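import Mathlib.Analysis.InnerProductSpace.PiL2
import Literature.MathematicalPhysics.StatisticalMechanics.Theil2006PeriodicLatticeStructure
import Literature.MathematicalPhysics.StatisticalMechanics.Theil2006DirichletMinimumDistance
import Literature.MathematicalPhysics.StatisticalMechanics.Theil2006LatticeSymmetry
import Literature.MathematicalPhysics.StatisticalMechanics.Theil2006Periodic
import HarnessLib

/-!
# Theil 2006, §3 (pp. 13–15): periodic and Dirichlet ground states from the main estimate (44)

MERGED FILING (lit-1 g53, 2026-08-25): this module is the verbatim concatenation — `import` lines
merged, nothing else changed — of four separately lean-verified bricks of the cell `pub-crystal3d`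
lit lane that were staged as the would-be modules `Theil2006DirichletPeriodization` (row 2b),
`Theil2006DirichletPeriodicComparison` (3), `Theil2006DirichletLatticeStructure` (4) and
`Theil2006RelaxedMinimizers`; they are filed as ONE module only to shorten the accept → build →
accept chain of the dependency path 2b → 3 → 4 → RelaxedMinimizers (the gate caps a proposal at
200 000 bytes, which is why the companion brick `Theil2006PeriodicFromFinite`, row 2c, stays a
separate module). Each part keeps its own
module docstring below (headed `#`), with its citations as printed. Source throughout: F. Theil,
*A proof of crystallization in two dimensions*, Comm. Math. Phys. 262 (2006) 209–236
[cite: Theil2006, §3 pp. 13–15; §2.1 Thm 2.1; (9), (44), (45), (46)].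
-/

/-! # Part: staged brick `Theil2006DirichletPeriodization` (sha16 53eda4d5f2a7a8c9) — verbatim -/

/-!
# Theil 2006, Corollary 1.3 — the periodization `Y`, `X_per`, `y_per` of a clamped configuration
(§3, Proof of Corollary 1.3, preprint pp. 14–15)

Topic `Literature/MathematicalPhysics/StatisticalMechanics`; companion of `Theil2006.lean` (the
model), `Theil2006PeriodicMinimumDistance.lean` (`IsPeriodicSet`, `relaxedPeriodicEnergy`,
`cellEquiv`, `IsPeriodicSet.tsum_eq_sum_tsum`) and `Theil2006PeriodicLatticeStructure.lean`
(`cellClasses`, `rowEnergy`, `IsPeriodic.rowEnergy_add_zsmul`). Everything in this file is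
PROVED (no `sorry`, no named fact introduced or discharged; D-0026); the definitions have bodies.

## Source, as printed

F. Theil, *A proof of crystallization in two dimensions*, Comm. Math. Phys. **262** (2006)
209–236, §3, Proof of Corollary 1.3 (read in the author's accepted preprint of 26 Aug 2005,
same numbering, pp. 14–15; lit store `paper:url-69bff4ce1e30`). After "Clearly `y_min` satisfies
the bound (13) …" (the relaxed Dirichlet minimizer `(𝒜_min, y_min)`,
`X = (A₂ ∖ 𝒜) ∪ 𝒜_min`):

p. 14: "We determine the properties of `𝒜_min, y_min` by comparing the minimization problem
with the periodic situation which has been analyzed earlier.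
  Let `Y = A₂ ∩ (L/2) (2 1; 0 √3) Q − (L/4) (3, √3)` where `Q = [0,1) × [0,1) ⊂ ℝ²` is the
semi-open unit square and let `X_per := Y + LA₂` and `y_per(x) := τ + y_min(x − τ)` if
`x ∈ X_per`, `τ ∈ LA₂`, `x + τ ∈ Y`. Clearly `X_per` is `L`-periodic and `y_per` is a projection
of `y_min` onto the set of `L`-periodic maps. Due to the compactness of `𝒜` we can assume that
`A ⊂ B(0, C)` for some number `C > 0`."
p. 15: "[…] By equation (44) `I ≤ E_L^per(Y + LA₂, {y_per}) + 3L³ [sic] = …`", "… As `ε` is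
arbitrary and `L² − #Y = #𝒜 ∖ 𝒜_min` for sufficiently large `L` …".

In labels (`A₂ = triPoint(ℤ²)`, `(m, n) ↦ ½(2m + n, √3 n)`): `(L/2)(2 1; 0 √3) Q − (L/4)(3, √3)`
is the image of the real label box `[−L/2, L/2)²`, so `Y` is the set of labels of `X` in the
centred period cell `[−⌊L/2⌋, L − ⌊L/2⌋)² ∩ ℤ²` — a fundamental domain of `ℤ² / Lℤ²`.

## What is here

* `Theil2006.centredCell L` — the centred period cell `Y_L = [−m, L−m)²`, `m = ⌊L/2⌋`, as a
  `Finset (ℤ × ℤ)` (`card = L²`; `mem_centredCell_iff`); `Theil2006.centredRep hL k ∈ Y_L` and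
  `Theil2006.centredQuot hL k ∈ ℤ²` with `k = centredRep k + L · centredQuot k`
  (`Theil2006.centredEquiv hL : Y_L × ℤ² ≃ ℤ²`).
* `Theil2006.periodizeSet hL X` (`X_per := Y + LA₂` with `Y = X ∩ Y_L`) and
  `Theil2006.periodize hL y` (`y_per(x) := τ + y(x − τ)`, `τ ∈ LA₂`, `x − τ ∈ Y_L`): `L`-periodic
  (`isPeriodicSet_periodizeSet`, `isPeriodic_periodize`), equal to `X`, `y` on `Y_L`
  ("`y_per(x) = y_min(x)` for all `x ∈ Y`", p. 15), the identity lattice wherever `y` is.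
* `Theil2006.card_cellClasses_periodizeSet` — `#X̃_per = #(X ∩ Y_L)`, and
  `Theil2006.card_cellClasses_periodizeSet_eq` — "`L² − #Y = #𝒜 ∖ 𝒜_min` for sufficiently large
  `L`" (as soon as `𝒜 ⊆ Y_L`), for `X = (A₂ ∖ 𝒜) ∪ 𝒜_min`.
* `Theil2006.sum_cellPoint_eq_sum_centredCell`, `Theil2006.tsum_periodizeSet_eq` — sums over
  the representatives `A₂ ∩ LU` of the tree's periodic vocabulary are sums over `Y_L`
  ("… and the elements of those quotient sets by representatives", p. 14), and
  `∑_{x' ∈ X_per} φ(x') = ∑_{x₀ ∈ X ∩ Y_L} ∑_{g ∈ ℤ²} φ(x₀ + Lg)`;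
  `Theil2006.relaxedPeriodicEnergy_periodize_eq` — `E_L^per(X_per, {y_per})` as the sum of the
  rows of the particles `x ∈ X ∩ Y_L`.
* `Theil2006.lt_dist_periodize` — **(13) survives periodization**: if `y ∈ Y_𝒜^Dir` satisfies
  (13) on `X ⊇ A₂ ∖ 𝒜`, its free particles lie in `B(0, R)` and `𝒜 ⊆ Y_L`, `L ≥ 2R + 2`, then
  `(X_per, y_per)` satisfies (13) — the hypothesis under which (44) is claimed (p. 14: "for
  configurations `X, y` which satisfy the bound (13) a suitably adapted version of (9) holds").

## Rendering notes

* **Print flag (p. 14).** "`Y = A₂ ∩ …`" must be read "`Y = X ∩ …`" with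
  `X = (A₂ ∖ 𝒜) ∪ 𝒜_min` the particles of the relaxed minimizer: with `Y = A₂ ∩ …` one would
  have `#Y = L²` and `X_per = A₂`, contradicting "`L² − #Y = #𝒜 ∖ 𝒜_min`" (p. 15) and the term
  `3(L² − #Y)` of `I`. We periodize the pair: `periodizeSet hL X` (labels) and `periodize hL y`
  (positions); "`x + τ ∈ Y`" (p. 14, once) is "`x − τ ∈ Y`" as in the formula for `y_per`.
* "`3L³`" in the first line of the p. 15 display is a misprint for `3L²` (second line, and
  (44)); nothing in this file depends on it.
* The cell is centred with `m = ⌊L/2⌋`; for odd `L` this is the paper's `[−L/2, L/2) ∩ ℤ`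
  exactly, for even `L` likewise. `L ≥ 1` throughout (`hL : 0 < L`).
-/

noncomputable section

open scoped BigOperators Topology
open Filter Set Metric

namespace Literature.MathematicalPhysics.StatisticalMechanics

namespace Theil2006

/-- `triPoint (L g) = L · triPoint g` (local copy of a private lemma of
`Theil2006PeriodicMinimumDistance.lean`). [folklore] -/
private theorem triPoint_zsmul'' (L : ℕ) (g : ℤ × ℤ) :
    triPoint ((L : ℤ) • g) = (L : ℝ) • triPoint g := by
  rw [map_zsmul, ← Int.cast_smul_eq_zsmul ℝ, Int.cast_natCast]

/-! ### The centred period cell `Y_L` and its representatives -/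

section Cell

variable {L : ℕ}

/-- The centring shift `s_L = (⌊L/2⌋, ⌊L/2⌋)` of the period cell. [cite: Theil2006, §3 Proof of Corollary 1.3 («Y = … − (L/4)(3,√3)», preprint p. 14)] -/
def cellShift (L : ℕ) : ℤ × ℤ := (((L / 2 : ℕ) : ℤ), ((L / 2 : ℕ) : ℤ))

/-- **The centred period cell** `Y_L = A₂ ∩ (L/2)(2 1; 0 √3) Q − (L/4)(3, √3)` of p. 14, in
labels: `[−m, L − m)² ∩ ℤ²`, `m = ⌊L/2⌋` — the translate by `−s_L` of the representatives
`A₂ ∩ LU` (`cellPoint`). [cite: Theil2006, §3 Proof of Corollary 1.3 (preprint p. 14)] -/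
def centredCell (L : ℕ) : Finset (ℤ × ℤ) :=
  Finset.univ.image fun c : Fin L × Fin L => cellPoint c - cellShift L

/-- `c ↦ cellPoint c − s_L` is injective. [folklore] -/
private theorem cellPoint_sub_cellShift_injective (L : ℕ) :
    Function.Injective fun c : Fin L × Fin L => cellPoint c - cellShift L := by
  intro c c' h
  have h' : cellPoint c = cellPoint c' := sub_left_injective h
  simp only [cellPoint, Prod.mk.injEq, Nat.cast_inj] at h'
  exact Prod.ext (Fin.ext h'.1) (Fin.ext h'.2)

/-- `#Y_L = L²`. [cite: Theil2006, §3 Proof of Corollary 1.3 (preprint pp. 14–15)] -/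
theorem card_centredCell (L : ℕ) : (centredCell L).card = L ^ 2 := by
  rw [centredCell, Finset.card_image_of_injective _ (cellPoint_sub_cellShift_injective L),
    Finset.card_univ, Fintype.card_prod, Fintype.card_fin, sq]

/-- Membership in `Y_L` by coordinates: `−m ≤ kᵢ < L − m`, `m = ⌊L/2⌋`.
[cite: Theil2006, §3 Proof of Corollary 1.3 (preprint p. 14)] -/
theorem mem_centredCell_iff {k : ℤ × ℤ} :
    k ∈ centredCell L ↔ (-((L / 2 : ℕ) : ℤ) ≤ k.1 ∧ k.1 < L - ((L / 2 : ℕ) : ℤ)) ∧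
      (-((L / 2 : ℕ) : ℤ) ≤ k.2 ∧ k.2 < L - ((L / 2 : ℕ) : ℤ)) := by
  rw [centredCell, Finset.mem_image]
  constructor
  · rintro ⟨c, -, rfl⟩
    simp only [cellPoint, cellShift, Prod.fst_sub, Prod.snd_sub]
    have h1 := c.1.isLt
    have h2 := c.2.isLt
    omega
  · rintro ⟨⟨h1, h2⟩, h3, h4⟩
    refine ⟨(⟨(k.1 + (L / 2 : ℕ)).toNat, by omega⟩, ⟨(k.2 + (L / 2 : ℕ)).toNat, by omega⟩),
      Finset.mem_univ _, ?_⟩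
    ext <;> simp only [cellPoint, cellShift, Prod.fst_sub, Prod.snd_sub] <;> omega

/-- Labels of sup-norm `≤ R` lie in `Y_L` once `L ≥ 2R + 2` ("for sufficiently large `L`",
p. 15). [cite: Theil2006, §3 Proof of Corollary 1.3 (preprint p. 15)] -/
theorem mem_centredCell_of_abs_le {k : ℤ × ℤ} {R : ℕ} (h1 : |k.1| ≤ R) (h2 : |k.2| ≤ R)
    (hL : 2 * R + 2 ≤ L) : k ∈ centredCell L := by
  rw [mem_centredCell_iff]
  rw [abs_le] at h1 h2
  have hm : ((L / 2 : ℕ) : ℤ) = (L : ℤ) / 2 := Int.natCast_div L 2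
  omega

/-- **The representative in `Y_L`** of a label modulo `L ℤ²`. [cite: Theil2006, §3 Proof of Corollary 1.3 («x − τ ∈ Y», preprint p. 14)] -/
def centredRep (hL : 0 < L) (k : ℤ × ℤ) : ℤ × ℤ :=
  cellPoint ((cellEquiv hL).symm (k + cellShift L)).1 - cellShift L

/-- **The period vector** `g ∈ ℤ²` with `k = centredRep k + L g` (`τ = L ξ_g ∈ LA₂`).
[cite: Theil2006, §3 Proof of Corollary 1.3 («τ ∈ LA₂, x − τ ∈ Y», preprint p. 14)] -/
def centredQuot (hL : 0 < L) (k : ℤ × ℤ) : ℤ × ℤ :=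
  ((cellEquiv hL).symm (k + cellShift L)).2

/-- `k = centredRep k + L · centredQuot k`. [cite: Theil2006, §3 Proof of Corollary 1.3 (preprint p. 14)] -/
theorem centredRep_add_zsmul_centredQuot (hL : 0 < L) (k : ℤ × ℤ) :
    centredRep hL k + (L : ℤ) • centredQuot hL k = k := by
  have h := cellEquiv_symm_apply_spec hL (k + cellShift L)
  unfold centredRep centredQuot
  rw [sub_add_eq_add_sub, h, add_sub_cancel_right]

/-- The representative lies in `Y_L`. [cite: Theil2006, §3 Proof of Corollary 1.3 (preprint p. 14)] -/
theorem centredRep_mem (hL : 0 < L) (k : ℤ × ℤ) : centredRep hL k ∈ centredCell L :=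
  Finset.mem_image.2 ⟨_, Finset.mem_univ _, rfl⟩

/-- Representative and period vector of `x₀ + L g`, `x₀ ∈ Y_L`. [cite: Theil2006, §3 Proof of Corollary 1.3 (preprint p. 14)] -/
theorem centredRep_add_zsmul_of_mem (hL : 0 < L) {x₀ : ℤ × ℤ} (hx₀ : x₀ ∈ centredCell L)
    (g : ℤ × ℤ) : centredRep hL (x₀ + (L : ℤ) • g) = x₀ ∧ centredQuot hL (x₀ + (L : ℤ) • g) = g := by
  obtain ⟨c, -, rfl⟩ := Finset.mem_image.1 hx₀
  have e : cellPoint c - cellShift L + (L : ℤ) • g + cellShift L = cellPoint c + (L : ℤ) • g := by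
    abel
  unfold centredRep centredQuot
  rw [e, cellEquiv_symm_cellPoint_add]
  exact ⟨rfl, rfl⟩

/-- On `Y_L` the representative is the label itself. [cite: Theil2006, §3 Proof of Corollary 1.3 (preprint p. 14)] -/
theorem centredRep_of_mem (hL : 0 < L) {x₀ : ℤ × ℤ} (hx₀ : x₀ ∈ centredCell L) :
    centredRep hL x₀ = x₀ ∧ centredQuot hL x₀ = 0 := by
  have h := centredRep_add_zsmul_of_mem hL hx₀ 0
  rwa [smul_zero, add_zero] at h

/-- Representatives are `L ℤ²`-invariant; period vectors shift. [cite: Theil2006, §3 Proof of Corollary 1.3 (preprint p. 14)] -/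
theorem centredRep_add_zsmul (hL : 0 < L) (k g : ℤ × ℤ) :
    centredRep hL (k + (L : ℤ) • g) = centredRep hL k ∧
      centredQuot hL (k + (L : ℤ) • g) = centredQuot hL k + g := by
  have e : k + (L : ℤ) • g = centredRep hL k + (L : ℤ) • (centredQuot hL k + g) := by
    conv_lhs => rw [← centredRep_add_zsmul_centredQuot hL k]
    rw [smul_add]
    abel
  rw [e]
  exact centredRep_add_zsmul_of_mem hL (centredRep_mem hL k) _

/-- **`Y_L × ℤ² ≅ ℤ²`, `(x₀, g) ↦ x₀ + L g`**: `Y_L` is a fundamental domain of `ℤ² / Lℤ²`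
("`X_per := Y + LA₂`", p. 14). [cite: Theil2006, §3 Proof of Corollary 1.3 (preprint p. 14)] -/
def centredEquiv (hL : 0 < L) : ↥(centredCell L) × (ℤ × ℤ) ≃ ℤ × ℤ where
  toFun q := (q.1 : ℤ × ℤ) + (L : ℤ) • q.2
  invFun k := (⟨centredRep hL k, centredRep_mem hL k⟩, centredQuot hL k)
  left_inv q := by
    obtain ⟨⟨x₀, hx₀⟩, g⟩ := q
    have h := centredRep_add_zsmul_of_mem hL hx₀ g
    exact Prod.ext (Subtype.ext h.1) h.2
  right_inv k := centredRep_add_zsmul_centredQuot hL k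

/-- `centredEquiv (x₀, g) = x₀ + L g`. [cite: Theil2006, §3 Proof of Corollary 1.3 (preprint p. 14)] -/
@[simp] theorem centredEquiv_apply (hL : 0 < L) (q : ↥(centredCell L) × (ℤ × ℤ)) :
    centredEquiv hL q = (q.1 : ℤ × ℤ) + (L : ℤ) • q.2 := rfl

/-- **The class map `Y_L ≅ A₂ ∩ LU`**: each point of the centred cell has the class of exactly one
standard representative `cellPoint c`, and `c ↦ centredRep (cellPoint c)` is the inverse.
[cite: Theil2006, §1 («we identify … A₂ mod LA₂ with the representatives A₂ ∩ LU», preprint p. 2); §3 (p. 14)] -/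
def cellClassEquiv (hL : 0 < L) : (Fin L × Fin L) ≃ ↥(centredCell L) where
  toFun c := ⟨centredRep hL (cellPoint c), centredRep_mem hL _⟩
  invFun x := ((cellEquiv hL).symm (x : ℤ × ℤ)).1
  left_inv c := by
    have e : centredRep hL (cellPoint c) =
        cellPoint c + (L : ℤ) • (-centredQuot hL (cellPoint c)) := by
      rw [smul_neg, ← sub_eq_add_neg]
      exact eq_sub_of_add_eq (centredRep_add_zsmul_centredQuot hL (cellPoint c))
    show ((cellEquiv hL).symm (centredRep hL (cellPoint c))).1 = c
    rw [e, cellEquiv_symm_cellPoint_add]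
  right_inv x := by
    obtain ⟨x, hx⟩ := x
    apply Subtype.ext
    show centredRep hL (cellPoint ((cellEquiv hL).symm x).1) = x
    have e : cellPoint ((cellEquiv hL).symm x).1 = x + (L : ℤ) • (-((cellEquiv hL).symm x).2) := by
      rw [smul_neg, ← sub_eq_add_neg]
      exact eq_sub_of_add_eq (cellEquiv_symm_apply_spec hL x)
    rw [e, (centredRep_add_zsmul_of_mem hL hx _).1]

/-- `cellClassEquiv c` and `cellPoint c` differ by a period vector.
[cite: Theil2006, §3 Proof of Corollary 1.3 (preprint p. 14)] -/
theorem cellClassEquiv_spec (hL : 0 < L) (c : Fin L × Fin L) :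
    (cellClassEquiv hL c : ℤ × ℤ) + (L : ℤ) • centredQuot hL (cellPoint c) = cellPoint c :=
  centredRep_add_zsmul_centredQuot hL (cellPoint c)

/-- **Sums over the representatives `A₂ ∩ LU` are sums over `Y_L`** for `Lℤ²`-invariant
summands ("the elements of those quotient sets by representatives", p. 14).
[cite: Theil2006, §3 (preprint p. 14); our lemma] -/
theorem sum_cellPoint_eq_sum_centredCell (hL : 0 < L) {F : ℤ × ℤ → ℝ}
    (hF : ∀ k g : ℤ × ℤ, F (k + (L : ℤ) • g) = F k) :
    ∑ c : Fin L × Fin L, F (cellPoint c) = ∑ x ∈ centredCell L, F x := by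
  have h1 : ∀ c : Fin L × Fin L, F (cellPoint c) = F (cellClassEquiv hL c : ℤ × ℤ) := fun c => by
    conv_lhs => rw [← cellClassEquiv_spec hL c]
    rw [hF]
  simp_rw [h1]
  rw [(cellClassEquiv hL).sum_comp (fun x : ↥(centredCell L) => F (x : ℤ × ℤ)),
    Finset.sum_coe_sort]

end Cell

/-! ### The periodized configuration `(X_per, y_per)` -/

section Periodize

variable {L : ℕ} {X : Set (ℤ × ℤ)} {y : ℤ × ℤ → Plane}

/-- **`X_per := Y + LA₂`** (p. 14) for `Y = X ∩ Y_L`: the labels whose representative in the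
centred cell belongs to `X`. [cite: Theil2006, §3 Proof of Corollary 1.3 (preprint p. 14)] -/
def periodizeSet (hL : 0 < L) (X : Set (ℤ × ℤ)) : Set (ℤ × ℤ) :=
  {k | centredRep hL k ∈ X}

/-- **`y_per(x) := τ + y(x − τ)`, `τ ∈ LA₂`, `x − τ ∈ Y`** (p. 14): the `L A₂`-periodic
extension of `y|_{Y_L}`. [cite: Theil2006, §3 Proof of Corollary 1.3 (preprint p. 14)] -/
def periodize (hL : 0 < L) (y : ℤ × ℤ → Plane) (k : ℤ × ℤ) : Plane :=
  y (centredRep hL k) + (L : ℝ) • triPoint (centredQuot hL k)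

/-- "Clearly `X_per` is `L`-periodic". [cite: Theil2006, §3 Proof of Corollary 1.3 (preprint p. 14)] -/
theorem isPeriodicSet_periodizeSet (hL : 0 < L) (X : Set (ℤ × ℤ)) :
    IsPeriodicSet L (periodizeSet hL X) := by
  intro k hk g
  simp only [periodizeSet, mem_setOf_eq] at hk ⊢
  rwa [(centredRep_add_zsmul hL k g).1]

/-- Membership in `X_per` along a coset of a cell point. [cite: Theil2006, §3 Proof of Corollary 1.3 (preprint p. 14)] -/
theorem add_zsmul_mem_periodizeSet_iff (hL : 0 < L) {x₀ : ℤ × ℤ} (hx₀ : x₀ ∈ centredCell L)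
    (g : ℤ × ℤ) : x₀ + (L : ℤ) • g ∈ periodizeSet hL X ↔ x₀ ∈ X := by
  simp only [periodizeSet, mem_setOf_eq, (centredRep_add_zsmul_of_mem hL hx₀ g).1]

/-- On the cell, `X_per` is `X` (`X_per ∩ Y_L = X ∩ Y_L = Y`). [cite: Theil2006, §3 Proof of Corollary 1.3 (preprint p. 14)] -/
theorem mem_periodizeSet_iff_of_mem (hL : 0 < L) {x₀ : ℤ × ℤ} (hx₀ : x₀ ∈ centredCell L) :
    x₀ ∈ periodizeSet hL X ↔ x₀ ∈ X := by
  simp only [periodizeSet, mem_setOf_eq, (centredRep_of_mem hL hx₀).1]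

/-- Membership in `X_per` of a general label. [cite: Theil2006, §3 Proof of Corollary 1.3 (preprint p. 14)] -/
theorem mem_periodizeSet_iff (hL : 0 < L) {k : ℤ × ℤ} :
    k ∈ periodizeSet hL X ↔ centredRep hL k ∈ X := Iff.rfl

/-- `y_per(x₀ + L g) = y(x₀) + L ξ_g` for `x₀ ∈ Y_L`. [cite: Theil2006, §3 Proof of Corollary 1.3 (preprint p. 14)] -/
theorem periodize_add_zsmul_of_mem (hL : 0 < L) {x₀ : ℤ × ℤ} (hx₀ : x₀ ∈ centredCell L)
    (g : ℤ × ℤ) : periodize hL y (x₀ + (L : ℤ) • g) = y x₀ + (L : ℝ) • triPoint g := by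
  have h := centredRep_add_zsmul_of_mem hL hx₀ g
  rw [periodize, h.1, h.2]

/-- "Since `y_per(x) = y_min(x)` for all `x ∈ Y`" (p. 15). [cite: Theil2006, §3 Proof of Corollary 1.3 (preprint p. 15)] -/
theorem periodize_of_mem (hL : 0 < L) {x₀ : ℤ × ℤ} (hx₀ : x₀ ∈ centredCell L) :
    periodize hL y x₀ = y x₀ := by
  have h := periodize_add_zsmul_of_mem hL hx₀ 0 (y := y)
  simpa using h

/-- `y_per` in terms of the representative of a general label. [cite: Theil2006, §3 Proof of Corollary 1.3 (preprint p. 14)] -/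
theorem periodize_apply (hL : 0 < L) (k : ℤ × ℤ) :
    periodize hL y k = y (centredRep hL k) + (L : ℝ) • triPoint (centredQuot hL k) := rfl

/-- "`y_per` is a projection of `y_min` onto the set of `L`-periodic maps": `y_per ∈ Y_L^per`.
[cite: Theil2006, §3 Proof of Corollary 1.3 (preprint p. 14)] -/
theorem isPeriodic_periodize (hL : 0 < L) (y : ℤ × ℤ → Plane) : IsPeriodic L (periodize hL y) := by
  intro k g
  have h := centredRep_add_zsmul hL k g
  rw [periodize, periodize, h.1, h.2, triPoint_zsmul'', map_add, smul_add]
  abel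

/-- **Where `y` is the lattice, so is `y_per`**: if `y(x₀) = x₀` at the representative `x₀` of
`k`, then `y_per(k) = k`. [cite: Theil2006, §3 Proof of Corollary 1.3 (preprint p. 14)] -/
theorem periodize_eq_triPoint (hL : 0 < L) {k : ℤ × ℤ}
    (hk : y (centredRep hL k) = triPoint (centredRep hL k)) : periodize hL y k = triPoint k := by
  rw [periodize, hk, ← triPoint_zsmul'', ← map_add, centredRep_add_zsmul_centredQuot]

end Periodize

/-! ### Counting classes: `#X̃_per = #Y` and `L² − #Y = #(𝒜 ∖ 𝒜_min)` -/

section Classes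

variable {L : ℕ} {X : Set (ℤ × ℤ)}

/-- `#X̃_per = #(X ∩ Y_L)`: the classes of `X_per` are those of the points of `Y = X ∩ Y_L`.
[cite: Theil2006, §3 Proof of Corollary 1.3 (preprint pp. 14–15)] -/
theorem card_cellClasses_periodizeSet (hL : 0 < L) (X : Set (ℤ × ℤ)) [DecidablePred (· ∈ X)] :
    (cellClasses L (periodizeSet hL X)).card = ((centredCell L).filter (· ∈ X)).card := by
  -- `c ↦ centredRep (cellPoint c)` is a bijection onto `Y_L` carrying `cellPoint c ∈ X_per` to `· ∈ X`
  refine Finset.card_bij' (fun c _ => (cellClassEquiv hL c : ℤ × ℤ))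
    (fun x hx => (cellClassEquiv hL).symm ⟨x, (Finset.mem_filter.1 hx).1⟩)
    (fun c hc => ?_) (fun x hx => ?_) (fun c _ => ?_) (fun x _ => ?_)
  · exact Finset.mem_filter.2 ⟨(cellClassEquiv hL c).2, mem_cellClasses.1 hc⟩
  · rw [mem_cellClasses, mem_periodizeSet_iff]
    have e : centredRep hL (cellPoint ((cellClassEquiv hL).symm ⟨x, (Finset.mem_filter.1 hx).1⟩)) =
        ((cellClassEquiv hL) ((cellClassEquiv hL).symm ⟨x, (Finset.mem_filter.1 hx).1⟩) : ℤ × ℤ) :=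
      rfl
    rw [e, (cellClassEquiv hL).apply_symm_apply]
    exact (Finset.mem_filter.1 hx).2
  · rw [Subtype.coe_eta, Equiv.symm_apply_apply]
  · rw [Equiv.apply_symm_apply]

/-- **"`L² − #Y = #𝒜 ∖ 𝒜_min` for sufficiently large `L`"** (p. 15): for the particles
`X = (A₂ ∖ 𝒜) ∪ 𝒜'` of the relaxed Dirichlet problem and `𝒜 ⊆ Y_L`,
`#X̃_per = L² − #(𝒜 ∖ 𝒜')`. [cite: Theil2006, §3 Proof of Corollary 1.3 (preprint p. 15)] -/
theorem card_cellClasses_periodizeSet_eq (hL : 0 < L) {A A' : Finset (ℤ × ℤ)}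
    (hAY : A ⊆ centredCell L) :
    ((cellClasses L (periodizeSet hL {k | k ∉ A ∨ k ∈ A'})).card : ℤ) =
      (L : ℤ) ^ 2 - ((A \ A').card : ℤ) := by
  classical
  rw [card_cellClasses_periodizeSet hL]
  have hset : (centredCell L).filter (· ∈ ({k | k ∉ A ∨ k ∈ A'} : Set (ℤ × ℤ))) =
      centredCell L \ (A \ A') := by
    ext k
    simp only [Finset.mem_filter, mem_setOf_eq, Finset.mem_sdiff]
    tauto
  rw [hset, Finset.card_sdiff_of_subset (Finset.sdiff_subset.trans hAY), card_centredCell,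
    Nat.cast_sub ((Finset.card_le_card Finset.sdiff_subset).trans
      ((Finset.card_le_card hAY).trans (card_centredCell L).le)), Nat.cast_pow]

end Classes

/-! ### Sums over `X_per` and the energy of the periodized pair -/

section Sums

variable {L : ℕ} {X : Set (ℤ × ℤ)} {y : ℤ × ℤ → Plane} {V : ℝ → ℝ}

/-- **Summing over `X_per` coset by coset from the centred cell**: for a summable `φ`,
`∑_{x' ∈ X_per} φ(x') = ∑_{x₀ ∈ X ∩ Y_L} ∑_{g ∈ ℤ²} φ(x₀ + Lg)`.
[cite: Theil2006, §3 (preprint p. 14: quotient sets by representatives); our lemma] -/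
theorem tsum_periodizeSet_eq (hL : 0 < L) (X : Set (ℤ × ℤ)) [DecidablePred (· ∈ X)]
    {φ : ℤ × ℤ → ℝ} (hφ : Summable φ) :
    ∑' k : periodizeSet hL X, φ k =
      ∑ x₀ ∈ (centredCell L).filter (· ∈ X), ∑' g : ℤ × ℤ, φ (x₀ + (L : ℤ) • g) := by
  classical
  rw [(isPeriodicSet_periodizeSet hL X).tsum_eq_sum_tsum hL (cellClasses L (periodizeSet hL X))
    (fun c => mem_cellClasses) hφ]
  -- move each representative `cellPoint c` to `centredRep (cellPoint c) ∈ Y_L`, shifting `g`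
  have h1 : ∀ c : Fin L × Fin L, ∑' g : ℤ × ℤ, φ (cellPoint c + (L : ℤ) • g) =
      ∑' g : ℤ × ℤ, φ ((cellClassEquiv hL c : ℤ × ℤ) + (L : ℤ) • g) := by
    intro c
    set q := centredQuot hL (cellPoint c) with hq
    have spec : (cellClassEquiv hL c : ℤ × ℤ) + (L : ℤ) • q = cellPoint c := cellClassEquiv_spec hL c
    rw [← (Equiv.addRight q).tsum_eq fun g => φ ((cellClassEquiv hL c : ℤ × ℤ) + (L : ℤ) • g)]
    refine tsum_congr fun g => ?_
    simp only [Equiv.coe_addRight]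
    rw [← spec, smul_add]
    congr 1
    abel
  rw [Finset.sum_congr rfl fun c _ => h1 c]
  -- reindex the finite sum along `cellClassEquiv`
  refine Finset.sum_bij' (fun c _ => (cellClassEquiv hL c : ℤ × ℤ))
    (fun x hx => (cellClassEquiv hL).symm ⟨x, (Finset.mem_filter.1 hx).1⟩)
    (fun c hc => ?_) (fun x hx => ?_) (fun c _ => ?_) (fun x _ => ?_) (fun c _ => rfl)
  · exact Finset.mem_filter.2 ⟨(cellClassEquiv hL c).2, mem_cellClasses.1 hc⟩
  · rw [mem_cellClasses, mem_periodizeSet_iff]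
    have e : centredRep hL (cellPoint ((cellClassEquiv hL).symm ⟨x, (Finset.mem_filter.1 hx).1⟩)) =
        ((cellClassEquiv hL) ((cellClassEquiv hL).symm ⟨x, (Finset.mem_filter.1 hx).1⟩) : ℤ × ℤ) :=
      rfl
    rw [e, (cellClassEquiv hL).apply_symm_apply]
    exact (Finset.mem_filter.1 hx).2
  · rw [Subtype.coe_eta, Equiv.symm_apply_apply]
  · rw [Equiv.apply_symm_apply]

/-- **`E_L^per(X_per, {y_per})` as the sum of the rows of `Y = X ∩ Y_L`**:
`E_L^per(X_per, {y_per}) = ∑_{x ∈ X ∩ Y_L} ∑_{x' ∈ X_per ∖ {x}} V(|y_per(x) − y_per(x')|)` (ordered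
form, as `relaxedPeriodicEnergy`). [cite: Theil2006, §3 Proof of Corollary 1.3 («rewriting E_L^per in a more explicit way», preprint p. 15)] -/
theorem relaxedPeriodicEnergy_periodize_eq (hL : 0 < L) (V : ℝ → ℝ) (X : Set (ℤ × ℤ))
    [DecidablePred (· ∈ X)] (y : ℤ × ℤ → Plane) :
    relaxedPeriodicEnergy V L (periodizeSet hL X) (periodize hL y) =
      ∑ x ∈ (centredCell L).filter (· ∈ X),
        rowEnergy V (periodizeSet hL X) (periodize hL y) x := by
  classical
  rw [relaxedPeriodicEnergy_eq_sum_rowEnergy,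
    sum_cellPoint_eq_sum_centredCell hL (F := (periodizeSet hL X).indicator
      (rowEnergy V (periodizeSet hL X) (periodize hL y)))]
  · rw [Finset.sum_filter]
    refine Finset.sum_congr rfl fun x hx => ?_
    by_cases hxX : x ∈ X
    · rw [if_pos hxX, indicator_of_mem ((mem_periodizeSet_iff_of_mem hL hx).2 hxX)]
    · rw [if_neg hxX, indicator_of_notMem (fun h => hxX ((mem_periodizeSet_iff_of_mem hL hx).1 h))]
  · intro k g
    have hXp := isPeriodicSet_periodizeSet hL X
    by_cases hk : k ∈ periodizeSet hL X
    · rw [indicator_of_mem hk, indicator_of_mem (hXp k hk g),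
        (isPeriodic_periodize hL y).rowEnergy_add_zsmul hXp]
    · rw [indicator_of_notMem hk, indicator_of_notMem (fun h => hk ((hXp.add_zsmul_mem_iff k g).1 h))]

end Sums

/-! ### (13) survives periodization -/

section MinimumDistance

variable {L : ℕ} {X : Set (ℤ × ℤ)} {y : ℤ × ℤ → Plane} {A : Finset (ℤ × ℤ)} {α R : ℝ}

/-- **(13) for the periodized pair.** Let `y ∈ Y_𝒜^Dir` (the lattice off `𝒜`) satisfy (13) on a
set of particles `X ⊇ A₂ ∖ 𝒜`, with its free particles `y(x)`, `x ∈ X ∩ 𝒜`, in the disc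
`B(0, R)`, and let `𝒜 ⊆ Y_L`, `L ≥ 2R + 2`. Then `(X_per, y_per)` satisfies (13): two clamped
particles are lattice points (`≥ 1` apart); a free particle against a clamped one is a pair of
the original configuration (the clamped partner translated back is clamped, as `𝒜 ⊆ Y_L` is met
by one coset each); two free particles of different cells are `≥ L − 2R ≥ 2` apart. This is the
hypothesis under which (44) is asserted for `(X_per, y_per)` (p. 14).
[cite: Theil2006, §3 Proof of Corollary 1.3 (preprint pp. 14–15), with (13) (p. 6) and (44) (p. 14)] -/
theorem lt_dist_periodize (hL : 0 < L) (hα : 0 < α) (hXA : ∀ k, k ∉ X → k ∈ A)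
    (hy : IsClampedOutside A y)
    (h13 : ∀ k ∈ X, ∀ k' ∈ X, k ≠ k' → 1 - α < dist (y k) (y k'))
    (hconf : ∀ k ∈ X, k ∈ A → ‖y k‖ ≤ R) (hAY : A ⊆ centredCell L)
    (hLR : 2 * R + 2 ≤ L) :
    ∀ k ∈ periodizeSet hL X, ∀ k' ∈ periodizeSet hL X, k ≠ k' →
      1 - α < dist (periodize hL y k) (periodize hL y k') := by
  -- a clamped representative makes the periodized particle a lattice point
  have hlat : ∀ k : ℤ × ℤ, centredRep hL k ∉ A → periodize hL y k = triPoint k := fun k hk =>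
    periodize_eq_triPoint hL (hy _ hk)
  -- the key case: free against clamped
  have hmixed : ∀ k k' : ℤ × ℤ, centredRep hL k ∈ X → centredRep hL k ∈ A →
      centredRep hL k' ∉ A → 1 - α < dist (periodize hL y k) (periodize hL y k') := by
    intro k k' hkX hkA hk'A
    rw [hlat k' hk'A, periodize_apply]
    -- translate back by `L · centredQuot k`: the partner `z = k' − L g` is a clamped particle
    set x₀ := centredRep hL k
    set g := centredQuot hL k
    set z : ℤ × ℤ := k' - (L : ℤ) • g with hz
    have hzrep : centredRep hL z = centredRep hL k' := by
      have : z = k' + (L : ℤ) • (-g) := by rw [hz, smul_neg, sub_eq_add_neg]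
      rw [this, (centredRep_add_zsmul hL k' (-g)).1]
    have hzA : z ∉ A := by
      intro hzA
      have hzY : z ∈ centredCell L := hAY hzA
      have : centredRep hL z = z := (centredRep_of_mem hL hzY).1
      rw [hzrep] at this
      exact hk'A (this ▸ hzA)
    have hzX : z ∈ X := by
      by_contra h
      exact hzA (hXA z h)
    have hne : x₀ ≠ z := fun h => hzA (h ▸ hkA)
    have hd : dist (y x₀ + (L : ℝ) • triPoint g) (triPoint k') = dist (y x₀) (y z) := by
      rw [hy z hzA, hz, map_sub, triPoint_zsmul'', dist_eq_norm, dist_eq_norm]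
      congr 1
      abel
    rw [hd]
    exact h13 x₀ hkX z hzX hne
  intro k hk k' hk' hne
  rw [mem_periodizeSet_iff] at hk hk'
  by_cases hkA : centredRep hL k ∈ A <;> by_cases hk'A : centredRep hL k' ∈ A
  · -- both free
    rw [periodize_apply, periodize_apply]
    set x₀ := centredRep hL k with hx₀
    set x₀' := centredRep hL k' with hx₀'
    set g := centredQuot hL k with hg
    set g' := centredQuot hL k' with hg'
    by_cases hgg : g = g'
    · -- same cell: a pair of the original configuration
      have hne' : x₀ ≠ x₀' := by
        intro h
        apply hne
        rw [← centredRep_add_zsmul_centredQuot hL k, ← centredRep_add_zsmul_centredQuot hL k',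
          ← hx₀, ← hx₀', ← hg, ← hg', h, hgg]
      rw [hgg, dist_add_right]
      exact h13 x₀ hk x₀' hk' hne'
    · -- different cells: `≥ L − 2R ≥ 2` apart
      have hR0 : ‖y x₀‖ ≤ R := hconf x₀ hk hkA
      have hR1 : ‖y x₀'‖ ≤ R := hconf x₀' hk' hk'A
      have hgg' : g - g' ≠ 0 := sub_ne_zero.2 hgg
      have hLg : (L : ℝ) ≤ ‖(L : ℝ) • triPoint (g - g')‖ := by
        rw [norm_smul, Real.norm_natCast]
        have h1 := one_le_norm_triPoint hgg'
        have hL0 : (0 : ℝ) ≤ L := Nat.cast_nonneg _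
        nlinarith
      have hkey : (L : ℝ) - 2 * R ≤ dist (y x₀ + (L : ℝ) • triPoint g) (y x₀' + (L : ℝ) • triPoint g') := by
        rw [dist_eq_norm]
        have e : y x₀ + (L : ℝ) • triPoint g - (y x₀' + (L : ℝ) • triPoint g') =
            (L : ℝ) • triPoint (g - g') + (y x₀ - y x₀') := by
          rw [map_sub, smul_sub]; abel
        rw [e]
        have h2 := norm_sub_norm_le ((L : ℝ) • triPoint (g - g')) (-(y x₀ - y x₀'))
        rw [sub_neg_eq_add, norm_neg] at h2
        linarith [norm_sub_le (y x₀) (y x₀')]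
      have hα1 : 1 - α < 1 := by linarith
      linarith
  · exact hmixed k k' hk hkA hk'A
  · rw [dist_comm]
    exact hmixed k' k hk' hk'A hkA
  · -- both clamped: lattice points
    rw [hlat k hkA, hlat k' hk'A, dist_triPoint]
    have := one_le_norm_triPoint (sub_ne_zero.2 hne)
    linarith

end MinimumDistance

end Theil2006

end Literature.MathematicalPhysics.StatisticalMechanics

end

/-! # Part: staged brick `Theil2006DirichletPeriodicComparison` (sha16 0db5726ace15dba7) — verbatim -/

/-!
# Theil 2006, Corollary 1.3 — comparing the relaxed Dirichlet energy with the periodic energy of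
the periodized configuration (§3, Proof of Corollary 1.3, preprint p. 15: (45), (46) and
"rewriting `E_L^per` in a more explicit way")

Topic `Literature/MathematicalPhysics/StatisticalMechanics`; companion of
`Theil2006DirichletMinimumDistance.lean` (`relaxedDirichletEnergy`, the relaxed Dirichlet
problem) and `Theil2006DirichletPeriodization.lean` (`centredCell`, `periodizeSet`, `periodize`).
Everything in this file is PROVED (no `sorry`, no named fact introduced or discharged; D-0026).

## Source, as printed (preprint p. 15)

"By the decay properties of `V`, for all `ε > 0` there exists `L_ε ∈ ℕ` such that
(45) `∑_{p ∈ 𝒫_per | p ∩ 𝒜_min ≠ ∅} |e_per(p) − e(p)| ≤ ε`,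
(46) `∑_{p ∈ 𝒫_min ∖ 𝒫_per | p ∩ 𝒜_min ≠ ∅} |e(p)| ≤ ε`
if `L ≥ L_ε`. […] By equation (44)
`I ≤ E_L^per(Y + LA₂, {y_per}) + 3L³ [sic; 3L²]`
`  = ∑_{p ∈ 𝒫_per | p ∩ 𝒜_min ≠ ∅} e_per(p) + ½ ∑_{p ∈ 𝒫_per | p ∩ 𝒜_min = ∅, p ⊂ Y} e_per(p) + 3L²`.
The last equality is obtained by simply rewriting `E_L^per` in a more explicit way. By definition
of `𝒫_per` and `y_per` we can replace `𝒜_min` by `𝒜` and `e_per({x,x'})` by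
`e_r({x,x'}) := V(|x − x'|)` in the second sum without changing the value of the sum. By (45) and
(46) we can replace the periodic configuration `y_per` by the original minimum energy
configuration `y_min` and `𝒫_per` by `𝒫_min` in the first sum without changing its value by
more than `2ε`, hence
`I ≤ ∑_{p ∈ 𝒫_min | p ∩ 𝒜_min ≠ ∅} e(p) + ½ ∑_{p ∈ 𝒫_per | p ∩ 𝒜 = ∅, p ⊂ Y} e_r(p) + 3L² + 2ε`.
The first sum is equal to `E_𝒜(𝒜_min, {y_min})` and can be estimated by `E_𝒜(A₂)` due to the
minimality of `y_min`. Let `Z := Y ∪ 𝒜`. By definition of `Z` we can replace the set `Y` by `Z`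
and `𝒫_per` by `𝒫` in the second sum without changing it.
`I ≤ ∑_{p ∈ 𝒫 | p ∩ 𝒜 ≠ ∅} e_r(p) + ½ ∑_{p ∈ 𝒫 | p ∩ 𝒜 = ∅, p ⊂ Z} e_r(p) + 3L² + 2ε = E_L^per(A₂) + 3L² + 2ε = 2ε`,
where the last two equations follow directly from the definition of `E_L^per`."

## What is here — the rigorous form of this chain

For a finite hole `𝒜 ⊂ A₂`, retained particles `𝒜' ⊆ 𝒜`, `y ∈ Y_𝒜^Dir` (`X = (A₂ ∖ 𝒜) ∪ 𝒜'`),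
`V` satisfying (1)–(5) and `L` with `𝒜 ⊆ Y_L` (`X_per = periodizeSet`, `y_per = periodize`):

* `Theil2006.relaxedPeriodicEnergy_periodize_eq_dirichlet` — **the exact identity**
  `E_L^per(X_per, {y_per}) = 2 E(𝒜', {y}) − 2 E_𝒜(A₂) − 6 L² + err₁(L) − err₂(L)`
  (ordered normalisation of `relaxedPeriodicEnergy`, twice the printed: printed
  `E_L^per + 3L² = E(𝒜',{y}) − E_𝒜(A₂) + (err₁ − err₂)/2`), where `E_𝒜(A₂)` is the Dirichlet
  energy of the undeformed lattice (`dirichletEnergy V 𝒜 triPoint`) and `err₁`, `err₂` are finite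
  sums (over `𝒜' × 𝒜'`, `𝒜 × 𝒜`, …) of **coset tails**
  `τ_L(p, q) = ∑_{g ≠ 0} V(|p − q − L ξ_g|)` (`Theil2006.cosetTail`) — the interactions between
  different translates of the defect, i.e. the quantities bounded by (45) and (46).
* `Theil2006.IsAdmissible.abs_cosetTail_le` — **(45)/(46): the tails are small**,
  `|τ_L(p, q)| ≤ (2α/L⁵) ∑_{ξ ∈ A₂∖0} |ξ|⁻⁵` for `|p|, |q| ≤ R`, `L ≥ 4R + 3` (decay (12)).
* `Theil2006.relaxedPeriodicEnergy_periodize_le` — hence, for every `ε > 0` and `L ≥ L_ε`,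
  `E_L^per(X_per, {y_per}) + 6L² ≤ 2 (E(𝒜', {y}) − E_𝒜(A₂)) + ε`, and for a relaxed minimizer
  ("can be estimated by `E_𝒜(A₂)` due to the minimality of `y_min`")
  `E_L^per(X_per, {y_per})/2 + 3L² ≤ ε` (`Theil2006.IsRelaxedDirichletMinimizer.periodicEnergy_le`):
  the right-hand side of the chain, ready to be combined with (44).

The bookkeeping differs from the printed displays (which are loose: e.g. the first "rewriting"
omits the pairs between `Y ∖ 𝒜_min` and other cells), but proves exactly their net content: rows
of free particles are their Dirichlet rows up to tails ((45)); the rows of the clamped particles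
of one period, compared with the perfect-lattice rows (`−6` each by the normalization (1)),
resum EXACTLY over `Y_L × LA₂ ≅ A₂` to the clamped parts of the Dirichlet rows of the defect minus
those of the perfect lattice, up to tails ((46)); and `E_L^per(A₂) + 3L² = 0`.
-/

noncomputable section

open scoped BigOperators Topology
open Filter Set Metric

namespace Literature.MathematicalPhysics.StatisticalMechanics

namespace Theil2006

/-- `triPoint (L g) = L · triPoint g`. [folklore] -/
private theorem triPoint_zsmul₃ (L : ℕ) (g : ℤ × ℤ) :
    triPoint ((L : ℤ) • g) = (L : ℝ) • triPoint g := by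
  rw [map_zsmul, ← Int.cast_smul_eq_zsmul ℝ, Int.cast_natCast]

/-! ### Coset sums and their tails -/

section Coset

variable {α : ℝ} {V : ℝ → ℝ} {L : ℕ}

/-- For an admissible potential, `g ↦ V(|q − L ξ_g|)` is summable over `A₂` for every `q ∈ ℝ²`
and `L ≥ 1` (local copy of a private lemma of `Theil2006PeriodicMinimumDistance.lean`).
[folklore] -/
private theorem summable_norm_sub_smul₃ (hV : IsAdmissible α V) (hL : 0 < L) (q : Plane) :
    Summable fun g : ℤ × ℤ => V ‖q - (L : ℝ) • triPoint g‖ := by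
  have hL1 : (1 : ℝ) ≤ L := by exact_mod_cast hL
  have hL0 : (0 : ℝ) < L := by linarith
  set q' : Plane := (L : ℝ)⁻¹ • q with hq'
  have hscale : ∀ g, ‖q - (L : ℝ) • triPoint g‖ = L * ‖q' - triPoint g‖ := fun g => by
    have e : q - (L : ℝ) • triPoint g = (L : ℝ) • (q' - triPoint g) := by
      rw [hq', smul_sub, smul_inv_smul₀ hL0.ne']
    rw [e, norm_smul, Real.norm_natCast]
  refine Summable.of_norm_bounded_eventually
    ((summable_norm_triPoint_sub_rpow q' (by norm_num : (-5 : ℝ) < -2)).mul_left (α / 30)) ?_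
  filter_upwards [(tendsto_norm_sub_triPoint_cofinite q').eventually_ge_atTop (4 / 3)] with g hg
  rw [Real.norm_eq_abs, hscale]
  have h43 : 4 / 3 ≤ (L : ℝ) * ‖q' - triPoint g‖ := by nlinarith [norm_nonneg (q' - triPoint g)]
  refine (hV.abs_apply_le h43).trans ?_
  have hα := hV.alpha_nonneg
  have h0 : 0 < ‖q' - triPoint g‖ := by linarith
  rw [Real.rpow_neg (norm_nonneg _), norm_sub_rev (triPoint g) q', inv_pow]
  have e5 : ‖q' - triPoint g‖ ^ (5 : ℝ) = ‖q' - triPoint g‖ ^ 5 := by norm_cast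
  rw [e5]
  have h1 : ‖q' - triPoint g‖ ^ 5 ≤ ((L : ℝ) * ‖q' - triPoint g‖) ^ 5 := by
    apply pow_le_pow_left₀ h0.le; nlinarith
  have h2 : (((L : ℝ) * ‖q' - triPoint g‖) ^ 5)⁻¹ ≤ (‖q' - triPoint g‖ ^ 5)⁻¹ :=
    inv_anti₀ (by positivity) h1
  exact mul_le_mul_of_nonneg_left h2 (by positivity)

/-- **Coset sums converge**: `g ↦ V(|p − (q + L ξ_g)|)` is summable over `ℤ²` (admissible `V`,
`L ≥ 1`). [cite: Theil2006, §3 Proof of Corollary 1.3 («By the decay properties of V», preprint p. 15); our lemma] -/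
theorem IsAdmissible.summable_coset (hV : IsAdmissible α V) (hL : 0 < L) (p q : Plane) :
    Summable fun g : ℤ × ℤ => V (dist p (q + (L : ℝ) • triPoint g)) := by
  have h : ∀ g : ℤ × ℤ, dist p (q + (L : ℝ) • triPoint g) = ‖(p - q) - (L : ℝ) • triPoint g‖ :=
    fun g => by rw [dist_eq_norm]; congr 1; abel
  simp_rw [h]
  exact summable_norm_sub_smul₃ hV hL (p - q)

/-- **The coset sum** `F_L(p, q) := ∑_{g ∈ ℤ²} V(|p − (q + L ξ_g)|)`: the interaction of a
particle at `p` with the whole `L A₂`-orbit of a particle at `q`.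
[cite: Theil2006, §3 Proof of Corollary 1.3 (e_per, preprint pp. 14–15)] -/
def cosetSum (V : ℝ → ℝ) (L : ℕ) (p q : Plane) : ℝ :=
  ∑' g : ℤ × ℤ, V (dist p (q + (L : ℝ) • triPoint g))

/-- **The coset tail** `τ_L(p, q) := ∑_{g ≠ 0} V(|p − (q + L ξ_g)|)`: the interaction with the
OTHER translates — the quantity controlled by (45)/(46).
[cite: Theil2006, §3 Proof of Corollary 1.3 ((45), (46), preprint p. 15)] -/
def cosetTail (V : ℝ → ℝ) (L : ℕ) (p q : Plane) : ℝ :=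
  ∑' g : ℤ × ℤ, if g = 0 then 0 else V (dist p (q + (L : ℝ) • triPoint g))

/-- `F_L(p, q) = V(|p − q|) + τ_L(p, q)`. [cite: Theil2006, §3 Proof of Corollary 1.3 (preprint p. 15)] -/
theorem IsAdmissible.cosetSum_eq (hV : IsAdmissible α V) (hL : 0 < L) (p q : Plane) :
    cosetSum V L p q = V (dist p q) + cosetTail V L p q := by
  rw [cosetSum, (hV.summable_coset hL p q).tsum_eq_add_tsum_ite 0]
  simp [cosetTail]

/-- **(45)/(46): the tails are small.** For `|p|, |q| ≤ R` and `L ≥ 4R + 3`: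
`|τ_L(p, q)| ≤ (2α/L⁵) ∑_{ξ ∈ A₂} |ξ|⁻⁵` — every other translate is at distance
`≥ L|ξ_g| − 2R ≥ L|ξ_g|/2 ≥ 4/3`, where (12) `|V(r)| ≤ α r⁻⁵/30` applies.
[cite: Theil2006, §3 Proof of Corollary 1.3 ((45)–(46) «By the decay properties of V», preprint p. 15), with Lemma 2.1 (12)] -/
theorem IsAdmissible.abs_cosetTail_le (hV : IsAdmissible α V) {R : ℝ} (hR : 0 ≤ R) {p q : Plane}
    (hp : ‖p‖ ≤ R) (hq : ‖q‖ ≤ R) (hL : 4 * R + 3 ≤ (L : ℝ)) :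
    |cosetTail V L p q| ≤ 2 * α / (L : ℝ) ^ 5 * ∑' g : ℤ × ℤ, ‖triPoint g‖⁻¹ ^ 5 := by
  have hα := hV.alpha_nonneg
  have hL3 : (3 : ℝ) ≤ L := by linarith
  have hL0 : (0 : ℝ) < L := by linarith
  set b : ℤ × ℤ → ℝ := fun g => 2 * α / (L : ℝ) ^ 5 * ‖triPoint g‖⁻¹ ^ 5 with hb
  have hb_summ : Summable b := summable_norm_triPoint_inv_pow.mul_left _
  have hterm : ∀ g : ℤ × ℤ,
      ‖(if g = 0 then (0 : ℝ) else V (dist p (q + (L : ℝ) • triPoint g)))‖ ≤ b g := by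
    intro g
    by_cases hg : g = 0
    · simp [hg, hb]
    · rw [if_neg hg, Real.norm_eq_abs]
      set d := dist p (q + (L : ℝ) • triPoint g) with hd
      have h1 : 1 ≤ ‖triPoint g‖ := one_le_norm_triPoint hg
      have hd_ge : (L : ℝ) * ‖triPoint g‖ - 2 * R ≤ d := by
        have e : d = ‖(L : ℝ) • triPoint g - (p - q)‖ := by
          rw [hd, dist_eq_norm, ← norm_neg]; congr 1; abel
        rw [e]
        have h2 := norm_sub_norm_le ((L : ℝ) • triPoint g) (p - q)
        rw [norm_smul, Real.norm_natCast] at h2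
        linarith [norm_sub_le p q]
      have hhalf : (L : ℝ) * ‖triPoint g‖ / 2 ≤ d := by nlinarith
      have hd43 : 4 / 3 ≤ d := by nlinarith
      have hpos : 0 < (L : ℝ) * ‖triPoint g‖ / 2 := by positivity
      have h4 : d⁻¹ ≤ ((L : ℝ) * ‖triPoint g‖ / 2)⁻¹ := inv_anti₀ hpos hhalf
      have h5 : d⁻¹ ^ 5 ≤ ((L : ℝ) * ‖triPoint g‖ / 2)⁻¹ ^ 5 :=
        pow_le_pow_left₀ (inv_nonneg.2 (by linarith)) h4 5
      have h6 : ((L : ℝ) * ‖triPoint g‖ / 2)⁻¹ ^ 5 = 32 / (L : ℝ) ^ 5 * ‖triPoint g‖⁻¹ ^ 5 := by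
        have hξ : ‖triPoint g‖ ≠ 0 := by linarith
        field_simp
        ring
      calc |V d| ≤ α / 30 * d⁻¹ ^ 5 := hV.abs_apply_le hd43
        _ ≤ α / 30 * (32 / (L : ℝ) ^ 5 * ‖triPoint g‖⁻¹ ^ 5) := by
            rw [← h6]; exact mul_le_mul_of_nonneg_left h5 (by positivity)
        _ ≤ b g := by
            simp only [hb]
            have h7 : 0 ≤ ‖triPoint g‖⁻¹ ^ 5 / (L : ℝ) ^ 5 := by positivity
            have h8 := mul_nonneg hα h7
            have e1 : α / 30 * (32 / (L : ℝ) ^ 5 * ‖triPoint g‖⁻¹ ^ 5) =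
                16 / 15 * (α * (‖triPoint g‖⁻¹ ^ 5 / (L : ℝ) ^ 5)) := by ring
            have e2 : 2 * α / (L : ℝ) ^ 5 * ‖triPoint g‖⁻¹ ^ 5 =
                2 * (α * (‖triPoint g‖⁻¹ ^ 5 / (L : ℝ) ^ 5)) := by ring
            rw [e1, e2]
            linarith
  calc |cosetTail V L p q|
      = ‖∑' g : ℤ × ℤ, (if g = 0 then (0 : ℝ) else V (dist p (q + (L : ℝ) • triPoint g)))‖ := by
        rw [cosetTail, Real.norm_eq_abs]
    _ ≤ ∑' g : ℤ × ℤ, b g := tsum_of_norm_bounded hb_summ.hasSum hterm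
    _ = 2 * α / (L : ℝ) ^ 5 * ∑' g : ℤ × ℤ, ‖triPoint g‖⁻¹ ^ 5 := by
        rw [hb]; exact tsum_mul_left

/-- Translating the first argument by a period vector permutes the coset: for a lattice point,
`F_L(x, q + Lξ_h) = F_L(x − L h, q)` — in the form used below,
`∑_g V(|x − (q + L ξ_g)|) = ∑_g V(|ξ_{x + L g} − q|)`. [folklore] -/
private theorem cosetSum_triPoint_eq (V : ℝ → ℝ) (L : ℕ) (x : ℤ × ℤ) (q : Plane) :
    cosetSum V L (triPoint x) q = ∑' g : ℤ × ℤ, V (dist (triPoint (x + (L : ℤ) • g)) q) := by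
  rw [cosetSum, ← (Equiv.neg (ℤ × ℤ)).tsum_eq]
  refine tsum_congr fun g => ?_
  rw [Equiv.neg_apply, map_add, triPoint_zsmul₃, map_neg, smul_neg, dist_eq_norm, dist_eq_norm]
  congr 1
  abel

end Coset

/-! ### Splitting sums over `A₂` and over `X_per` along the centred cell -/

section Splitting

variable {L : ℕ}

/-- `periodizeSet` of everything is everything. [cite: Theil2006, §3 proof of Corollary 1.3, periodization (preprint pp. 14–15); our lemma] -/
theorem periodizeSet_univ (hL : 0 < L) : periodizeSet hL (univ : Set (ℤ × ℤ)) = univ := by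
  ext k
  simp [periodizeSet]

/-- **`A₂ = Y_L + Lℤ²`**: `∑_{k ∈ ℤ²} φ(k) = ∑_{x₀ ∈ Y_L} ∑_{g ∈ ℤ²} φ(x₀ + Lg)` for summable
`φ`. [cite: Theil2006, §3 Proof of Corollary 1.3 («X_per := Y + LA₂», preprint p. 14); our lemma] -/
theorem tsum_eq_sum_centredCell_tsum (hL : 0 < L) {φ : ℤ × ℤ → ℝ} (hφ : Summable φ) :
    ∑' k, φ k = ∑ x₀ ∈ centredCell L, ∑' g : ℤ × ℤ, φ (x₀ + (L : ℤ) • g) := by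
  classical
  have h := tsum_periodizeSet_eq hL (univ : Set (ℤ × ℤ)) hφ
  rw [tsum_congr_set_coe φ (periodizeSet_univ hL), tsum_univ] at h
  rw [h, Finset.filter_true_of_mem fun _ _ => mem_univ _]

/-- Splitting one term off a sum over a set of labels. [folklore] -/
private theorem tsum_subtype_ne_add_eq {s : Set (ℤ × ℤ)} {f : ℤ × ℤ → ℝ} {x : ℤ × ℤ} (hx : x ∈ s)
    (hf : Summable f) :
    (∑' k : {k : ℤ × ℤ // k ∈ s ∧ k ≠ x}, f k) + f x = ∑' k : s, f k := by
  have e1 : s = {k | k ∈ s ∧ k ≠ x} ∪ {x} := by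
    ext k
    simp only [mem_union, mem_setOf_eq, mem_singleton_iff]
    constructor
    · intro hk
      by_cases hkx : k = x
      · exact Or.inr hkx
      · exact Or.inl ⟨hk, hkx⟩
    · rintro (⟨hk, -⟩ | rfl)
      · exact hk
      · exact hx
  have hdisj : Disjoint {k | k ∈ s ∧ k ≠ x} ({x} : Set (ℤ × ℤ)) :=
    Set.disjoint_left.2 fun k hk hkx => hk.2 hkx
  rw [tsum_congr_set_coe f e1, Summable.tsum_union_disjoint hdisj (hf.subtype _) (hf.subtype _)]
  congr 1
  rw [← Finset.coe_singleton, Finset.tsum_subtype' ({x} : Finset (ℤ × ℤ)) f, Finset.sum_singleton]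

end Splitting

/-! ### The rows of the periodized configuration -/

section Rows

variable {α : ℝ} {V : ℝ → ℝ} {L : ℕ} {A A' : Finset (ℤ × ℤ)} {y : ℤ × ℤ → Plane}

/-- The particles `X = (A₂ ∖ 𝒜) ∪ 𝒜'` of the relaxed Dirichlet problem, as a set of labels.
[cite: Theil2006, §3 Proof of Corollary 1.3 («X = (A₂ ∖ 𝒜) ∪ 𝒜′», preprint p. 14)] -/
def dirichletSupport (A A' : Finset (ℤ × ℤ)) : Set (ℤ × ℤ) := {k | k ∉ A ∨ k ∈ A'}

/-- Membership in `X`. [cite: Theil2006, §3 Proof of Corollary 1.3 (preprint p. 14)] -/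
theorem mem_dirichletSupport {k : ℤ × ℤ} : k ∈ dirichletSupport A A' ↔ k ∉ A ∨ k ∈ A' := Iff.rfl

/-- `Y = X ∩ Y_L = 𝒜' ⊔ (Y_L ∖ 𝒜)` when `𝒜' ⊆ 𝒜 ⊆ Y_L`. [cite: Theil2006, §3 Proof of Corollary 1.3 (preprint p. 14)] -/
theorem filter_centredCell_dirichletSupport [DecidablePred (· ∈ dirichletSupport A A')]
    (hA' : A' ⊆ A) (hAY : A ⊆ centredCell L) :
    (centredCell L).filter (· ∈ dirichletSupport A A') = A' ∪ (centredCell L \ A) := by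
  ext k
  simp only [Finset.mem_filter, mem_dirichletSupport, Finset.mem_union, Finset.mem_sdiff]
  constructor
  · rintro ⟨hkY, hk | hk⟩
    · exact Or.inr ⟨hkY, hk⟩
    · exact Or.inl hk
  · rintro (hk | ⟨hkY, hk⟩)
    · exact ⟨hAY (hA' hk), Or.inr hk⟩
    · exact ⟨hkY, Or.inl hk⟩

/-- `𝒜'` and `Y_L ∖ 𝒜` are disjoint. [folklore] -/
private theorem disjoint_sdiff_of_subset (hA' : A' ⊆ A) : Disjoint A' (centredCell L \ A) :=
  Finset.disjoint_left.2 fun _ hk hk' => (Finset.mem_sdiff.1 hk').2 (hA' hk)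

/-- **The row of a particle of `Y` in `E_L^per(X_per, {y_per})`, coset by coset**: for
`x ∈ X ∩ Y_L`,
`∑_{x' ∈ X_per ∖ {x}} V(|y_per(x) − y_per(x')|) + V(0) = ∑_{x₀ ∈ X ∩ Y_L} F_L(y(x), y(x₀))`.
[cite: Theil2006, §3 Proof of Corollary 1.3 («rewriting E_L^per in a more explicit way», preprint p. 15)] -/
theorem rowEnergy_periodize_add (hV : IsAdmissible α V) (hL : 0 < L) {X : Set (ℤ × ℤ)}
    [DecidablePred (· ∈ X)] {x : ℤ × ℤ} (hx : x ∈ centredCell L) (hxX : x ∈ X) :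
    rowEnergy V (periodizeSet hL X) (periodize hL y) x + V 0 =
      ∑ x₀ ∈ (centredCell L).filter (· ∈ X), cosetSum V L (y x) (y x₀) := by
  classical
  have hyp := isPeriodic_periodize hL y
  have hsumm : Summable fun k' : ℤ × ℤ => V (dist (periodize hL y x) (periodize hL y k')) :=
    hV.summable_periodic hL hyp _
  have hxper : x ∈ periodizeSet hL X := (mem_periodizeSet_iff_of_mem hL hx).2 hxX
  have hself : V (dist (periodize hL y x) (periodize hL y x)) = V 0 := by rw [dist_self]
  rw [rowEnergy, ← hself, tsum_subtype_ne_add_eq hxper hsumm, tsum_periodizeSet_eq hL X hsumm]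
  refine Finset.sum_congr rfl fun x₀ hx₀ => ?_
  rw [cosetSum]
  refine tsum_congr fun g => ?_
  rw [periodize_of_mem hL hx, periodize_add_zsmul_of_mem hL (Finset.mem_filter.1 hx₀).1]

/-- **The clamped part of a Dirichlet row, coset by coset**: for `y ∈ Y_𝒜^Dir`, `𝒜 ⊆ Y_L` and any
`p`, `∑_{x' ∈ A₂ ∖ 𝒜} V(|p − x'|) = ∑_{x₀ ∈ Y_L ∖ 𝒜} V(|p − x₀|) + ∑_{x₀ ∈ Y_L} τ_L(p, x₀)`
(all sites outside `Y_L` are clamped). [cite: Theil2006, §3 Proof of Corollary 1.3 (preprint p. 15); our lemma] -/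
theorem tsum_compl_eq_sum_add_sum_cosetTail (hV : IsAdmissible α V) (hL : 0 < L)
    (hAY : A ⊆ centredCell L) (p : Plane) :
    ∑' k' : {k' : ℤ × ℤ // k' ∉ A}, V (dist p (triPoint k'.1)) =
      ∑ x₀ ∈ centredCell L \ A, V (dist p (triPoint x₀)) +
        ∑ x₀ ∈ centredCell L, cosetTail V L p (triPoint x₀) := by
  classical
  have hsumm : Summable fun k' : ℤ × ℤ => V (dist p (triPoint k')) := by
    have h := hV.summable_norm_sub p
    refine h.congr fun k' => ?_
    rw [dist_eq_norm]
  -- all labels: `Y_L`-cosets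
  have hall := tsum_eq_sum_centredCell_tsum hL hsumm
  have hcoset : ∀ x₀ : ℤ × ℤ, ∑' g : ℤ × ℤ, V (dist p (triPoint (x₀ + (L : ℤ) • g))) =
      V (dist p (triPoint x₀)) + cosetTail V L p (triPoint x₀) := by
    intro x₀
    have e : ∀ g : ℤ × ℤ, triPoint (x₀ + (L : ℤ) • g) = triPoint x₀ + (L : ℝ) • triPoint g :=
      fun g => by rw [map_add, triPoint_zsmul₃]
    simp_rw [e]
    exact hV.cosetSum_eq hL p (triPoint x₀)
  simp_rw [hcoset] at hall
  -- remove the finite set `𝒜`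
  have hsplit := hsumm.sum_add_tsum_compl (s := A)
  have e2 : (∑' k' : {k' : ℤ × ℤ // k' ∉ A}, V (dist p (triPoint k'.1))) =
      ∑' k' : ↥((A : Set (ℤ × ℤ))ᶜ), V (dist p (triPoint k'.1)) := rfl
  rw [e2]
  have hAsum : ∑ x₀ ∈ centredCell L, V (dist p (triPoint x₀)) =
      ∑ x₀ ∈ centredCell L \ A, V (dist p (triPoint x₀)) + ∑ x₀ ∈ A, V (dist p (triPoint x₀)) := by
    rw [← Finset.sum_sdiff hAY]
  rw [Finset.sum_add_distrib, hAsum] at hall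
  linarith

/-- **The perfect-lattice row**: `∑_{x' ∈ A₂} V(|x − x'|) = V(0) − 6` for every `x ∈ A₂`
(the normalization (1): `∑_{ξ ∈ A₂ ∖ 0} V(|ξ|) = −6`). [cite: Theil2006, §1 (1) (preprint p. 2)] -/
theorem IsNormalized.tsum_dist_triPoint (hV : IsNormalized V) (hs : ∀ p : Plane,
    Summable fun k' : ℤ × ℤ => V (dist p (triPoint k'))) (x : ℤ × ℤ) :
    ∑' k' : ℤ × ℤ, V (dist (triPoint x) (triPoint k')) = V 0 - 6 := by
  classical
  have h6 : ∑' k : ℤ × ℤ, latticePotential V k = -6 := hV.hasSum_latticePotential.tsum_eq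
  -- reindex `k' = x + k`
  rw [← (Equiv.addLeft x).tsum_eq]
  have e : ∀ k : ℤ × ℤ, V (dist (triPoint x) (triPoint (Equiv.addLeft x k))) = V ‖triPoint k‖ := by
    intro k
    rw [Equiv.coe_addLeft, dist_triPoint, show x - (x + k) = -k by abel, map_neg, norm_neg]
  simp_rw [e]
  have hs' : Summable fun k : ℤ × ℤ => V ‖triPoint k‖ := by
    have := hs 0
    refine this.congr fun k => ?_
    rw [dist_eq_norm, zero_sub, norm_neg]
  rw [hs'.tsum_eq_add_tsum_ite 0, map_zero, norm_zero]
  have e2 : ∀ k : ℤ × ℤ, (if k = 0 then (0 : ℝ) else V ‖triPoint k‖) = latticePotential V k := by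
    intro k; rfl
  simp_rw [e2, h6]
  ring

end Rows

/-! ### Free rows: the Dirichlet row up to tails ((45)) -/

section FreeRows

variable {α : ℝ} {V : ℝ → ℝ} {L : ℕ} {A A' : Finset (ℤ × ℤ)} {y : ℤ × ℤ → Plane}

/-- **The row of a free particle** `x ∈ 𝒜'` in `E_L^per(X_per, {y_per})`: the pairs inside `𝒜'`,
the clamped part of its Dirichlet row, and the tails (interactions with the other translates of
the defect minus those with the would-be lattice sites `𝒜 + LA₂ ∖ 𝒜`):
`row_per(x) = ∑_{x' ∈ 𝒜'∖x} V(|y x − y x'|) + ∑_{x' ∉ 𝒜} V(|y x − x'|)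
  + (∑_{x₀ ∈ 𝒜'} τ_L(y x, y x₀) − ∑_{x₀ ∈ 𝒜} τ_L(y x, x₀))`.
[cite: Theil2006, §3 Proof of Corollary 1.3 ((45) and «we can replace … y_per by … y_min and 𝒫_per by 𝒫_min in the first sum», preprint p. 15)] -/
theorem rowEnergy_periodize_free (hV : IsAdmissible α V) (hL : 0 < L) (hy : IsClampedOutside A y)
    (hA' : A' ⊆ A) (hAY : A ⊆ centredCell L) {x : ℤ × ℤ} (hx : x ∈ A') :
    rowEnergy V (periodizeSet hL (dirichletSupport A A')) (periodize hL y) x =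
      ∑ x' ∈ A'.erase x, V (dist (y x) (y x')) +
        ∑' k' : {k' : ℤ × ℤ // k' ∉ A}, V (dist (y x) (y k'.1)) +
          (∑ x₀ ∈ A', cosetTail V L (y x) (y x₀) -
            ∑ x₀ ∈ A, cosetTail V L (y x) (triPoint x₀)) := by
  classical
  have hxY : x ∈ centredCell L := hAY (hA' hx)
  have hrow := rowEnergy_periodize_add hV hL (X := dirichletSupport A A') (y := y) hxY (Or.inr hx)
  rw [filter_centredCell_dirichletSupport hA' hAY, Finset.sum_union (disjoint_sdiff_of_subset hA')]
    at hrow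
  -- the clamped part of the Dirichlet row
  have hT : (∑' k' : {k' : ℤ × ℤ // k' ∉ A}, V (dist (y x) (y k'.1))) =
      ∑' k' : {k' : ℤ × ℤ // k' ∉ A}, V (dist (y x) (triPoint k'.1)) :=
    tsum_congr fun k' => by rw [hy k'.1 k'.2]
  rw [hT, tsum_compl_eq_sum_add_sum_cosetTail hV hL hAY (y x)]
  -- coset sums = value + tail
  have hF : ∀ x₀ : ℤ × ℤ, cosetSum V L (y x) (y x₀) = V (dist (y x) (y x₀)) + cosetTail V L (y x) (y x₀) :=
    fun x₀ => hV.cosetSum_eq hL _ _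
  simp_rw [hF, Finset.sum_add_distrib] at hrow
  -- the pairs inside `𝒜'`: split off the self term
  have hin : ∑ x₀ ∈ A', V (dist (y x) (y x₀)) = V 0 + ∑ x' ∈ A'.erase x, V (dist (y x) (y x')) := by
    rw [← Finset.add_sum_erase A' _ hx, dist_self]
  -- on `Y_L ∖ 𝒜` the configuration is the lattice
  have hcl : ∑ x₀ ∈ centredCell L \ A, V (dist (y x) (y x₀)) =
      ∑ x₀ ∈ centredCell L \ A, V (dist (y x) (triPoint x₀)) :=
    Finset.sum_congr rfl fun x₀ hx₀ => by rw [hy x₀ (Finset.mem_sdiff.1 hx₀).2]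
  have hcl' : ∑ x₀ ∈ centredCell L \ A, cosetTail V L (y x) (y x₀) =
      ∑ x₀ ∈ centredCell L \ A, cosetTail V L (y x) (triPoint x₀) :=
    Finset.sum_congr rfl fun x₀ hx₀ => by rw [hy x₀ (Finset.mem_sdiff.1 hx₀).2]
  have hY : ∑ x₀ ∈ centredCell L, cosetTail V L (y x) (triPoint x₀) =
      ∑ x₀ ∈ centredCell L \ A, cosetTail V L (y x) (triPoint x₀) +
        ∑ x₀ ∈ A, cosetTail V L (y x) (triPoint x₀) := by
    rw [← Finset.sum_sdiff hAY]
  rw [hin, hcl, hcl'] at hrow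
  rw [hY]
  linarith

end FreeRows

/-! ### Clamped rows: exact resummation over `Y_L × LA₂ ≅ A₂` ((46)) -/

section ClampedRows

variable {α : ℝ} {V : ℝ → ℝ} {L : ℕ} {A A' : Finset (ℤ × ℤ)} {y : ℤ × ℤ → Plane}

/-- **The row of a clamped particle** `x ∈ Y_L ∖ 𝒜`: the perfect-lattice row `V(0) − 6` minus its
self term, corrected by the defect: `row_per(x) = −6 + ∑_{x₀ ∈ 𝒜'} F_L(x, y x₀) − ∑_{x₀ ∈ 𝒜} F_L(x, x₀)`.
[cite: Theil2006, §3 Proof of Corollary 1.3 («replace 𝒜_min by 𝒜 and e_per by e_r in the second sum», preprint p. 15)] -/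
theorem rowEnergy_periodize_clamped (hV : IsAdmissible α V) (hL : 0 < L)
    (hy : IsClampedOutside A y) (hA' : A' ⊆ A) (hAY : A ⊆ centredCell L) {x : ℤ × ℤ}
    (hx : x ∈ centredCell L \ A) :
    rowEnergy V (periodizeSet hL (dirichletSupport A A')) (periodize hL y) x =
      -6 + (∑ x₀ ∈ A', cosetSum V L (triPoint x) (y x₀) -
        ∑ x₀ ∈ A, cosetSum V L (triPoint x) (triPoint x₀)) := by
  classical
  obtain ⟨hxY, hxA⟩ := Finset.mem_sdiff.1 hx
  have hrow := rowEnergy_periodize_add hV hL (X := dirichletSupport A A') (y := y) hxY (Or.inl hxA)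
  rw [filter_centredCell_dirichletSupport hA' hAY, Finset.sum_union (disjoint_sdiff_of_subset hA'),
    hy x hxA] at hrow
  -- the perfect-lattice row through the same cosets
  have hsumm : ∀ p : Plane, Summable fun k' : ℤ × ℤ => V (dist p (triPoint k')) := fun p => by
    refine (hV.summable_norm_sub p).congr fun k' => ?_
    rw [dist_eq_norm]
  have hperf := tsum_eq_sum_centredCell_tsum hL (hsumm (triPoint x))
  rw [hV.toIsNormalized.tsum_dist_triPoint hsumm x] at hperf
  have hcoset : ∀ x₀ : ℤ × ℤ, ∑' g : ℤ × ℤ, V (dist (triPoint x) (triPoint (x₀ + (L : ℤ) • g))) =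
      cosetSum V L (triPoint x) (triPoint x₀) := by
    intro x₀
    rw [cosetSum]
    refine tsum_congr fun g => ?_
    rw [map_add, triPoint_zsmul₃]
  simp_rw [hcoset] at hperf
  rw [← Finset.sum_sdiff hAY] at hperf
  -- on `Y_L ∖ 𝒜` the configuration is the lattice
  have hcl : ∑ x₀ ∈ centredCell L \ A, cosetSum V L (triPoint x) (y x₀) =
      ∑ x₀ ∈ centredCell L \ A, cosetSum V L (triPoint x) (triPoint x₀) :=
    Finset.sum_congr rfl fun x₀ hx₀ => by rw [hy x₀ (Finset.mem_sdiff.1 hx₀).2]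
  rw [hcl] at hrow
  linarith

/-- **Resummation over `Y_L × LA₂ ≅ A₂`**: `∑_{x ∈ Y_L} F_L(x, q) = ∑_{z ∈ A₂} V(|z − q|)` — the
interactions of all translates of `q` with one period of the lattice are the interactions of `q`
with the whole lattice. [cite: Theil2006, §3 Proof of Corollary 1.3 («By definition of Z we can replace the set Y by Z and 𝒫_per by 𝒫 in the second sum», preprint p. 15); our lemma] -/
theorem sum_centredCell_cosetSum (hV : IsAdmissible α V) (hL : 0 < L) (q : Plane) :
    ∑ x ∈ centredCell L, cosetSum V L (triPoint x) q = ∑' z : ℤ × ℤ, V (dist (triPoint z) q) := by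
  have hsumm : Summable fun z : ℤ × ℤ => V (dist (triPoint z) q) := by
    refine (hV.summable_norm_sub q).congr fun z => ?_
    rw [dist_eq_norm, norm_sub_rev]
  rw [tsum_eq_sum_centredCell_tsum hL hsumm]
  exact Finset.sum_congr rfl fun x _ => cosetSum_triPoint_eq V L x q

/-- **The sum of the clamped rows of one period**:
`∑_{x ∈ Y_L ∖ 𝒜} row_per(x) = −6(L² − #𝒜) + ∑_{x₀ ∈ 𝒜'} ∑_{x' ∉ 𝒜} V(|x' − y x₀|)
  − ∑_{x₀ ∈ 𝒜} ∑_{x' ∉ 𝒜} V(|x' − x₀|) − err₂(L)` with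
`err₂(L) = ∑_{x ∈ 𝒜} (∑_{x₀ ∈ 𝒜'} τ_L(x, y x₀) − ∑_{x₀ ∈ 𝒜} τ_L(x, x₀))`.
[cite: Theil2006, §3 Proof of Corollary 1.3 ((46) and the last two displays, preprint p. 15)] -/
theorem sum_rowEnergy_periodize_clamped (hV : IsAdmissible α V) (hL : 0 < L)
    (hy : IsClampedOutside A y) (hA' : A' ⊆ A) (hAY : A ⊆ centredCell L) :
    ∑ x ∈ centredCell L \ A, rowEnergy V (periodizeSet hL (dirichletSupport A A')) (periodize hL y) x =
      -6 * ((L : ℝ) ^ 2 - A.card) +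
        (∑ x₀ ∈ A', ∑' k' : {k' : ℤ × ℤ // k' ∉ A}, V (dist (triPoint k'.1) (y x₀)) -
          ∑ x₀ ∈ A, ∑' k' : {k' : ℤ × ℤ // k' ∉ A}, V (dist (triPoint k'.1) (triPoint x₀))) -
        ∑ x ∈ A, (∑ x₀ ∈ A', cosetTail V L (triPoint x) (y x₀) -
          ∑ x₀ ∈ A, cosetTail V L (triPoint x) (triPoint x₀)) := by
  classical
  rw [Finset.sum_congr rfl fun x hx => rowEnergy_periodize_clamped hV hL hy hA' hAY hx,
    Finset.sum_add_distrib, Finset.sum_const, Finset.card_sdiff_of_subset hAY, card_centredCell]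
  -- `∑_{x ∈ Y∖𝒜} Ψ(x) = ∑_{x ∈ Y} Ψ(x) − ∑_{x ∈ 𝒜} Ψ(x)`
  set Ψ : ℤ × ℤ → ℝ := fun x => ∑ x₀ ∈ A', cosetSum V L (triPoint x) (y x₀) -
    ∑ x₀ ∈ A, cosetSum V L (triPoint x) (triPoint x₀) with hΨ
  have hsplit : ∑ x ∈ centredCell L \ A, Ψ x = ∑ x ∈ centredCell L, Ψ x - ∑ x ∈ A, Ψ x := by
    rw [← Finset.sum_sdiff hAY]; ring
  -- the full period resums exactly
  have hfull : ∑ x ∈ centredCell L, Ψ x =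
      ∑ x₀ ∈ A', ∑' z : ℤ × ℤ, V (dist (triPoint z) (y x₀)) -
        ∑ x₀ ∈ A, ∑' z : ℤ × ℤ, V (dist (triPoint z) (triPoint x₀)) := by
    simp only [hΨ, Finset.sum_sub_distrib]
    rw [Finset.sum_comm, Finset.sum_comm (s := centredCell L) (t := A)]
    simp_rw [sum_centredCell_cosetSum hV hL]
  -- the `𝒜`-rows: value + tail, and the values remove `𝒜` from the full lattice sums
  have hsumm : ∀ q : Plane, Summable fun z : ℤ × ℤ => V (dist (triPoint z) q) := fun q => by
    refine (hV.summable_norm_sub q).congr fun z => ?_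
    rw [dist_eq_norm, norm_sub_rev]
  have hcompl : ∀ q : Plane, (∑' z : ℤ × ℤ, V (dist (triPoint z) q)) =
      ∑ x ∈ A, V (dist (triPoint x) q) + ∑' k' : {k' : ℤ × ℤ // k' ∉ A}, V (dist (triPoint k'.1) q) := by
    intro q
    have h := (hsumm q).sum_add_tsum_compl (s := A)
    have e2 : (∑' k' : {k' : ℤ × ℤ // k' ∉ A}, V (dist (triPoint k'.1) q)) =
        ∑' k' : ↥((A : Set (ℤ × ℤ))ᶜ), V (dist (triPoint k'.1) q) := rfl
    rw [e2, h]
  have hA_rows : ∑ x ∈ A, Ψ x =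
      (∑ x₀ ∈ A', ∑ x ∈ A, V (dist (triPoint x) (y x₀)) -
        ∑ x₀ ∈ A, ∑ x ∈ A, V (dist (triPoint x) (triPoint x₀))) +
      ∑ x ∈ A, (∑ x₀ ∈ A', cosetTail V L (triPoint x) (y x₀) -
        ∑ x₀ ∈ A, cosetTail V L (triPoint x) (triPoint x₀)) := by
    simp only [hΨ, hV.cosetSum_eq hL, Finset.sum_add_distrib, Finset.sum_sub_distrib]
    rw [Finset.sum_comm (s := A) (t := A'), Finset.sum_comm (s := A) (t := A)]
    ring
  have hcast : ((L ^ 2 - A.card : ℕ) : ℝ) = (L : ℝ) ^ 2 - A.card := by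
    rw [Nat.cast_sub ((Finset.card_le_card hAY).trans (card_centredCell L).le), Nat.cast_pow]
  rw [nsmul_eq_mul, hcast, hsplit, hfull, hA_rows]
  simp_rw [hcompl]
  rw [Finset.sum_add_distrib, Finset.sum_add_distrib]
  ring

end ClampedRows

/-! ### The identity and the estimate -/

section Identity

variable {α : ℝ} {V : ℝ → ℝ} {L : ℕ} {A A' : Finset (ℤ × ℤ)} {y : ℤ × ℤ → Plane}

/-- The perfect lattice's Dirichlet energy in row form:
`2 E_𝒜(A₂) = ∑_{x₀ ∈ 𝒜} ∑_{x' ∉ 𝒜} V(|x' − x₀|) − 6 #𝒜` (each full row is `−6`).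
[cite: Theil2006, §3 Proof of Corollary 1.3 («E_𝒜(A₂)», preprint p. 15), with §1 (1)] -/
theorem IsAdmissible.two_mul_dirichletEnergy_triPoint (hV : IsAdmissible α V) (A : Finset (ℤ × ℤ)) :
    2 * dirichletEnergy V A triPoint =
      ∑ x₀ ∈ A, ∑' k' : {k' : ℤ × ℤ // k' ∉ A}, V (dist (triPoint k'.1) (triPoint x₀)) -
        6 * A.card := by
  classical
  have hsumm : ∀ p : Plane, Summable fun k' : ℤ × ℤ => V (dist p (triPoint k')) := fun p => by
    refine (hV.summable_norm_sub p).congr fun k' => ?_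
    rw [dist_eq_norm]
  -- each row of `x₀ ∈ 𝒜`: `V 0 + ∑_{x' ∈ 𝒜∖x₀} + ∑_{x' ∉ 𝒜} = V 0 − 6`
  have hrow : ∀ x₀ ∈ A, ∑ x' ∈ A.erase x₀, V (dist (triPoint x₀) (triPoint x')) +
      ∑' k' : {k' : ℤ × ℤ // k' ∉ A}, V (dist (triPoint x₀) (triPoint k'.1)) = -6 := by
    intro x₀ hx₀
    have h := (hsumm (triPoint x₀)).sum_add_tsum_compl (s := A)
    rw [hV.toIsNormalized.tsum_dist_triPoint hsumm x₀, ← Finset.add_sum_erase A _ hx₀,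
      dist_self] at h
    have e2 : (∑' k' : {k' : ℤ × ℤ // k' ∉ A}, V (dist (triPoint x₀) (triPoint k'.1))) =
        ∑' k' : ↥((A : Set (ℤ × ℤ))ᶜ), V (dist (triPoint x₀) (triPoint k'.1)) := rfl
    rw [e2]
    linarith
  have hsym : ∀ x₀ : ℤ × ℤ, (∑' k' : {k' : ℤ × ℤ // k' ∉ A}, V (dist (triPoint k'.1) (triPoint x₀))) =
      ∑' k' : {k' : ℤ × ℤ // k' ∉ A}, V (dist (triPoint x₀) (triPoint k'.1)) :=
    fun x₀ => tsum_congr fun k' => by rw [dist_comm]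
  simp_rw [hsym]
  rw [dirichletEnergy]
  have htot : ∑ x₀ ∈ A, (∑ x' ∈ A.erase x₀, V (dist (triPoint x₀) (triPoint x')) +
      ∑' k' : {k' : ℤ × ℤ // k' ∉ A}, V (dist (triPoint x₀) (triPoint k'.1))) =
      ∑ x₀ ∈ A, (-6 : ℝ) := Finset.sum_congr rfl hrow
  rw [Finset.sum_add_distrib, Finset.sum_const, nsmul_eq_mul] at htot
  linarith

/-- The relaxed Dirichlet energy in row form: `2 E(𝒜', {y}) = ∑_{x ∈ 𝒜'} (∑_{x' ∈ 𝒜'∖x} e +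
2 ∑_{x' ∉ 𝒜} e)`. [cite: Theil2006, §3 Proof of Corollary 1.3 (preprint p. 14)] -/
theorem two_mul_relaxedDirichletEnergy (V : ℝ → ℝ) (A A' : Finset (ℤ × ℤ)) (y : ℤ × ℤ → Plane) :
    2 * relaxedDirichletEnergy V A A' y =
      ∑ x ∈ A', ∑ x' ∈ A'.erase x, V (dist (y x) (y x')) +
        2 * ∑ x ∈ A', ∑' k' : {k' : ℤ × ℤ // k' ∉ A}, V (dist (y x) (y k'.1)) := by
  rw [relaxedDirichletEnergy]
  ring

/-- **The explicit rewriting of `E_L^per(X_per, {y_per})`** (p. 15), as an exact identity: for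
`𝒜' ⊆ 𝒜 ⊆ Y_L`, `y ∈ Y_𝒜^Dir` and admissible `V`,
`E_L^per(X_per, {y_per}) = 2 E(𝒜', {y}) − 2 E_𝒜(A₂) − 6L² + err₁(L) − err₂(L)` (ordered
normalisation; halve for the printed one), where
`err₁(L) = ∑_{x ∈ 𝒜'} (∑_{x₀ ∈ 𝒜'} τ_L(y x, y x₀) − ∑_{x₀ ∈ 𝒜} τ_L(y x, x₀))` and
`err₂(L) = ∑_{x ∈ 𝒜} (∑_{x₀ ∈ 𝒜'} τ_L(x, y x₀) − ∑_{x₀ ∈ 𝒜} τ_L(x, x₀))` are sums of coset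
tails. [cite: Theil2006, §3 Proof of Corollary 1.3 (the chain of displays, preprint p. 15)] -/
theorem relaxedPeriodicEnergy_periodize_eq_dirichlet (hV : IsAdmissible α V) (hL : 0 < L)
    (hy : IsClampedOutside A y) (hA' : A' ⊆ A) (hAY : A ⊆ centredCell L) :
    relaxedPeriodicEnergy V L (periodizeSet hL (dirichletSupport A A')) (periodize hL y) =
      2 * relaxedDirichletEnergy V A A' y - 2 * dirichletEnergy V A triPoint - 6 * (L : ℝ) ^ 2 +
        ∑ x ∈ A', (∑ x₀ ∈ A', cosetTail V L (y x) (y x₀) -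
          ∑ x₀ ∈ A, cosetTail V L (y x) (triPoint x₀)) -
        ∑ x ∈ A, (∑ x₀ ∈ A', cosetTail V L (triPoint x) (y x₀) -
          ∑ x₀ ∈ A, cosetTail V L (triPoint x) (triPoint x₀)) := by
  classical
  rw [relaxedPeriodicEnergy_periodize_eq hL, filter_centredCell_dirichletSupport hA' hAY,
    Finset.sum_union (disjoint_sdiff_of_subset hA'),
    Finset.sum_congr rfl fun x hx => rowEnergy_periodize_free hV hL hy hA' hAY hx,
    sum_rowEnergy_periodize_clamped hV hL hy hA' hAY, two_mul_relaxedDirichletEnergy,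
    hV.two_mul_dirichletEnergy_triPoint]
  -- the clamped parts of the Dirichlet rows, both ways round
  have hT : ∀ x ∈ A', (∑' k' : {k' : ℤ × ℤ // k' ∉ A}, V (dist (y x) (y k'.1))) =
      ∑' k' : {k' : ℤ × ℤ // k' ∉ A}, V (dist (triPoint k'.1) (y x)) := fun x _ =>
    tsum_congr fun k' => by rw [hy k'.1 k'.2, dist_comm]
  rw [Finset.sum_add_distrib, Finset.sum_add_distrib, Finset.sum_congr rfl hT]
  ring

/-- **The upper bound fed into (44)**: for every `ε > 0` there is `L_ε` such that for all
`L ≥ L_ε` (with `𝒜 ⊆ Y_L`),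
`E_L^per(X_per, {y_per}) + 6L² ≤ 2 (E(𝒜', {y}) − E_𝒜(A₂)) + ε`, provided the free particles
and the hole lie in `B(0, R)` ("Due to the compactness of `𝒜` we can assume that `A ⊂ B(0, C)`",
p. 14; (45), (46), p. 15). Quantitatively: the error is at most
`2 (#𝒜' + #𝒜)² · (2α/L⁵) ∑_{ξ ∈ A₂∖0} |ξ|⁻⁵` for `L ≥ 4R + 3`.
[cite: Theil2006, §3 Proof of Corollary 1.3 ((45), (46) and the chain, preprint p. 15)] -/
theorem relaxedPeriodicEnergy_periodize_le (hV : IsAdmissible α V) (hL : 0 < L)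
    (hy : IsClampedOutside A y) (hA' : A' ⊆ A) (hAY : A ⊆ centredCell L) {R : ℝ} (hR : 0 ≤ R)
    (hyR : ∀ x ∈ A', ‖y x‖ ≤ R) (hAR : ∀ x ∈ A, ‖triPoint x‖ ≤ R) (hLR : 4 * R + 3 ≤ (L : ℝ)) :
    relaxedPeriodicEnergy V L (periodizeSet hL (dirichletSupport A A')) (periodize hL y) +
        6 * (L : ℝ) ^ 2 ≤
      2 * (relaxedDirichletEnergy V A A' y - dirichletEnergy V A triPoint) +
        2 * ((A'.card : ℝ) + A.card) ^ 2 *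
          (2 * α / (L : ℝ) ^ 5 * ∑' g : ℤ × ℤ, ‖triPoint g‖⁻¹ ^ 5) := by
  rw [relaxedPeriodicEnergy_periodize_eq_dirichlet hV hL hy hA' hAY]
  set K : ℝ := 2 * α / (L : ℝ) ^ 5 * ∑' g : ℤ × ℤ, ‖triPoint g‖⁻¹ ^ 5 with hK
  have hK0 : 0 ≤ K := by
    have hα := hV.alpha_nonneg
    have hL0 : (0 : ℝ) ≤ L := Nat.cast_nonneg _
    have : 0 ≤ ∑' g : ℤ × ℤ, ‖triPoint g‖⁻¹ ^ 5 := tsum_nonneg fun g => by positivity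
    positivity
  -- every tail is `≤ K` in absolute value
  have ht : ∀ p q : Plane, ‖p‖ ≤ R → ‖q‖ ≤ R → |cosetTail V L p q| ≤ K := fun p q hp hq =>
    hV.abs_cosetTail_le hR hp hq hLR
  have hyR' : ∀ x ∈ A', ‖y x‖ ≤ R := hyR
  -- bound the two error sums
  have h1 : |∑ x ∈ A', (∑ x₀ ∈ A', cosetTail V L (y x) (y x₀) -
      ∑ x₀ ∈ A, cosetTail V L (y x) (triPoint x₀))| ≤ A'.card * ((A'.card + A.card) * K) := by
    refine (Finset.abs_sum_le_sum_abs _ _).trans ?_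
    have : ∀ x ∈ A', |∑ x₀ ∈ A', cosetTail V L (y x) (y x₀) -
        ∑ x₀ ∈ A, cosetTail V L (y x) (triPoint x₀)| ≤ (A'.card + A.card) * K := by
      intro x hx
      refine (abs_sub _ _).trans ?_
      have ha : |∑ x₀ ∈ A', cosetTail V L (y x) (y x₀)| ≤ A'.card * K := by
        refine (Finset.abs_sum_le_sum_abs _ _).trans ?_
        have := Finset.sum_le_sum fun x₀ hx₀ => ht (y x) (y x₀) (hyR x hx) (hyR x₀ hx₀)
        rwa [Finset.sum_const, nsmul_eq_mul] at this
      have hb : |∑ x₀ ∈ A, cosetTail V L (y x) (triPoint x₀)| ≤ A.card * K := by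
        refine (Finset.abs_sum_le_sum_abs _ _).trans ?_
        have := Finset.sum_le_sum fun x₀ hx₀ => ht (y x) (triPoint x₀) (hyR x hx) (hAR x₀ hx₀)
        rwa [Finset.sum_const, nsmul_eq_mul] at this
      linarith
    have := Finset.sum_le_sum this
    rwa [Finset.sum_const, nsmul_eq_mul] at this
  have h2 : |∑ x ∈ A, (∑ x₀ ∈ A', cosetTail V L (triPoint x) (y x₀) -
      ∑ x₀ ∈ A, cosetTail V L (triPoint x) (triPoint x₀))| ≤ A.card * ((A'.card + A.card) * K) := by
    refine (Finset.abs_sum_le_sum_abs _ _).trans ?_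
    have : ∀ x ∈ A, |∑ x₀ ∈ A', cosetTail V L (triPoint x) (y x₀) -
        ∑ x₀ ∈ A, cosetTail V L (triPoint x) (triPoint x₀)| ≤ (A'.card + A.card) * K := by
      intro x hx
      refine (abs_sub _ _).trans ?_
      have ha : |∑ x₀ ∈ A', cosetTail V L (triPoint x) (y x₀)| ≤ A'.card * K := by
        refine (Finset.abs_sum_le_sum_abs _ _).trans ?_
        have := Finset.sum_le_sum fun x₀ hx₀ => ht (triPoint x) (y x₀) (hAR x hx) (hyR x₀ hx₀)
        rwa [Finset.sum_const, nsmul_eq_mul] at this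
      have hb : |∑ x₀ ∈ A, cosetTail V L (triPoint x) (triPoint x₀)| ≤ A.card * K := by
        refine (Finset.abs_sum_le_sum_abs _ _).trans ?_
        have := Finset.sum_le_sum fun x₀ hx₀ => ht (triPoint x) (triPoint x₀) (hAR x hx) (hAR x₀ hx₀)
        rwa [Finset.sum_const, nsmul_eq_mul] at this
      linarith
    have := Finset.sum_le_sum this
    rwa [Finset.sum_const, nsmul_eq_mul] at this
  have h1' := (abs_le.1 h1).2
  have h2' := (abs_le.1 h2).1
  have hA0 : (0 : ℝ) ≤ A.card := Nat.cast_nonneg _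
  have hA0' : (0 : ℝ) ≤ A'.card := Nat.cast_nonneg _
  nlinarith

/-- **For a relaxed minimizer** ("The first sum is equal to `E_𝒜(𝒜_min, {y_min})` and can be
estimated by `E_𝒜(A₂)` due to the minimality of `y_min`", p. 15):
`E_L^per(X_per, {y_per})/2 + 3L² ≤ (#𝒜_min + #𝒜)² (2α/L⁵) ∑_{ξ ∈ A₂∖0} |ξ|⁻⁵` for `𝒜 ⊆ Y_L`,
`L ≥ 4R + 3`, `𝒜 ∪ y(𝒜_min) ⊂ B(0, R)` — the right-hand side of the chain, `→ 0` as `L → ∞`.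
[cite: Theil2006, §3 Proof of Corollary 1.3 (the chain of displays, preprint p. 15)] -/
theorem IsRelaxedDirichletMinimizer.relaxedPeriodicEnergy_periodize_le (hV : IsAdmissible α V)
    (hL : 0 < L) (hmin : IsRelaxedDirichletMinimizer V A A' y) (hAY : A ⊆ centredCell L) {R : ℝ}
    (hR : 0 ≤ R) (hyR : ∀ x ∈ A', ‖y x‖ ≤ R) (hAR : ∀ x ∈ A, ‖triPoint x‖ ≤ R)
    (hLR : 4 * R + 3 ≤ (L : ℝ)) :
    relaxedPeriodicEnergy V L (periodizeSet hL (dirichletSupport A A')) (periodize hL y) / 2 +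
        3 * (L : ℝ) ^ 2 ≤
      ((A'.card : ℝ) + A.card) ^ 2 * (2 * α / (L : ℝ) ^ 5 * ∑' g : ℤ × ℤ, ‖triPoint g‖⁻¹ ^ 5) := by
  have h := Theil2006.relaxedPeriodicEnergy_periodize_le hV hL hmin.2.1 hmin.1 hAY hR hyR hAR hLR
  have hm := hmin.le_dirichletEnergy_triPoint
  linarith

end Identity

end Theil2006

end Literature.MathematicalPhysics.StatisticalMechanics

end

/-! # Part: staged brick `Theil2006DirichletLatticeStructure` (sha16 9951ad0c283ec3f2) — verbatim -/

/-!
# Theil 2006, Corollary 1.3 — the end of its proof (§3, preprint p. 15): from the periodic main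
estimate (44), Dirichlet ground states are the lattice `A₂`

Topic `Literature/MathematicalPhysics/StatisticalMechanics`; companion of `Theil2006.lean` (the
named fact `Theil2006_dirichletGroundStates` = Corollary 1.3), `Theil2006DirichletMinimumDistance.lean`
(the relaxed Dirichlet problem, (13), existence), `Theil2006DirichletPeriodization.lean`
(`X_per`, `y_per`), `Theil2006DirichletPeriodicComparison.lean` ((45)/(46) and the comparison
`E_L^per(X_per,{y_per})/2 + 3L² ≤ O(L⁻⁵)` for a relaxed minimizer),
`Theil2006PeriodicLatticeStructure.lean` (`mainEstimateRHS`, the (44) hypothesis shape of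
Theorem 1.2) and `Theil2006LatticeSymmetry.lean` (`IsClampedOutside.range_eq_triangularLattice`:
(42) ∧ (43) for a clamped configuration ⇒ `{y(x)} = A₂`). Everything in this file is PROVED (no
`sorry`, no named fact introduced or discharged; D-0026).

## Source, as printed (preprint p. 15, end of the proof of Corollary 1.3)

"As `ε` is arbitrary and `L² − #Y = #𝒜 ∖ 𝒜_min` for sufficiently large `L` […] we obtain that
`𝒜_min = 𝒜`, `∂X_per = ∅` and `||y_per(x) − y_per(x')| − 1| ≤ Cε` for all `{x,x'} ∈ 𝒮_per`.
Since `y_per(x)` and `y_per(x')` are independent of `L` if `L` is sufficiently big, this proves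
that `|y_per(x) − y_per(x')| = 1` for all `{x,x'} ∈ 𝒮_per`. Hence, the set
`Ω = {y_per(x) | x ∈ A₂}` satisfies (42) and (43) and consequentially `RΩ + τ = A₂` for a rotation
`R ∈ SO(2)` and a translation `τ ∈ ℝ²`. By the periodicity of `y_per` we can choose `R = Id`.
Since `y_per(x) = y_min(x)` for all `x ∈ Y` we obtain that `τ = 0` and `y_min(x) = x` for all
`x ∈ A₂`. The proof of Corollary 1.3 is finished."

with, from p. 14 and p. 15: (44) `E_L^per(X,{y}) ≥ (1/C) ∑_{𝒮̃} (e_* + 1) + ¼ #∂X̃ − 3#X̃`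
(sign as in `Theil2006PeriodicLatticeStructure.lean`) for `(X, y)` satisfying (13), and
`I := (1/C) ∑_{𝒮_per/∼} ||y_per(x) − y_per(x')| − 1|² + ¼ #∂X̃_per + 3(L² − #Y) ≤ … ≤ 2ε`.

## What is here

* `Theil2006.isShortRange_periodize_iff`, `Theil2006.nbhdSet_periodize_eq` — **"`y_per(x)` and
  `y_per(x')` are independent of `L` if `L` is sufficiently big"**: for `L ≥ 16R + 24` the
  short bonds and the neighbourhood of a particle of `Y_L` within `B(0, R)` are the same for `y_per`
  and for `y`.
* `Theil2006.le_shortBondSum_of_isShortRange`, `Theil2006.one_le_card_defectClasses_of_mem` — a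
  distorted short bond, resp. a defect, of the periodized configuration shows up in the terms
  `∑_{𝒮̃}(e_* + 1)` resp. `#∂X̃` of (44).
* `Theil2006.structure_of_isRelaxedDirichletMinimizer` — **the three conclusions "`𝒜_min = 𝒜`,
  `∂X = ∅`, `|y(x) − y(x')| = 1` on `𝒮`"** for every relaxed Dirichlet minimizer, from (44)
  (hypothesis, with `C` independent of `L`) — PROVED: by (44), (13) for `(X_per, y_per)`
  (`lt_dist_periodize`) and the comparison of `Theil2006DirichletPeriodicComparison.lean`,
  `(1/C) S_L/2 + ¼ D_L + 3 #(𝒜 ∖ 𝒜_min) ≤ (#𝒜_min + #𝒜)² · 2αS₅/L⁵ → 0`, while a missing particle,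
  a distorted bond of `y` or a defect of `y` contributes `≥ 3`, `≥ (V_*(r)+1)/C > 0`, `≥ ¼` for all
  large `L`.
* `Theil2006.exists_structure_of_isRelaxedDirichletMinimizer` (thresholds packaged),
  `Theil2006.range_eq_triangularLattice_of_mainEstimate` — **the end of the proof**: (42) ∧ (43)
  for `Ω = {y(x)}` (`local_conditions_of_structure`) and, `y` being clamped, `Ω = A₂`
  (`IsClampedOutside.range_eq_triangularLattice`: the clamping excludes the rotations, cf. the
  misstatement of Theorem 1.2); every Dirichlet ground state is a relaxed minimizer once one
  relaxed minimizer retains all of `𝒜` (`isRelaxedDirichletMinimizer_of_isMinOn`).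
* `Theil2006_dirichletGroundStates_of_mainEstimate` — **Corollary 1.3 reduced to (44) and the
  existence of relaxed Dirichlet minimizers** (the latter PROVED for continuous `V`:
  `Theil2006.range_eq_triangularLattice_of_mainEstimate_of_continuousOn`), in the style of
  `Theil2006_periodicGroundStates_upToRotation_of_mainEstimate`.

## Rendering notes

* (44) enters as a hypothesis of the same shape as in `Theil2006PeriodicLatticeStructure.lean`
  but with the constant `C` chosen BEFORE `L` (`∀ V, ∃ C, ∀ L`; the paper's `C` is universal):
  the `L → ∞` argument of p. 15 ("independent of `L`") needs `C` not to grow with `L`. This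
  stronger-in-form hypothesis implies the one used for Theorem 1.2.
* The last sentence of the print ("`y_min(x) = x` for all `x ∈ A₂`") over-claims relative to the
  STATED conclusion `{y_min(x) | x ∈ A₂} = A₂` of Corollary 1.3 (two adjacent free particles may be
  exchanged); we prove the stated one, as vendored in `Theil2006_dirichletGroundStates`.
* We obtain (42), (43) for `Ω = {y_min(x)}` directly (for large `L` the neighbourhoods of `y_per`
  inside `Y_L` are those of `y_min`), instead of passing through `Ω_per` and "`R = Id` by
  periodicity, `τ = 0`"; the clamping gives `R = Id`, `τ = 0` at once
  (`IsClampedOutside.range_eq_triangularLattice`).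
-/

noncomputable section

open scoped BigOperators Topology
open Filter Set Metric

namespace Literature.MathematicalPhysics.StatisticalMechanics

namespace Theil2006

/-! ### Geometry of labels and of the centred cell -/

section Geometry

variable {L : ℕ}

/-- `1/3 < √3 − 1`. [folklore] -/
private theorem one_third_lt_sqrt_three_sub_one : (1 : ℝ) / 3 < √3 - 1 := by
  have h : (4 : ℝ) / 3 < √3 := by
    rw [show √3 = √(3 : ℝ) from rfl, Real.lt_sqrt (by norm_num)]
    norm_num
  linarith

/-- Coordinates are bounded by the norm in `ℝ²`. [folklore] -/
private theorem abs_apply_le_norm_plane (p : Plane) (i : Fin 2) : |p i| ≤ ‖p‖ := by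
  have h := abs_sub_apply_le_dist p 0 i
  simpa using h

/-- A lattice point of norm `≤ R` has label coordinates of absolute value `≤ 2R`. [folklore] -/
private theorem abs_label_le_of_norm_triPoint_le {k : ℤ × ℤ} {R : ℝ} (h : ‖triPoint k‖ ≤ R) :
    |(k.1 : ℝ)| ≤ 2 * R ∧ |(k.2 : ℝ)| ≤ 2 * R := by
  have h0 := abs_apply_le_norm_plane (triPoint k) 0
  have h1 := abs_apply_le_norm_plane (triPoint k) 1
  rw [triPoint_apply_zero] at h0
  rw [triPoint_apply_one] at h1
  have hs : (1 : ℝ) < √3 := by linarith [one_third_lt_sqrt_three_sub_one]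
  have h2 : |(k.2 : ℝ)| ≤ 2 * R := by
    rw [abs_mul, abs_of_pos (by positivity : (0 : ℝ) < √3 / 2)] at h1
    nlinarith [abs_nonneg (k.2 : ℝ)]
  refine ⟨?_, h2⟩
  have e : (k.1 : ℝ) = (k.1 + k.2 / 2) - k.2 / 2 := by ring
  rw [e]
  refine (abs_sub _ _).trans ?_
  rw [abs_div, abs_two]
  linarith

/-- Points of the centred cell have norm `≤ ⅞ L` (`|k_i| ≤ L/2`, `|ξ_k|² = k₁² + k₁k₂ + k₂² ≤ ¾L²`).
[folklore] -/
private theorem norm_triPoint_le_of_mem_centredCell {k : ℤ × ℤ} (hk : k ∈ centredCell L) :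
    ‖triPoint k‖ ≤ 7 / 8 * L := by
  rw [mem_centredCell_iff] at hk
  obtain ⟨⟨h1, h2⟩, h3, h4⟩ := hk
  have hb1 : 2 * k.1 ≤ (L : ℤ) ∧ -(2 * k.1) ≤ (L : ℤ) := by omega
  have hb2 : 2 * k.2 ≤ (L : ℤ) ∧ -(2 * k.2) ≤ (L : ℤ) := by omega
  have hsqZ : 4 * (k.1 ^ 2 + k.1 * k.2 + k.2 ^ 2) ≤ 3 * (L : ℤ) ^ 2 := by
    nlinarith [hb1.1, hb1.2, hb2.1, hb2.2, sq_nonneg (k.1 - k.2), sq_nonneg (k.1 + k.2)]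
  have hsq : 4 * ‖triPoint k‖ ^ 2 ≤ 3 * (L : ℝ) ^ 2 := by
    rw [norm_triPoint_sq]
    exact_mod_cast hsqZ
  have hL : (0 : ℝ) ≤ L := Nat.cast_nonneg _
  nlinarith [norm_nonneg (triPoint k)]

/-- Points off the centred cell are far from the origin: `3 (L − 1)² ≤ 16 |ξ_k|²` (`L ≥ 1`).
[folklore] -/
private theorem sq_le_norm_triPoint_sq_of_not_mem_centredCell (hL : 0 < L) {k : ℤ × ℤ}
    (hk : k ∉ centredCell L) : 3 * ((L : ℝ) - 1) ^ 2 ≤ 16 * ‖triPoint k‖ ^ 2 := by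
  rw [mem_centredCell_iff] at hk
  have hL1 : (1 : ℤ) ≤ L := by exact_mod_cast hL
  have hcoord : (L : ℤ) - 1 ≤ 2 * k.1 ∨ (L : ℤ) - 1 ≤ -(2 * k.1) ∨
      (L : ℤ) - 1 ≤ 2 * k.2 ∨ (L : ℤ) - 1 ≤ -(2 * k.2) := by omega
  have hform : ∀ a b : ℤ, 3 * a ^ 2 ≤ 4 * (a ^ 2 + a * b + b ^ 2) := fun a b => by
    nlinarith [sq_nonneg (a + 2 * b)]
  have hform' : ∀ a b : ℤ, 3 * b ^ 2 ≤ 4 * (a ^ 2 + a * b + b ^ 2) := fun a b => by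
    nlinarith [sq_nonneg (2 * a + b)]
  have hsqZ : 3 * ((L : ℤ) - 1) ^ 2 ≤ 16 * (k.1 ^ 2 + k.1 * k.2 + k.2 ^ 2) := by
    rcases hcoord with h | h | h | h
    · nlinarith [hform k.1 k.2]
    · nlinarith [hform k.1 k.2]
    · nlinarith [hform' k.1 k.2]
    · nlinarith [hform' k.1 k.2]
  rw [norm_triPoint_sq]
  exact_mod_cast hsqZ

/-- Off the centred cell the period vector is nonzero. [folklore] -/
private theorem centredQuot_ne_zero (hL : 0 < L) {k : ℤ × ℤ} (hk : k ∉ centredCell L) :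
    centredQuot hL k ≠ 0 := by
  intro h
  apply hk
  have e := centredRep_add_zsmul_centredQuot hL k
  rw [h, smul_zero, add_zero] at e
  rw [← e]
  exact centredRep_mem hL k

/-- `√3 − 1 < 1`. [folklore] -/
private theorem sqrt_three_sub_one_lt_one' : √3 - 1 < (1 : ℝ) := by
  have h : √3 < 2 := by
    rw [show √3 = √(3 : ℝ) from rfl, Real.sqrt_lt' (by norm_num)]
    norm_num
  linarith

end Geometry

/-! ### "`y_per(x)`, `y_per(x')` are independent of `L` if `L` is sufficiently big" (p. 15) -/

section Stability

variable {α : ℝ} {L : ℕ} {A : Finset (ℤ × ℤ)} {y : ℤ × ℤ → Plane}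

/-- **Short bonds near the origin are the same for `y_per` and `y` once `L ≥ 16R + 24`**: for
`y ∈ Y_𝒜^Dir` with `𝒜 ⊆ Y_L` and `|y(a)| ≤ R` on `𝒜`, a particle `x₀ ∈ Y_L` with `|y(x₀)| ≤ R`
has the same `𝒮`-partners in `y_per` and in `y` (partners off `Y_L` are at distance `≥ 3` in
both). [cite: Theil2006, §3 Proof of Corollary 1.3 («y_per(x) and y_per(x′) are independent of L if L is sufficiently big», preprint p. 15)] -/
theorem isShortRange_periodize_iff (hL : 0 < L) (hy : IsClampedOutside A y)
    (hAY : A ⊆ centredCell L) {R : ℝ} (hR : 0 ≤ R) (hyA : ∀ a ∈ A, ‖y a‖ ≤ R) (hα1 : α ≤ 1)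
    {x₀ : ℤ × ℤ} (hx₀ : x₀ ∈ centredCell L) (hx₀R : ‖y x₀‖ ≤ R) (hLR : 16 * R + 24 ≤ (L : ℝ))
    (k : ℤ × ℤ) : IsShortRange α (periodize hL y) x₀ k ↔ IsShortRange α y x₀ k := by
  by_cases hk : k ∈ centredCell L
  · unfold IsShortRange
    rw [periodize_of_mem hL hx₀, periodize_of_mem hL hk]
  · have hkA : k ∉ A := fun h => hk (hAY h)
    have hfar : ∀ p : Plane, 3 ≤ dist (y x₀) p → ¬ |dist (y x₀) p - 1| ≤ α := by
      intro p hp habs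
      have := (abs_le.1 habs).2
      linarith
    have hL0 : (0 : ℝ) ≤ L := Nat.cast_nonneg _
    constructor
    · intro h
      exfalso
      unfold IsShortRange at h
      rw [periodize_of_mem hL hx₀, periodize_apply] at h
      refine hfar _ ?_ h
      have hq0 : centredQuot hL k ≠ 0 := centredQuot_ne_zero hL hk
      have h1 : (L : ℝ) ≤ ‖(L : ℝ) • triPoint (centredQuot hL k)‖ := by
        rw [norm_smul, Real.norm_natCast]
        have := one_le_norm_triPoint hq0
        nlinarith
      have h2 : ‖y (centredRep hL k)‖ ≤ 7 / 8 * L + R := by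
        by_cases hrA : centredRep hL k ∈ A
        · have := hyA _ hrA
          linarith
        · rw [hy _ hrA]
          have := norm_triPoint_le_of_mem_centredCell (centredRep_mem hL k)
          linarith
      have h3 : (L : ℝ) / 8 - R ≤ ‖y (centredRep hL k) + (L : ℝ) • triPoint (centredQuot hL k)‖ := by
        have := norm_sub_norm_le ((L : ℝ) • triPoint (centredQuot hL k)) (-(y (centredRep hL k)))
        rw [norm_neg, sub_neg_eq_add, add_comm] at this
        linarith
      have h4 := norm_sub_norm_le (y (centredRep hL k) + (L : ℝ) • triPoint (centredQuot hL k))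
        (y x₀)
      rw [← dist_eq_norm, dist_comm] at h4
      linarith
    · intro h
      exfalso
      unfold IsShortRange at h
      rw [hy k hkA] at h
      refine hfar _ ?_ h
      have hsq := sq_le_norm_triPoint_sq_of_not_mem_centredCell hL hk
      have h5 : R + 3 ≤ ‖triPoint k‖ := by
        by_contra hlt
        rw [not_le] at hlt
        have hn := norm_nonneg (triPoint k)
        nlinarith [mul_pos (by linarith : 0 < R + 3 - ‖triPoint k‖)
          (by linarith : 0 < R + 3 + ‖triPoint k‖),
          mul_nonneg (by linarith : (0 : ℝ) ≤ (L : ℝ) - 1 - (16 * R + 23))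
            (by linarith : (0 : ℝ) ≤ (L : ℝ) - 1 + (16 * R + 23))]
      have h4 := norm_sub_norm_le (triPoint k) (y x₀)
      rw [← dist_eq_norm, dist_comm] at h4
      linarith

/-- Hence the neighbourhoods agree: `𝒩_{y_per}(x₀) = 𝒩_y(x₀)` (`L ≥ 16R + 24`).
[cite: Theil2006, §3 Proof of Corollary 1.3 (preprint p. 15)] -/
theorem nbhdSet_periodize_eq (hL : 0 < L) (hy : IsClampedOutside A y)
    (hAY : A ⊆ centredCell L) {R : ℝ} (hR : 0 ≤ R) (hyA : ∀ a ∈ A, ‖y a‖ ≤ R) (hα1 : α ≤ 1)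
    {x₀ : ℤ × ℤ} (hx₀ : x₀ ∈ centredCell L) (hx₀R : ‖y x₀‖ ≤ R) (hLR : 16 * R + 24 ≤ (L : ℝ)) :
    nbhdSet α (periodize hL y) x₀ = nbhdSet α y x₀ := by
  ext k
  rw [mem_nbhdSet_iff, mem_nbhdSet_iff, isShortRange_periodize_iff hL hy hAY hR hyA hα1 hx₀ hx₀R hLR]

end Stability

/-! ### Distorted bonds and defects lie near the hole -/

section Near

variable {α : ℝ} {A : Finset (ℤ × ℤ)} {y : ℤ × ℤ → Plane}

/-- Two clamped particles forming a short bond are at distance exactly `1` (lattice distances are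
`0`, `1` or `≥ √3`; `α < √3 − 1`). [cite: Theil2006, §2.3 Remark 2.5 (preprint p. 7)] -/
theorem dist_eq_one_of_isShortRange_clamped (hα0 : 0 ≤ α) (hα : α < √3 - 1)
    (hy : IsClampedOutside A y) {x x' : ℤ × ℤ} (hx : x ∉ A) (hx' : x' ∉ A)
    (h : IsShortRange α y x x') : dist (y x) (y x') = 1 := by
  have h' : IsShortRange α (triPoint : ℤ × ℤ → Plane) x x' := by
    unfold IsShortRange at h ⊢
    rwa [hy x hx, hy x' hx'] at h
  rw [hy x hx, hy x' hx', dist_comm, dist_triPoint]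
  exact norm_triPoint_of_mem_unitShell ((isShortRange_triPoint_iff hα0 hα).1 h')

/-- **A distorted short bond has an end in the hole**, so both ends lie in `B(0, R + 2)` when
`y(𝒜) ⊂ B(0, R)`. [cite: Theil2006, §3 Proof of Corollary 1.3 (preprint p. 15); our lemma] -/
theorem norm_le_of_isShortRange_of_dist_ne_one (hα0 : 0 ≤ α) (hα : α < √3 - 1)
    (hy : IsClampedOutside A y) {R : ℝ} (hyA : ∀ a ∈ A, ‖y a‖ ≤ R) {x x' : ℤ × ℤ}
    (h : IsShortRange α y x x') (hne : dist (y x) (y x') ≠ 1) :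
    ‖y x‖ ≤ R + 2 ∧ ‖y x'‖ ≤ R + 2 := by
  have hA : x ∈ A ∨ x' ∈ A := by
    by_contra hnot
    push Not at hnot
    exact hne (dist_eq_one_of_isShortRange_clamped hα0 hα hy hnot.1 hnot.2 h)
  have hd : dist (y x) (y x') ≤ 2 := h.dist_le.trans (by linarith [sqrt_three_sub_one_lt_one'])
  have h1 := norm_sub_norm_le (y x') (y x)
  have h2 := norm_sub_norm_le (y x) (y x')
  rw [← dist_eq_norm, dist_comm] at h1
  rw [← dist_eq_norm] at h2
  rcases hA with hx | hx'
  · have := hyA x hx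
    constructor <;> linarith
  · have := hyA x' hx'
    constructor <;> linarith

/-- **A particle far from the hole is not a defect**: if `𝒜, y(𝒜) ⊂ B(0, R)` and
`|y(x₀)| > R + 3`, the neighbourhood of `x₀` is that of the perfect lattice, which has seven
elements. [cite: Theil2006, §2.1 (definition of ∂X(y), preprint p. 4); our lemma] -/
theorem not_mem_defectSet_of_far (hα0 : 0 ≤ α) (hα : α < √3 - 1) (hy : IsClampedOutside A y)
    {R : ℝ} (hAR : ∀ a ∈ A, ‖triPoint a‖ ≤ R) (hyA : ∀ a ∈ A, ‖y a‖ ≤ R) {x₀ : ℤ × ℤ}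
    (hx₀ : R + 3 < ‖y x₀‖) : x₀ ∉ defectSet α y := by
  have hα1 : α < 1 := hα.trans sqrt_three_sub_one_lt_one'
  have hx₀A : x₀ ∉ A := fun h => by linarith [hyA x₀ h]
  have hyx₀ : y x₀ = triPoint x₀ := hy x₀ hx₀A
  have hN : nbhdSet α y x₀ = nbhdSet α (triPoint : ℤ × ℤ → Plane) x₀ := by
    ext k
    rw [mem_nbhdSet_iff, mem_nbhdSet_iff]
    apply or_congr_right
    by_cases hkA : k ∈ A
    · have h1 : ¬ IsShortRange α y x₀ k := fun h => by
        have hd := h.dist_le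
        have h4 := norm_sub_norm_le (y x₀) (y k)
        rw [← dist_eq_norm] at h4
        linarith [hyA k hkA]
      have h2 : ¬ IsShortRange α (triPoint : ℤ × ℤ → Plane) x₀ k := fun h => by
        have hd := h.dist_le
        have h4 := norm_sub_norm_le (triPoint x₀) (triPoint k)
        rw [← dist_eq_norm] at h4
        have hx₀' : R + 3 < ‖triPoint x₀‖ := by rwa [hyx₀] at hx₀
        linarith [hAR k hkA]
      exact iff_of_false h1 h2
    · unfold IsShortRange
      rw [hyx₀, hy k hkA]
  rw [mem_defectSet_iff, hN, ← mem_defectSet_iff, defectSet_triPoint_eq_empty hα0 hα]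
  exact fun h => h

end Near

/-! ### A distorted bond / a defect of a periodic configuration is seen by (44) -/

section Persistence

variable {α : ℝ} {L : ℕ} {y' : ℤ × ℤ → Plane}

/-- **One short bond bounds `∑_{𝒮̃} f` from below** (all terms nonnegative): for `L`-periodic
`y'` and `{x, x'} ∈ 𝒮(y')`, `f(|y'(x) − y'(x')|) ≤ shortBondSum α L A₂ y' f`.
[cite: Theil2006, §3 Proof of Corollary 1.3 («||y_per(x) − y_per(x′)| − 1| ≤ Cε for all {x,x′} ∈ 𝒮_per», preprint p. 15)] -/
theorem le_shortBondSum_of_isShortRange (hL : 0 < L) (hy' : IsPeriodic L y') {f : ℝ → ℝ}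
    (hf : ∀ k k' : ℤ × ℤ, IsShortRange α y' k k' → 0 ≤ f (dist (y' k) (y' k')))
    {x x' : ℤ × ℤ} (h : IsShortRange α y' x x') :
    f (dist (y' x) (y' x')) ≤ shortBondSum α L univ y' f := by
  classical
  rw [shortBondSum, cellClasses_univ]
  set c₀ := ((cellEquiv hL).symm x).1 with hc₀
  set g₀ := ((cellEquiv hL).symm x).2 with hg₀
  have hx : cellPoint c₀ + (L : ℤ) • g₀ = x := cellEquiv_symm_apply_spec hL x
  have hinner : ∀ c : Fin L × Fin L,
      0 ≤ ∑ᶠ k' ∈ {k' | k' ∈ (univ : Set (ℤ × ℤ)) ∧ IsShortRange α y' (cellPoint c) k'},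
        f (dist (y' (cellPoint c)) (y' k')) :=
    fun c => finsum_nonneg fun k' => finsum_nonneg fun hk' => hf _ _ hk'.2
  refine le_trans ?_ (Finset.single_le_sum (fun c _ => hinner c) (Finset.mem_univ c₀))
  have hfin := hy'.finite_shortRange (α := α) hL (univ : Set (ℤ × ℤ)) (cellPoint c₀)
  rw [finsum_mem_eq_finite_toFinset_sum _ hfin]
  have hmem : x' - (L : ℤ) • g₀ ∈ hfin.toFinset := by
    rw [Set.Finite.mem_toFinset]
    refine ⟨mem_univ _, ?_⟩
    have e := hy'.isShortRange_add_zsmul_iff (α := α) (cellPoint c₀) (x' - (L : ℤ) • g₀) g₀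
    rw [hx, sub_add_cancel] at e
    exact e.1 h
  have hterm : f (dist (y' (cellPoint c₀)) (y' (x' - (L : ℤ) • g₀))) = f (dist (y' x) (y' x')) := by
    rw [← hy'.dist_add_zsmul (cellPoint c₀) (x' - (L : ℤ) • g₀) g₀, hx, sub_add_cancel]
  rw [← hterm]
  exact Finset.single_le_sum (fun k' hk' => hf _ _ ((Set.Finite.mem_toFinset _).1 hk').2) hmem

/-- **A defect gives a defect class**: for `L`-periodic `y'` and `x₀ ∈ ∂X(y')`, `#∂X̃ ≥ 1`.
[cite: Theil2006, §3 Proof of Corollary 1.3 («∂X_per = ∅», preprint p. 15)] -/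
theorem one_le_card_defectClasses_of_mem (hL : 0 < L) (hy' : IsPeriodic L y') {x₀ : ℤ × ℤ}
    (h : x₀ ∈ defectSet α y') : 1 ≤ (defectClasses α L univ y').card := by
  classical
  set c₀ := ((cellEquiv hL).symm x₀).1 with hc₀
  set g₀ := ((cellEquiv hL).symm x₀).2 with hg₀
  have hx : cellPoint c₀ + (L : ℤ) • g₀ = x₀ := cellEquiv_symm_apply_spec hL x₀
  have hc : c₀ ∈ defectClasses α L univ y' := by
    rw [mem_defectClasses_univ, mem_defectSet_iff, ← hy'.ncard_nbhdSet_add_zsmul (cellPoint c₀) g₀,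
      hx]
    exact h
  exact Finset.card_pos.2 ⟨c₀, hc⟩

end Persistence

/-! ### The structure of relaxed Dirichlet minimizers (p. 15) -/

section Main

variable {α : ℝ} {V : ℝ → ℝ} {L : ℕ} {A A' : Finset (ℤ × ℤ)} {y : ℤ × ℤ → Plane}

/-- With all particles retained, `X = A₂`. [cite: Theil2006, §3 Proof of Corollary 1.3 (preprint p. 14)] -/
theorem dirichletSupport_self (A : Finset (ℤ × ℤ)) : dirichletSupport A A = univ := by
  ext k
  simp only [mem_dirichletSupport, mem_univ, iff_true]
  exact (em (k ∈ A)).symm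

/-- `#X̃_per = L² − #(𝒜 ∖ 𝒜′)` («L² − #Y = #𝒜 ∖ 𝒜_min»), real form.
[cite: Theil2006, §3 Proof of Corollary 1.3 (preprint p. 15)] -/
theorem card_cellClasses_periodizeSet_dirichletSupport (hL : 0 < L) (hAY : A ⊆ centredCell L) :
    ((cellClasses L (periodizeSet hL (dirichletSupport A A'))).card : ℝ) =
      (L : ℝ) ^ 2 - ((A \ A').card : ℝ) := by
  have h : ((cellClasses L (periodizeSet hL (dirichletSupport A A'))).card : ℤ) =
      (L : ℤ) ^ 2 - ((A \ A').card : ℤ) := card_cellClasses_periodizeSet_eq hL (A' := A') hAY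
  have h2 : (cellClasses L (periodizeSet hL (dirichletSupport A A'))).card + (A \ A').card = L ^ 2 := by
    have h' : ((cellClasses L (periodizeSet hL (dirichletSupport A A'))).card : ℤ) +
        ((A \ A').card : ℤ) = (L : ℤ) ^ 2 := by linarith
    exact_mod_cast h'
  rw [eq_sub_iff_add_eq]
  exact_mod_cast h2

/-- **The inequality fed by (44) for the periodized relaxed minimizer** (p. 15, `I ≤ … ≤ 2ε`,
ordered normalisation): for `L ≥ 16R + 24` with `𝒜 ⊆ Y_L`,
`(1/C) S_L/2 + ¼ #∂X̃_per + 3 #(𝒜 ∖ 𝒜_min) ≤ (#𝒜_min + #𝒜)² · 2αS₅/L⁵`, where `S_L` is the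
short-bond sum `∑_{𝒮̃_per}(e_* + 1)` of (44). [cite: Theil2006, §3 Proof of Corollary 1.3 ((44) for (X_per, y_per) and the chain of displays, preprint pp. 14–15)] -/
theorem mainEstimate_periodize_le (hα : 0 < α) (hV : IsAdmissible α V) {C : ℝ}
    (h44 : ∀ L : ℕ, 0 < L → ∀ (X : Set (ℤ × ℤ)) (y : ℤ × ℤ → Plane), IsPeriodicSet L X →
      IsPeriodic L y → (∀ x ∈ X, ∀ x' ∈ X, x ≠ x' → 1 - α < dist (y x) (y x')) →
        mainEstimateRHS C α V L X y ≤ relaxedPeriodicEnergy V L X y / 2)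
    (hmin : IsRelaxedDirichletMinimizer V A A' y)
    (h13 : ∀ x, (x ∉ A ∨ x ∈ A') → ∀ x', (x' ∉ A ∨ x' ∈ A') → x ≠ x' → 1 - α < dist (y x) (y x'))
    {R : ℝ} (hR : 0 ≤ R) (hyR : ∀ x ∈ A', ‖y x‖ ≤ R) (hAR : ∀ a ∈ A, ‖triPoint a‖ ≤ R)
    (hL : 0 < L) (hAY : A ⊆ centredCell L) (hLR : 4 * R + 3 ≤ (L : ℝ)) :
    1 / C * (shortBondSum α L (periodizeSet hL (dirichletSupport A A')) (periodize hL y)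
        (fun r => renormalizedPotential V r + 1) / 2) +
      1 / 4 * ((defectClasses α L (periodizeSet hL (dirichletSupport A A')) (periodize hL y)).card : ℝ) +
      3 * ((A \ A').card : ℝ) ≤
    ((A'.card : ℝ) + A.card) ^ 2 * (2 * α / (L : ℝ) ^ 5 * ∑' g : ℤ × ℤ, ‖triPoint g‖⁻¹ ^ 5) := by
  have hXA : ∀ k, k ∉ dirichletSupport A A' → k ∈ A := fun k hk => by
    by_contra h
    exact hk (Or.inl h)
  have h13per := lt_dist_periodize hL hα hXA hmin.2.1 (fun k hk k' hk' hne => h13 k hk k' hk' hne)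
    (fun k hk hkA => hyR k ((mem_dirichletSupport.1 hk).resolve_left fun h => h hkA)) hAY
    (by linarith : 2 * R + 2 ≤ (L : ℝ))
  have h44L := h44 L hL _ _ (isPeriodicSet_periodizeSet hL _) (isPeriodic_periodize hL y) h13per
  have hcmp := hmin.relaxedPeriodicEnergy_periodize_le hV hL hAY hR hyR hAR hLR
  rw [mainEstimateRHS, card_cellClasses_periodizeSet_dirichletSupport hL hAY] at h44L
  linarith

/-- **Structure of relaxed Dirichlet minimizers** — the conclusions "`𝒜_min = 𝒜`, `∂X = ∅`,
`|y(x) − y(x')| = 1` for all `{x,x'} ∈ 𝒮`" of p. 15, together with (13), for every minimizer of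
the relaxed Dirichlet problem, from the main estimate (44) with a constant `C` independent of
`L`: with `R` a radius containing `𝒜`, `y(𝒜_min)`, and hence every distorted bond and every
defect, and `L ≥ 16R + 24`: `(1/C) S_L/2 + ¼ D_L + 3#(𝒜 ∖ 𝒜_min) ≤ K/L⁵`
(`mainEstimate_periodize_le`), whereas a missing particle contributes `3`, a distorted bond
`{x,x'}` of `y` contributes `(V_*(|y(x) − y(x')|) + 1)/C > 0` to the first term for all large `L`
(`le_shortBondSum_of_isShortRange`, `isShortRange_periodize_iff`; `V_* + 1 = 0` only at length
`1`, `exists_eq_one_of_renormalizedPotential_eq`) and a defect of `y` contributes `¼`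
(`nbhdSet_periodize_eq`, `one_le_card_defectClasses_of_mem`).
[cite: Theil2006, §3 Proof of Corollary 1.3 (last paragraph, preprint p. 15)] -/
theorem structure_of_isRelaxedDirichletMinimizer (hα : 0 < α) (hα₁ : α < 1 / 13447168)
    (hV : IsAdmissible α V)
    (hone : ∀ r : ℝ, 1 - α < r → r ≤ 1 + α → renormalizedPotential V r = -1 → r = 1)
    {C : ℝ} (hC : 0 < C)
    (h44 : ∀ L : ℕ, 0 < L → ∀ (X : Set (ℤ × ℤ)) (y : ℤ × ℤ → Plane), IsPeriodicSet L X →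
      IsPeriodic L y → (∀ x ∈ X, ∀ x' ∈ X, x ≠ x' → 1 - α < dist (y x) (y x')) →
        mainEstimateRHS C α V L X y ≤ relaxedPeriodicEnergy V L X y / 2)
    (hmin : IsRelaxedDirichletMinimizer V A A' y) :
    A' = A ∧ (∀ x, x ∉ defectSet α y) ∧ (∀ x x', IsShortRange α y x x' → dist (y x) (y x') = 1) ∧
      ∀ x x', x ≠ x' → 1 - α < dist (y x) (y x') := by
  classical
  have hα3 : α < √3 - 1 := by linarith [one_third_lt_sqrt_three_sub_one]
  have hα1 : α < 1 := by linarith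
  have hA' := hmin.1
  have hy := hmin.2.1
  have h13 : ∀ x, (x ∉ A ∨ x ∈ A') → ∀ x', (x' ∉ A ∨ x' ∈ A') → x ≠ x' →
      1 - α < dist (y x) (y x') := fun x hx x' hx' hne => hmin.lt_dist hα hα₁ hV hx hx' hne
  -- a radius containing the hole and the free particles, with room for neighbours and defects
  set R : ℝ := ∑ a ∈ A, ‖triPoint a‖ + 4 with hRdef
  have hsum0 : 0 ≤ ∑ a ∈ A, ‖triPoint a‖ := Finset.sum_nonneg fun a _ => norm_nonneg _
  have hR0 : 0 ≤ R := by rw [hRdef]; linarith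
  have hAR : ∀ a ∈ A, ‖triPoint a‖ ≤ R - 4 := fun a ha => by
    rw [hRdef]
    linarith [Finset.single_le_sum (fun a _ => norm_nonneg (triPoint a)) ha]
  have hAR' : ∀ a ∈ A, ‖triPoint a‖ ≤ R := fun a ha => by linarith [hAR a ha]
  have hyR : ∀ x ∈ A', ‖y x‖ ≤ R - 3 := fun x hx => by
    obtain ⟨a, ha, hd⟩ := hmin.exists_dist_triPoint_le_one hα hα₁ hV hx
    have h4 := norm_sub_norm_le (y x) (triPoint a)
    rw [← dist_eq_norm] at h4
    linarith [hAR a ha]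
  have hyR' : ∀ x ∈ A', ‖y x‖ ≤ R := fun x hx => by linarith [hyR x hx]
  -- the labels of `𝒜` and of every clamped particle in `B(0, R)` lie in `Y_L` for `L ≥ 2N + 2`
  set N : ℕ := ⌈2 * R⌉₊ with hNdef
  have hlab : ∀ k : ℤ × ℤ, ‖triPoint k‖ ≤ R → |k.1| ≤ (N : ℤ) ∧ |k.2| ≤ (N : ℤ) := fun k hk => by
    have h := abs_label_le_of_norm_triPoint_le hk
    have hN' : 2 * R ≤ (N : ℝ) := Nat.le_ceil _
    have h1 : |(k.1 : ℝ)| ≤ (N : ℝ) := h.1.trans hN'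
    have h2 : |(k.2 : ℝ)| ≤ (N : ℝ) := h.2.trans hN'
    exact ⟨by exact_mod_cast h1, by exact_mod_cast h2⟩
  set L₀ : ℕ := max (2 * N + 2) ⌈16 * R + 24⌉₊ with hL₀def
  have hcellA : ∀ L : ℕ, L₀ ≤ L → A ⊆ centredCell L := fun L hL a ha =>
    mem_centredCell_of_abs_le (hlab a (hAR' a ha)).1 (hlab a (hAR' a ha)).2
      (le_trans (le_max_left _ _) hL)
  have hcell : ∀ L : ℕ, L₀ ≤ L → ∀ k : ℤ × ℤ, ‖y k‖ ≤ R → k ∈ centredCell L := fun L hL k hk => by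
    by_cases hkA : k ∈ A
    · exact hcellA L hL hkA
    · rw [hy k hkA] at hk
      exact mem_centredCell_of_abs_le (hlab k hk).1 (hlab k hk).2 (le_trans (le_max_left _ _) hL)
  have hL16 : ∀ L : ℕ, L₀ ≤ L → 16 * R + 24 ≤ (L : ℝ) := fun L hL =>
    (Nat.le_ceil _).trans (by exact_mod_cast (le_max_right _ _).trans hL)
  have hL₀pos : ∀ L : ℕ, L₀ ≤ L → 0 < L := fun L hL =>
    lt_of_lt_of_le (by omega : 0 < 2 * N + 2) ((le_max_left _ _).trans hL)
  -- the quantity controlled by (44) and its bound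
  set S : ℝ := ∑' g : ℤ × ℤ, ‖triPoint g‖⁻¹ ^ 5 with hSdef
  have hS0 : 0 ≤ S := tsum_nonneg fun g => by positivity
  set K : ℝ := ((A'.card : ℝ) + A.card) ^ 2 * (2 * α * S) with hKdef
  have hK0 : 0 ≤ K := by positivity
  have hQ : ∀ (L : ℕ) (hL : 0 < L), L₀ ≤ L →
      1 / C * (shortBondSum α L (periodizeSet hL (dirichletSupport A A')) (periodize hL y)
          (fun r => renormalizedPotential V r + 1) / 2) +
        1 / 4 * ((defectClasses α L (periodizeSet hL (dirichletSupport A A'))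
          (periodize hL y)).card : ℝ) +
        3 * ((A \ A').card : ℝ) ≤ K / (L : ℝ) ^ 5 := by
    intro L hL hLe
    have h := mainEstimate_periodize_le hα hV h44 hmin h13 hR0 hyR' hAR' hL (hcellA L hLe)
      (by linarith [hL16 L hLe])
    have e : ((A'.card : ℝ) + A.card) ^ 2 * (2 * α / (L : ℝ) ^ 5 * S) = K / (L : ℝ) ^ 5 := by
      rw [hKdef]
      ring
    linarith [e.le, e.ge]
  -- `K / L⁵ → 0`
  have hsmall : ∀ δ : ℝ, 0 < δ → ∃ L : ℕ, L₀ ≤ L ∧ K / (L : ℝ) ^ 5 < δ := by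
    intro δ hδ
    refine ⟨max L₀ (⌈K / δ⌉₊ + 1), le_max_left _ _, ?_⟩
    set L : ℕ := max L₀ (⌈K / δ⌉₊ + 1) with hLdef
    have hL1 : (1 : ℝ) ≤ L := by exact_mod_cast hL₀pos L (le_max_left _ _)
    have hLK : K / δ < (L : ℝ) := by
      have h1 : K / δ ≤ (⌈K / δ⌉₊ : ℝ) := Nat.le_ceil _
      have h2 : ((⌈K / δ⌉₊ + 1 : ℕ) : ℝ) ≤ L := by exact_mod_cast le_max_right _ _
      push_cast at h2
      linarith
    have hL5 : (L : ℝ) ≤ (L : ℝ) ^ 5 := by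
      calc (L : ℝ) = (L : ℝ) ^ 1 := (pow_one _).symm
        _ ≤ (L : ℝ) ^ 5 := pow_le_pow_right₀ hL1 (by norm_num)
    have hL0 : (0 : ℝ) < L := by linarith
    calc K / (L : ℝ) ^ 5 ≤ K / L := div_le_div_of_nonneg_left hK0 hL0 hL5
      _ < δ := by rw [div_lt_iff₀ hL0]; rw [div_lt_iff₀ hδ] at hLK; linarith
  -- nonnegativity of the two other terms
  have hSnn : ∀ (L : ℕ) (hL : 0 < L) (X : Set (ℤ × ℤ)),
      0 ≤ 1 / C * (shortBondSum α L X (periodize hL y) (fun r => renormalizedPotential V r + 1) / 2) :=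
    fun L hL X => by
      have := hV.toIsNormalized.shortBondSum_nonneg (L := L) (X := X) (y := periodize hL y) hα1
      positivity
  have hDnn : ∀ (L : ℕ) (hL : 0 < L) (X : Set (ℤ × ℤ)),
      0 ≤ 1 / 4 * ((defectClasses α L X (periodize hL y)).card : ℝ) := fun L hL X => by positivity
  -- (a) `𝒜_min = 𝒜`
  have hAA : A' = A := by
    by_contra hne
    have hpos : 1 ≤ ((A \ A').card : ℝ) := by
      have : (A \ A').Nonempty := by
        rw [Finset.sdiff_nonempty]
        exact fun h => hne (Finset.Subset.antisymm hA' h)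
      exact_mod_cast Finset.card_pos.2 this
    obtain ⟨L, hLe, hLδ⟩ := hsmall 3 (by norm_num)
    have hL := hL₀pos L hLe
    have h := hQ L hL hLe
    linarith [hSnn L hL (periodizeSet hL (dirichletSupport A A')),
      hDnn L hL (periodizeSet hL (dirichletSupport A A'))]
  subst hAA
  -- now `X = A₂`, `X_per = A₂`, all of `y(𝒜)` lies in `B(0, R − 3)`
  have hyA : ∀ a ∈ A', ‖y a‖ ≤ R := hyR'
  have hXu : ∀ (L : ℕ) (hL : 0 < L), periodizeSet hL (dirichletSupport A' A') = univ := fun L hL => by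
    rw [dirichletSupport_self, periodizeSet_univ]
  have hQ' : ∀ (L : ℕ) (hL : 0 < L), L₀ ≤ L →
      1 / C * (shortBondSum α L univ (periodize hL y) (fun r => renormalizedPotential V r + 1) / 2) +
        1 / 4 * ((defectClasses α L univ (periodize hL y)).card : ℝ) ≤ K / (L : ℝ) ^ 5 := by
    intro L hL hLe
    have h := hQ L hL hLe
    rw [hXu L hL, Finset.sdiff_self, Finset.card_empty, Nat.cast_zero, mul_zero, add_zero] at h
    exact h
  have h13all : ∀ x x', x ≠ x' → 1 - α < dist (y x) (y x') := fun x x' hne =>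
    h13 x (em (x ∈ A')).symm x' (em (x' ∈ A')).symm hne
  -- (b) unit bonds
  have hbond : ∀ x x', IsShortRange α y x x' → dist (y x) (y x') = 1 := by
    intro x x' hxx'
    by_contra hne
    set f : ℝ := renormalizedPotential V (dist (y x) (y x')) + 1 with hfdef
    have hf0 : 0 ≤ f := hV.toIsNormalized.renormalizedPotential_add_one_nonneg hα1 hxx'
    have hfpos : 0 < f := by
      rcases hf0.lt_or_eq with h | h
      · exact h
      · exfalso
        refine hne (hone _ (h13all x x' (hxx'.ne hα1)) hxx'.dist_le ?_)
        rw [hfdef] at h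
        linarith
    obtain ⟨hxR, hx'R⟩ := norm_le_of_isShortRange_of_dist_ne_one hα.le hα3 hy hyR hxx' hne
    obtain ⟨L, hLe, hLδ⟩ := hsmall (f / (2 * C)) (by positivity)
    have hL := hL₀pos L hLe
    have hLR := hL16 L hLe
    have hxY : x ∈ centredCell L := hcell L hLe x (by linarith)
    have hx'Y : x' ∈ centredCell L := hcell L hLe x' (by linarith)
    have hper : IsShortRange α (periodize hL y) x x' :=
      (isShortRange_periodize_iff hL hy (hcellA L hLe) hR0 hyA hα1.le hxY (by linarith)
        hLR x').2 hxx'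
    have hle := le_shortBondSum_of_isShortRange hL (isPeriodic_periodize hL y)
      (f := fun r => renormalizedPotential V r + 1)
      (fun k k' hkk' => hV.toIsNormalized.renormalizedPotential_add_one_nonneg hα1 hkk') hper
    rw [periodize_of_mem hL hxY, periodize_of_mem hL hx'Y] at hle
    have h := hQ' L hL hLe
    have hD := hDnn L hL univ
    -- `f ≤ S_L` and `(1/C) S_L / 2 ≤ K/L⁵ < f/(2C)`
    have h1 : 1 / C * (f / 2) ≤ 1 / C * (shortBondSum α L univ (periodize hL y)
        (fun r => renormalizedPotential V r + 1) / 2) :=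
      mul_le_mul_of_nonneg_left (by linarith) (by positivity)
    have h2 : 1 / C * (f / 2) < f / (2 * C) := by linarith
    have h3 : 1 / C * (f / 2) = f / (2 * C) := by field_simp
    linarith
  -- (c) no defects
  have hdef : ∀ x, x ∉ defectSet α y := by
    intro x₀ hx₀
    have hx₀R : ‖y x₀‖ ≤ R := by
      by_contra hlt
      rw [not_le] at hlt
      exact not_mem_defectSet_of_far hα.le hα3 hy (R := R - 3) (fun a ha => by linarith [hAR a ha])
        (fun a ha => hyR a ha) (by linarith) hx₀
    obtain ⟨L, hLe, hLδ⟩ := hsmall (1 / 4) (by norm_num)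
    have hL := hL₀pos L hLe
    have hLR := hL16 L hLe
    have hx₀Y : x₀ ∈ centredCell L := hcell L hLe x₀ hx₀R
    have hN : nbhdSet α (periodize hL y) x₀ = nbhdSet α y x₀ :=
      nbhdSet_periodize_eq hL hy (hcellA L hLe) hR0 hyA hα1.le hx₀Y hx₀R hLR
    have hx₀' : x₀ ∈ defectSet α (periodize hL y) := by
      rw [mem_defectSet_iff, hN]
      exact hx₀
    have hcard := one_le_card_defectClasses_of_mem hL (isPeriodic_periodize hL y) hx₀'
    have hcard' : (1 : ℝ) ≤ (defectClasses α L univ (periodize hL y)).card := by exact_mod_cast hcard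
    have h := hQ' L hL hLe
    have hS := hSnn L hL univ
    linarith
  exact ⟨rfl, hdef, hbond, h13all⟩

/-- **Structure of relaxed Dirichlet minimizers, thresholds packaged**: there is `α₀ > 0` such
that for `0 < α < α₀`, `V` satisfying (1)–(5), and (44) with a constant `C` (uniform in `L`),
every relaxed Dirichlet minimizer `(𝒜_min, y_min)` has `𝒜_min = 𝒜`, no defects, all short bonds
of length `1`, and (13). [cite: Theil2006, §3 Proof of Corollary 1.3 (last paragraph, preprint p. 15)] -/
theorem exists_structure_of_isRelaxedDirichletMinimizer :
    ∃ α₀ : ℝ, 0 < α₀ ∧ α₀ < 1 / 3 ∧ ∀ α : ℝ, 0 < α → α < α₀ → ∀ V : ℝ → ℝ, IsAdmissible α V →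
      ∀ C : ℝ, 0 < C →
        (∀ L : ℕ, 0 < L → ∀ (X : Set (ℤ × ℤ)) (y : ℤ × ℤ → Plane), IsPeriodicSet L X →
          IsPeriodic L y → (∀ x ∈ X, ∀ x' ∈ X, x ≠ x' → 1 - α < dist (y x) (y x')) →
            mainEstimateRHS C α V L X y ≤ relaxedPeriodicEnergy V L X y / 2) →
        ∀ (A A' : Finset (ℤ × ℤ)) (y : ℤ × ℤ → Plane), IsRelaxedDirichletMinimizer V A A' y →
          A' = A ∧ (∀ x, x ∉ defectSet α y) ∧
            (∀ x x', IsShortRange α y x x' → dist (y x) (y x') = 1) ∧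
              ∀ x x', x ≠ x' → 1 - α < dist (y x) (y x') := by
  obtain ⟨α₂, hα₂, hone⟩ := exists_eq_one_of_renormalizedPotential_eq
  refine ⟨min (1 / 13447168) α₂, lt_min (by norm_num) hα₂,
    (min_le_left _ _).trans_lt (by norm_num), ?_⟩
  intro α hα hαlt V hV C hC h44 A A' y hmin
  exact structure_of_isRelaxedDirichletMinimizer hα (lt_of_lt_of_le hαlt (min_le_left _ _)) hV
    (fun r h1 h2 h3 => hone α V hα (lt_of_lt_of_le hαlt (min_le_right _ _)) hV r h1 h2 h3) hC h44
    hmin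

/-- **"Hence `Ω = {y(x) | x ∈ A₂}` satisfies (42) and (43) and consequentially … `= A₂`"**: a
clamped configuration with (13), no defects and unit short bonds is onto the lattice.
[cite: Theil2006, §3 Proof of Corollary 1.3 (last paragraph, preprint p. 15)] -/
theorem range_eq_triangularLattice_of_structure (hα : 0 < α) (hα1 : α < 1)
    (hy : IsClampedOutside A y) (h13 : ∀ x x', x ≠ x' → 1 - α < dist (y x) (y x'))
    (hdef : ∀ x, x ∉ defectSet α y) (hbond : ∀ x x', IsShortRange α y x x' → dist (y x) (y x') = 1) :
    Set.range y = triangularLattice := by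
  obtain ⟨h42, h43⟩ := local_conditions_of_structure hα hα1 h13 hdef hbond
  exact hy.range_eq_triangularLattice h42 h43

end Main

end Theil2006

/-! ### Corollary 1.3 from (44) -/

open Theil2006


/-- **Theil 2006, Corollary 1.3 reduced to the main estimate (44) and the existence of relaxed
Dirichlet minimizers** (the printed proof, pp. 14–15, made rigorous): if (44) holds for all
periodic `(X, y)` satisfying (13) with a constant `C` independent of `L` (Theorem 1.2's
mechanism, §3 (44), preprint p. 14), and the relaxed Dirichlet problem has
minimizers ("compactness arguments", p. 14; PROVED for continuous `V` in
`Theil2006DirichletMinimumDistance.lean`), then every ground state `y` of `E_𝒜` over `Y_𝒜^Dir`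
has `{y(x) | x ∈ A₂} = A₂`: a relaxed minimizer `(𝒜_min, y_min)` exists, has `𝒜_min = 𝒜`
(`exists_structure_of_isRelaxedDirichletMinimizer`), so `y` itself is a relaxed minimizer
(`isRelaxedDirichletMinimizer_of_isMinOn`), hence has no defects, unit bonds and (13), i.e. (42)
and (43), and the clamping pins the lattice (`IsClampedOutside.range_eq_triangularLattice`).
[cite: Theil2006, Corollary 1.3 and §3 Proof of Corollary 1.3 (preprint pp. 3, 14–15)] -/
theorem Theil2006_dirichletGroundStates_of_mainEstimate
    (h44 : ∃ α₁ : ℝ, 0 < α₁ ∧ ∀ α : ℝ, 0 < α → α < α₁ → ∀ V : ℝ → ℝ, IsAdmissible α V →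
      ∃ C : ℝ, 0 < C ∧ ∀ L : ℕ, 0 < L → ∀ (X : Set (ℤ × ℤ)) (y : ℤ × ℤ → Plane),
        IsPeriodicSet L X → IsPeriodic L y →
          (∀ x ∈ X, ∀ x' ∈ X, x ≠ x' → 1 - α < dist (y x) (y x')) →
            mainEstimateRHS C α V L X y ≤ relaxedPeriodicEnergy V L X y / 2)
    (hex : ∃ α₂ : ℝ, 0 < α₂ ∧ ∀ α : ℝ, 0 < α → α < α₂ → ∀ V : ℝ → ℝ, IsAdmissible α V →
      ∀ A : Finset (ℤ × ℤ), ∃ (A' : Finset (ℤ × ℤ)) (y : ℤ × ℤ → Plane),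
        IsRelaxedDirichletMinimizer V A A' y) :
    Theil2006_dirichletGroundStates := by
  obtain ⟨α₀, hα₀, hα₀3, hstr⟩ := exists_structure_of_isRelaxedDirichletMinimizer
  obtain ⟨α₁, hα₁, h44⟩ := h44
  obtain ⟨α₂, hα₂, hex⟩ := hex
  refine ⟨min α₀ (min α₁ α₂), lt_min hα₀ (lt_min hα₁ hα₂), (min_le_left _ _).trans_lt hα₀3, ?_⟩
  intro α hα hαlt V hV A y hy hmin
  have hα0' : α < α₀ := hαlt.trans_le (min_le_left _ _)
  have hα1' : α < α₁ := hαlt.trans_le ((min_le_right _ _).trans (min_le_left _ _))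
  have hα2' : α < α₂ := hαlt.trans_le ((min_le_right _ _).trans (min_le_right _ _))
  obtain ⟨C, hC, h44C⟩ := h44 α hα hα1' V hV
  obtain ⟨A₀, y₀, h₀⟩ := hex α hα hα2' V hV A
  obtain ⟨rfl, -⟩ := hstr α hα hα0' V hV C hC h44C A A₀ y₀ h₀
  have hminR := isRelaxedDirichletMinimizer_of_isMinOn h₀ hy hmin
  obtain ⟨-, hdef, hbond, h13⟩ := hstr α hα hα0' V hV C hC h44C _ _ y hminR
  exact range_eq_triangularLattice_of_structure hα (by linarith) hy h13 hdef hbond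

/-- **Corollary 1.3 for continuous admissible `V`, from (44) alone**: the existence of relaxed
Dirichlet minimizers being PROVED for continuous `V` (`exists_isRelaxedDirichletMinimizer`), the
only remaining input is the main estimate (44) (uniform `C`).
[cite: Theil2006, Corollary 1.3 and §3 Proof of Corollary 1.3 (preprint pp. 3, 14–15)] -/
theorem range_eq_triangularLattice_of_mainEstimate_of_continuousOn
    (h44 : ∃ α₁ : ℝ, 0 < α₁ ∧ ∀ α : ℝ, 0 < α → α < α₁ → ∀ V : ℝ → ℝ, IsAdmissible α V →
      ∃ C : ℝ, 0 < C ∧ ∀ L : ℕ, 0 < L → ∀ (X : Set (ℤ × ℤ)) (y : ℤ × ℤ → Plane),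
        IsPeriodicSet L X → IsPeriodic L y →
          (∀ x ∈ X, ∀ x' ∈ X, x ≠ x' → 1 - α < dist (y x) (y x')) →
            mainEstimateRHS C α V L X y ≤ relaxedPeriodicEnergy V L X y / 2) :
    ∃ α₀ : ℝ, 0 < α₀ ∧ α₀ < 1 / 3 ∧ ∀ α : ℝ, 0 < α → α < α₀ → ∀ V : ℝ → ℝ, IsAdmissible α V →
      ContinuousOn V (Ici 0) → ∀ (A : Finset (ℤ × ℤ)) (y : ℤ × ℤ → Plane), IsClampedOutside A y →
        (∀ y' : ℤ × ℤ → Plane, IsClampedOutside A y' →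
          dirichletEnergy V A y ≤ dirichletEnergy V A y') →
        Set.range y = triangularLattice := by
  obtain ⟨α₀, hα₀, hα₀3, hstr⟩ := exists_structure_of_isRelaxedDirichletMinimizer
  obtain ⟨α₁, hα₁, h44⟩ := h44
  refine ⟨min α₀ (min α₁ (1 / 13447168)), lt_min hα₀ (lt_min hα₁ (by norm_num)),
    (min_le_left _ _).trans_lt hα₀3, ?_⟩
  intro α hα hαlt V hV hVc A y hy hmin
  have hα0' : α < α₀ := hαlt.trans_le (min_le_left _ _)
  have hα1' : α < α₁ := hαlt.trans_le ((min_le_right _ _).trans (min_le_left _ _))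
  have hα2' : α < 1 / 13447168 := hαlt.trans_le ((min_le_right _ _).trans (min_le_right _ _))
  obtain ⟨C, hC, h44C⟩ := h44 α hα hα1' V hV
  obtain ⟨A₀, y₀, h₀⟩ := exists_isRelaxedDirichletMinimizer hα hα2' hV hVc A
  obtain ⟨rfl, -⟩ := hstr α hα hα0' V hV C hC h44C A A₀ y₀ h₀
  have hminR := isRelaxedDirichletMinimizer_of_isMinOn h₀ hy hmin
  obtain ⟨-, hdef, hbond, h13⟩ := hstr α hα hα0' V hV C hC h44C _ _ y hminR
  exact range_eq_triangularLattice_of_structure hα (by linarith) hy h13 hdef hbond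

/-! ### One main estimate for Theorem 1.2 and Corollary 1.3 -/

/-- The uniform-in-`L` main estimate (44) (the paper's `C` is a universal constant) implies the
per-`L` form under which `Theil2006PeriodicLatticeStructure.lean` reduces Theorem 1.2.
[cite: Theil2006, §3 (44) (preprint p. 14)] -/
theorem Theil2006.mainEstimate_perL_of_uniform
    (h44 : ∃ α₁ : ℝ, 0 < α₁ ∧ ∀ α : ℝ, 0 < α → α < α₁ → ∀ V : ℝ → ℝ, IsAdmissible α V →
      ∃ C : ℝ, 0 < C ∧ ∀ L : ℕ, 0 < L → ∀ (X : Set (ℤ × ℤ)) (y : ℤ × ℤ → Plane),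
        IsPeriodicSet L X → IsPeriodic L y →
          (∀ x ∈ X, ∀ x' ∈ X, x ≠ x' → 1 - α < dist (y x) (y x')) →
            mainEstimateRHS C α V L X y ≤ relaxedPeriodicEnergy V L X y / 2) :
    ∃ α₁ : ℝ, 0 < α₁ ∧ ∀ α : ℝ, 0 < α → α < α₁ → ∀ L : ℕ, 0 < L → ∀ V : ℝ → ℝ,
      IsAdmissible α V → ∃ C : ℝ, 0 < C ∧
        ∀ (X : Set (ℤ × ℤ)) (y : ℤ × ℤ → Plane), IsPeriodicSet L X → IsPeriodic L y →
          (∀ x ∈ X, ∀ x' ∈ X, x ≠ x' → 1 - α < dist (y x) (y x')) →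
            mainEstimateRHS C α V L X y ≤ relaxedPeriodicEnergy V L X y / 2 := by
  obtain ⟨α₁, hα₁, h⟩ := h44
  refine ⟨α₁, hα₁, fun α hα hα' L hL V hV => ?_⟩
  obtain ⟨C, hC, hC'⟩ := h α hα hα' V hV
  exact ⟨C, hC, hC' L hL⟩

/-- **Theorem 1.2 (corrected, up to rotation) and Corollary 1.3 from ONE proof of (44).** Given
the main estimate (44) for the relaxed periodic problem with a universal constant `C`, and the two
existence assertions of §3 (relaxed periodic minimizers, p. 13; relaxed Dirichlet minimizers,
p. 14 — both PROVED in the tree for continuous `V`), both named facts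
`Theil2006_periodicGroundStates_upToRotation` and `Theil2006_dirichletGroundStates` follow
(`Theil2006_periodicGroundStates_upToRotation_of_mainEstimate`,
`Theil2006_dirichletGroundStates_of_mainEstimate`).
[cite: Theil2006, §3 (44) and the proofs of Theorem 1.2 and Corollary 1.3 (preprint pp. 13–15)] -/
theorem Theil2006_periodic_and_dirichletGroundStates_of_mainEstimate
    (h44 : ∃ α₁ : ℝ, 0 < α₁ ∧ ∀ α : ℝ, 0 < α → α < α₁ → ∀ V : ℝ → ℝ, IsAdmissible α V →
      ∃ C : ℝ, 0 < C ∧ ∀ L : ℕ, 0 < L → ∀ (X : Set (ℤ × ℤ)) (y : ℤ × ℤ → Plane),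
        IsPeriodicSet L X → IsPeriodic L y →
          (∀ x ∈ X, ∀ x' ∈ X, x ≠ x' → 1 - α < dist (y x) (y x')) →
            mainEstimateRHS C α V L X y ≤ relaxedPeriodicEnergy V L X y / 2)
    (hexPer : ∃ α₂ : ℝ, 0 < α₂ ∧ ∀ α : ℝ, 0 < α → α < α₂ → ∀ L : ℕ, 0 < L → ∀ V : ℝ → ℝ,
      IsAdmissible α V → ∃ (X₀ : Set (ℤ × ℤ)) (y₀ : ℤ × ℤ → Plane), IsRelaxedMinimizer V L X₀ y₀)
    (hexDir : ∃ α₃ : ℝ, 0 < α₃ ∧ ∀ α : ℝ, 0 < α → α < α₃ → ∀ V : ℝ → ℝ, IsAdmissible α V →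
      ∀ A : Finset (ℤ × ℤ), ∃ (A' : Finset (ℤ × ℤ)) (y : ℤ × ℤ → Plane),
        IsRelaxedDirichletMinimizer V A A' y) :
    Theil2006_periodicGroundStates_upToRotation ∧ Theil2006_dirichletGroundStates :=
  ⟨Theil2006_periodicGroundStates_upToRotation_of_mainEstimate
      (Theil2006.mainEstimate_perL_of_uniform h44) hexPer,
    Theil2006_dirichletGroundStates_of_mainEstimate h44 hexDir⟩

end Literature.MathematicalPhysics.StatisticalMechanics

end

/-! # Part: staged brick `Theil2006RelaxedMinimizers` (sha16 667da6c3e155766f) — verbatim -/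

/-!
# Theil 2006, §3: the relaxed periodic and Dirichlet minimizers EXIST for every admissible `V`
— the undeformed lattice is one, by the main estimate (44) (so Theorem 1.2 and Corollary 1.3
need no existence hypothesis)

Topic `Literature/MathematicalPhysics/StatisticalMechanics`; companion of
`Theil2006PeriodicLatticeStructure.lean` (end of the proof of Theorem 1.2 from (44) + existence
of a relaxed periodic minimizer), `Theil2006DirichletLatticeStructure.lean` (Corollary 1.3 from
(44) + existence of a relaxed Dirichlet minimizer), `Theil2006PeriodicMinimumDistance.lean`
(Lemma 3.1) and `Theil2006DirichletMinimumDistance.lean` (its Dirichlet twin). Everything here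
is PROVED (no `sorry`, no definition, no named fact introduced; D-0026).

## Source, as printed, and what this file settles

F. Theil, *A proof of crystallization in two dimensions*, Comm. Math. Phys. **262** (2006)
209–236, §3 (accepted preprint of 26 Aug 2005, pp. 13–15). The printed proofs of Theorem 1.2
and Corollary 1.3 start from a minimizer of a RELAXED problem: p. 13, "since there are only
`2^{L²}` possible `L`-periodic sets `X`, a minimizer `(X_min, y_min)` of `E_L^per` exists";
p. 14, "Let `𝒜_min, y_min` be the minimizer of `E(·, ·)`". For the real-valued potentials of
`Theil2006.IsAdmissible` — (2) is only the inequality `V ≥ 1/α` on `[0, 1 − α]`, no continuity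
at `1 − α` — the relaxed energies need not be lower semicontinuous, and the tree proved these two
existence assertions for CONTINUOUS `V` only (`Theil2006.exists_isRelaxedMinimizer`,
`Theil2006.exists_isRelaxedDirichletMinimizer`), keeping them as the hypotheses `hexPer` /
`hexDir` of `Theil2006_periodic_and_dirichletGroundStates_of_mainEstimate` for general `V`.

This file removes both hypotheses: **given the main estimate (44), the undeformed lattice
`(A₂, x ↦ x)` is itself a minimizer of the relaxed periodic problem, and `(𝒜, x ↦ x)` one of the
relaxed Dirichlet problem, for EVERY admissible `V`** — no compactness, no continuity. The
argument is the paper's own, run as an induction on the number of particles instead of at a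
minimizer:

* if a competitor violates (13), the particle-removal mechanism of Lemma 2.2 / Lemma 3.1
  (p. 6, p. 13: "those particles that are too close to each other are moved to infinity and
  thereby effectively removed from the system without increasing the energy") produces a
  competitor with FEWER particles and STRICTLY smaller energy — for any competitor, not only for
  a minimizer (`Theil2006.exists_relaxedPeriodicEnergy_lt`, the periodic twin of the tree's
  `Theil2006.exists_relaxedDirichletEnergy_lt`; same computation as the tree's Lemma 3.1);
* if a competitor satisfies (13), (44) applies to it (periodic case) or to its periodization
  (Dirichlet case, pp. 14–15: (45), (46) and the identity
  `E_L^per(X_per, {y_per}) = 2E(𝒜', {y}) − 2E_𝒜(A₂) − 6L² + tails`,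
  `Theil2006.relaxedPeriodicEnergy_periodize_le`), and the right-hand side of (44) is
  `≥ −3 #X̃ ≥ −3L²` resp. `≥ −3(L² − #(𝒜 ∖ 𝒜'))`, i.e. the competitor is no better than the
  lattice ("Since `#X̃ ≤ L²` …", p. 14; "`3(L² − #Y) ≤ 2ε`", p. 15, with `L → ∞`).

## What is here

* `Theil2006.exists_relaxedPeriodicEnergy_lt` — Lemma 3.1's mechanism for an ARBITRARY
  `L`-periodic competitor `(X, y)`: a pair at distance `≤ 1 − α` ⇒ removing the `L`-periodic set
  generated by a most crowded disc strictly lowers `E_L^per(·, {y})` and the class count `#X̃`.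
* `Theil2006.le_relaxedPeriodicEnergy_of_mainEstimate`,
  `Theil2006.isRelaxedMinimizer_univ_triPoint_of_mainEstimate`,
  `Theil2006.exists_isRelaxedMinimizer_of_mainEstimate` — under (44) (per `L`):
  `E_L^per(X, {y}) ≥ −6L² = E_L^per(A₂, {id})` for all competitors; the lattice is a relaxed
  minimizer; the hypothesis `hexPer` holds.
* `Theil2006.dirichletEnergy_triPoint_le_of_mainEstimate`,
  `Theil2006.isRelaxedDirichletMinimizer_self_triPoint_of_mainEstimate`,
  `Theil2006.exists_isRelaxedDirichletMinimizer_of_mainEstimate` — under (44) (uniform `C`):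
  `E(𝒜', {y}) ≥ E_𝒜(A₂)` for all competitors; `(𝒜, id)` is a relaxed Dirichlet minimizer; the
  hypothesis `hexDir` holds.
* `Theil2006_periodic_and_dirichletGroundStates_of_mainEstimate'` — **Theorem 1.2 (corrected,
  up to rotation) and Corollary 1.3 from (44) ALONE**, for every admissible `V`
  (`Theil2006_periodic_and_dirichletGroundStates_of_mainEstimate` with `hexPer`, `hexDir`
  discharged).

## Rendering notes

* Thresholds: `α < 1/13447168` (the tree's Lemma 2.2 / 3.1 constant) for the removal step; the
  confinement of free particles to distance `≤ 1` of `𝒜` (needed to periodize, p. 14 "we can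
  assume that `A ⊂ B(0, C)`") follows from (13) alone, as in
  `IsRelaxedDirichletMinimizer.exists_dist_triPoint_le_one`.
* The print asserts existence and argues at a minimizer; we argue at an arbitrary competitor by
  strong induction on `#X̃` resp. `#𝒜'`. The conclusions drawn downstream (structure of
  minimizers, Theorem 1.2, Corollary 1.3) are unchanged. [cite: Theil2006, §3 (preprint
  pp. 13–15)]
-/

noncomputable section

open scoped BigOperators Topology
open Filter Set Metric

namespace Literature.MathematicalPhysics.StatisticalMechanics

namespace Theil2006

/-! ### Lemma 3.1's removal mechanism for an arbitrary periodic competitor -/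

section PeriodicRemoval

variable {α : ℝ} {V : ℝ → ℝ} {L : ℕ} {X : Set (ℤ × ℤ)} {y : ℤ × ℤ → Plane}

/-- **The mechanism of Lemma 3.1 (Lemma 2.2 in the relaxed periodic class) for an ARBITRARY
competitor.** Let `0 < α < 1/13447168`, `V` satisfy (1)–(5), `L ≥ 1`, `X ⊂ A₂` be `L`-periodic
and `y ∈ Y_L^per`. If two particles of `X` are at distance `≤ 1 − α`, then with `M ≥ 2` the
maximal number of particles in a closed disc of radius `½(1 − α)`, attained at `η₀`, and
`𝒜 = X ∩ y⁻¹B(η₀, ½(1−α))`, removing the `L`-periodic set `P = 𝒜 + LA₂` from `X` STRICTLY lowers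
the relaxed periodic energy and the number of classes:
`E_L^per(X ∖ P, {y}) < E_L^per(X, {y})`, `#(X ∖ P)~ = #X̃ − M`. The computation is that of the
tree's Lemma 3.1 (`lt_dist_of_isMinimizer_relaxedPeriodicEnergy`): in the ordered form
`E(X) − E(X∖P) = ∑_{x ∈ P∩LU} (2 ∑_{x' ∈ X∖P} e + ∑_{x' ∈ P∖{x}} e)`, each of the `M` rows has
its `M − 1` companions priced `≥ 1/α` by (2) and every partial row `≥ −WM` (`W = 4 · 420224`,
(11) near, (12) far, at most `M` particles per grid cell), so the difference is
`≥ M((M−1)/α − 3WM) > 0` for `M ≥ 2`, `α < 1/(8W)`. (Stated for all `(X, y)` because the same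
inequality drives the existence of the relaxed minimizer below; the print argues at a
minimizer, "moved to infinity and thereby effectively removed from the system without
increasing the energy", p. 13. The tree's Lemma 3.1 is the special case of a minimizer; it is
left untouched rather than re-derived from this lemma, so that its importers need no rebuild —
hence the repeated computation.)
[cite: Theil2006, §3 Lemma 3.1 and its proof (preprint pp. 13–14), with §2.2 proof of Lemma 2.2 (14)–(17) (p. 6)] -/
theorem exists_relaxedPeriodicEnergy_lt (hα : 0 < α) (hαlt : α < 1 / 13447168)
    (hV : IsAdmissible α V) (hL : 0 < L) (hX : IsPeriodicSet L X) (hy : IsPeriodic L y)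
    {x₁ x₂ : ℤ × ℤ} (hx₁ : x₁ ∈ X) (hx₂ : x₂ ∈ X) (hne : x₁ ≠ x₂)
    (hcon : dist (y x₁) (y x₂) ≤ 1 - α) :
    ∃ X' : Set (ℤ × ℤ), IsPeriodicSet L X' ∧ X' ⊆ X ∧
      (cellClasses L X').card < (cellClasses L X).card ∧
        relaxedPeriodicEnergy V L X' y < relaxedPeriodicEnergy V L X y := by
  classical
  have hα5 : α ≤ 1 / 5 := by linarith
  set ρ := (1 - α) / 2 with hρdef
  have hρ25 : 2 / 5 ≤ ρ := by rw [hρdef]; linarith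
  have hρ0 : 0 < ρ := by linarith
  -- summable rows
  have hsumm : ∀ p : Plane, Summable fun k => V (dist p (y k)) :=
    fun p => hV.summable_periodic hL hy p
  -- the particles of `X` in a closed disc of radius `ρ`: finite sets
  have hfin : ∀ η : Plane, ({k : ℤ × ℤ | k ∈ X ∧ dist (y k) η ≤ ρ}).Finite := fun η =>
    (hy.finite_dist_le hL η ρ).subset fun k hk => hk.2
  have hmemD : ∀ η k, k ∈ (hfin η).toFinset ↔ k ∈ X ∧ dist (y k) η ≤ ρ := fun η k =>
    Set.Finite.mem_toFinset _
  set cnt : Plane → ℕ := fun η => (hfin η).toFinset.card with hcnt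
  -- two particles of one disc are at distance `≤ 1 - α`
  have hdisc : ∀ (η : Plane) (k k' : ℤ × ℤ), dist (y k) η ≤ ρ → dist (y k') η ≤ ρ →
      dist (y k) (y k') ≤ 1 - α := by
    intro η k k' hk hk'
    have := dist_triangle (y k) η (y k')
    rw [dist_comm η] at this
    rw [hρdef] at hk hk'
    linarith
  -- two particles of one coset of `L A₂` are never in one disc: residues are injective on discs
  have hres : ∀ (η : Plane) (k k' : ℤ × ℤ), dist (y k) η ≤ ρ → dist (y k') η ≤ ρ →
      ((cellEquiv hL).symm k).1 = ((cellEquiv hL).symm k').1 → k = k' := by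
    intro η k k' hk hk' hkk'
    have ek := cellEquiv_symm_apply_spec hL k
    have ek' := cellEquiv_symm_apply_spec hL k'
    set g := ((cellEquiv hL).symm k).2
    set g' := ((cellEquiv hL).symm k').2
    have hk'k : k' = k + (L : ℤ) • (g' - g) := by
      rw [smul_sub, ← ek', ← hkk']
      conv_rhs => rw [← ek]
      abel
    by_contra hne'
    have hgg : g' - g ≠ 0 := by
      intro h0
      rw [h0, smul_zero, add_zero] at hk'k
      exact hne' hk'k.symm
    have h1 := hy.one_le_dist_add_zsmul hL k hgg
    rw [← hk'k] at h1
    have h2 := hdisc η k k' hk hk'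
    linarith
  have hbdd : ∀ η, cnt η ≤ L ^ 2 := by
    intro η
    have h := Finset.card_le_card_of_injOn (s := (hfin η).toFinset)
      (t := (Finset.univ : Finset (Fin L × Fin L))) (fun k => ((cellEquiv hL).symm k).1)
      (fun _ _ => Finset.mem_coe.2 (Finset.mem_univ _)) fun k hk k' hk' hkk' =>
        hres η k k' ((hmemD η k).1 (Finset.mem_coe.1 hk)).2
          ((hmemD η k').1 (Finset.mem_coe.1 hk')).2 hkk'
    simpa [Finset.card_univ, Fintype.card_prod, Fintype.card_fin, sq] using h
  -- the maximal count `M`, attained at `η₀`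
  have hBdd : BddAbove (Set.range cnt) := ⟨L ^ 2, by rintro _ ⟨η, rfl⟩; exact hbdd η⟩
  set M := sSup (Set.range cnt) with hMdef
  have hle : ∀ η, cnt η ≤ M := fun η => le_csSup hBdd ⟨η, rfl⟩
  obtain ⟨η₀, hη₀⟩ : ∃ η₀, cnt η₀ = M := Nat.sSup_mem (s := Set.range cnt) ⟨cnt 0, 0, rfl⟩ hBdd
  -- the close pair forces `M ≥ 2`
  have hM2 : 2 ≤ M := by
    set m : Plane := (2 : ℝ)⁻¹ • (y x₁ + y x₂) with hm
    have hd1 : dist (y x₁) m ≤ ρ := by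
      have e : y x₁ - m = (2 : ℝ)⁻¹ • (y x₁ - y x₂) := by rw [hm]; module
      rw [dist_eq_norm, e, norm_smul, Real.norm_eq_abs, abs_of_pos (by norm_num), ← dist_eq_norm]
      rw [hρdef]; linarith
    have hd2 : dist (y x₂) m ≤ ρ := by
      have e : y x₂ - m = (2 : ℝ)⁻¹ • (y x₂ - y x₁) := by rw [hm]; module
      rw [dist_eq_norm, e, norm_smul, Real.norm_eq_abs, abs_of_pos (by norm_num), ← dist_eq_norm,
        dist_comm]
      rw [hρdef]; linarith
    have hsub : ({x₁, x₂} : Finset (ℤ × ℤ)) ⊆ (hfin m).toFinset := by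
      intro k hk
      rw [Finset.mem_insert, Finset.mem_singleton] at hk
      rw [hmemD]
      rcases hk with rfl | rfl
      · exact ⟨hx₁, hd1⟩
      · exact ⟨hx₂, hd2⟩
    have := Finset.card_le_card hsub
    rw [Finset.card_pair hne] at this
    exact this.trans (hle m)
  have hMpos : 0 < M := by omega
  -- the cluster `𝒜` and the removed periodic set `P = 𝒜 + L A₂`
  set A : Finset (ℤ × ℤ) := (hfin η₀).toFinset with hA
  have hAmem : ∀ k, k ∈ A ↔ k ∈ X ∧ dist (y k) η₀ ≤ ρ := hmemD η₀
  have hAcard : A.card = M := hη₀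
  set P : Set (ℤ × ℤ) := {k | ∃ a ∈ A, ∃ g : ℤ × ℤ, k = a + (L : ℤ) • g} with hP
  have hPper : IsPeriodicSet L P := by
    rintro k ⟨a, ha, g, rfl⟩ g'
    exact ⟨a, ha, g + g', by rw [smul_add, add_assoc]⟩
  have hPX : P ⊆ X := by
    rintro k ⟨a, ha, g, rfl⟩
    exact hX a ((hAmem a).1 ha).1 g
  set X' : Set (ℤ × ℤ) := X \ P with hX'
  have hX'per : IsPeriodicSet L X' := hX.diff hPper
  have hX'X : X' ⊆ X := fun k hk => hk.1
  -- cell representatives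
  set sX : Finset (Fin L × Fin L) := Finset.univ.filter fun c => cellPoint c ∈ X with hsX
  set sX' : Finset (Fin L × Fin L) := Finset.univ.filter fun c => cellPoint c ∈ X' with hsX'
  set sP : Finset (Fin L × Fin L) := Finset.univ.filter fun c => cellPoint c ∈ P with hsP
  have hmsX : ∀ c, c ∈ sX ↔ cellPoint c ∈ X := fun c => by simp [hsX]
  have hmsX' : ∀ c, c ∈ sX' ↔ cellPoint c ∈ X' := fun c => by simp [hsX']
  have hmsP : ∀ c, c ∈ sP ↔ cellPoint c ∈ P := fun c => by simp [hsP]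
  -- `P ∩ LU` = the residues of `𝒜`, `M` of them
  have hsP_eq : sP = A.image fun a => ((cellEquiv hL).symm a).1 := by
    ext c
    rw [hmsP, Finset.mem_image]
    constructor
    · rintro ⟨a, ha, g, hag⟩
      refine ⟨a, ha, ?_⟩
      have : a = cellPoint c + (L : ℤ) • (-g) := by rw [smul_neg, hag]; abel
      rw [this, cellEquiv_symm_cellPoint_add]
    · rintro ⟨a, ha, hac⟩
      set q := ((cellEquiv hL).symm a).2 with hq
      refine ⟨a, ha, -q, ?_⟩
      have ea : cellPoint c + (L : ℤ) • q = a := by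
        have := cellEquiv_symm_apply_spec hL a
        rwa [hac] at this
      rw [← ea, smul_neg, add_neg_cancel_right]
  have hsPcard : sP.card = M := by
    rw [hsP_eq, Finset.card_image_of_injOn, hAcard]
    intro a ha a' ha' h
    exact hres η₀ a a' ((hAmem a).1 (Finset.mem_coe.1 ha)).2
      ((hAmem a').1 (Finset.mem_coe.1 ha')).2 h
  -- rows
  set R : Set (ℤ × ℤ) → ℤ × ℤ → ℝ := fun T k =>
    ∑' k' : ({k' : ℤ × ℤ | k' ∈ T ∧ k' ≠ k} : Set (ℤ × ℤ)), V (dist (y k) (y k')) with hR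
  set Q : Set (ℤ × ℤ) → ℤ × ℤ → ℝ := fun T k => ∑' k' : T, V (dist (y k) (y k')) with hQ
  -- the two energies
  have hEX : relaxedPeriodicEnergy V L X y = ∑ c ∈ sX, R X (cellPoint c) := by
    rw [relaxedPeriodicEnergy, Finset.sum_indicator_eq_sum_filter]
    exact Finset.sum_congr (by ext c; simp [hmsX]) fun c _ => rfl
  have hEX' : relaxedPeriodicEnergy V L X' y = ∑ c ∈ sX', R X' (cellPoint c) := by
    rw [relaxedPeriodicEnergy, Finset.sum_indicator_eq_sum_filter]
    exact Finset.sum_congr (by ext c; simp [hmsX']) fun c _ => rfl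
  -- `X ∩ LU = (X' ∩ LU) ⊔ (P ∩ LU)`
  have hsplit : ∀ F : Fin L × Fin L → ℝ, ∑ c ∈ sX, F c = ∑ c ∈ sX', F c + ∑ c ∈ sP, F c := by
    intro F
    rw [← Finset.sum_filter_add_sum_filter_not sX fun c => cellPoint c ∈ P, add_comm]
    congr 1
    · refine Finset.sum_congr ?_ fun _ _ => rfl
      ext c
      simp only [Finset.mem_filter, hmsX, hmsX', hX', Set.mem_sdiff]
    · refine Finset.sum_congr ?_ fun _ _ => rfl
      ext c
      simp only [Finset.mem_filter, hmsX, hmsP]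
      exact ⟨fun h => h.2, fun h => ⟨hPX h, h⟩⟩
  -- splitting the rows of `E(X)`
  have h1 : ∀ c ∈ sX', R X (cellPoint c) = R X' (cellPoint c) + Q P (cellPoint c) := by
    intro c hc
    have hcX' := (hmsX' c).1 hc
    have e1 : ({k' : ℤ × ℤ | k' ∈ X ∧ k' ≠ cellPoint c} : Set (ℤ × ℤ)) =
        {k' | k' ∈ X' ∧ k' ≠ cellPoint c} ∪ P := by
      ext k'
      simp only [Set.mem_setOf_eq, Set.mem_union, hX', Set.mem_sdiff]
      constructor
      · rintro ⟨hk'X, hk'ne⟩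
        by_cases hk'P : k' ∈ P
        · exact Or.inr hk'P
        · exact Or.inl ⟨⟨hk'X, hk'P⟩, hk'ne⟩
      · rintro (⟨⟨hk'X, -⟩, hk'ne⟩ | hk'P)
        · exact ⟨hk'X, hk'ne⟩
        · exact ⟨hPX hk'P, fun h => hcX'.2 (h ▸ hk'P)⟩
    have hdisj : Disjoint ({k' : ℤ × ℤ | k' ∈ X' ∧ k' ≠ cellPoint c}) P :=
      Set.disjoint_left.2 fun k' hk' hk'P => hk'.1.2 hk'P
    have step : (∑' k' : ({k' : ℤ × ℤ | k' ∈ X ∧ k' ≠ cellPoint c} : Set (ℤ × ℤ)),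
        V (dist (y (cellPoint c)) (y k'))) =
        (∑' k' : ({k' : ℤ × ℤ | k' ∈ X' ∧ k' ≠ cellPoint c} : Set (ℤ × ℤ)),
          V (dist (y (cellPoint c)) (y k'))) + ∑' k' : P, V (dist (y (cellPoint c)) (y k')) := by
      rw [tsum_congr_set_coe (fun k' => V (dist (y (cellPoint c)) (y k'))) e1]
      exact Summable.tsum_union_disjoint hdisj ((hsumm _).subtype _) ((hsumm _).subtype _)
    exact step
  have h2 : ∀ c ∈ sP, R X (cellPoint c) = Q X' (cellPoint c) + R P (cellPoint c) := by
    intro c hc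
    have hcP := (hmsP c).1 hc
    have e1 : ({k' : ℤ × ℤ | k' ∈ X ∧ k' ≠ cellPoint c} : Set (ℤ × ℤ)) =
        X' ∪ {k' | k' ∈ P ∧ k' ≠ cellPoint c} := by
      ext k'
      simp only [Set.mem_setOf_eq, Set.mem_union, hX', Set.mem_sdiff]
      constructor
      · rintro ⟨hk'X, hk'ne⟩
        by_cases hk'P : k' ∈ P
        · exact Or.inr ⟨hk'P, hk'ne⟩
        · exact Or.inl ⟨hk'X, hk'P⟩
      · rintro (⟨hk'X, hk'P⟩ | ⟨hk'P, hk'ne⟩)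
        · exact ⟨hk'X, fun h => hk'P (h ▸ hcP)⟩
        · exact ⟨hPX hk'P, hk'ne⟩
    have hdisj : Disjoint X' ({k' : ℤ × ℤ | k' ∈ P ∧ k' ≠ cellPoint c}) :=
      Set.disjoint_left.2 fun k' hk' hk'P => hk'.2 hk'P.1
    have step : (∑' k' : ({k' : ℤ × ℤ | k' ∈ X ∧ k' ≠ cellPoint c} : Set (ℤ × ℤ)),
        V (dist (y (cellPoint c)) (y k'))) =
        (∑' k' : X', V (dist (y (cellPoint c)) (y k'))) +
          ∑' k' : ({k' : ℤ × ℤ | k' ∈ P ∧ k' ≠ cellPoint c} : Set (ℤ × ℤ)),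
            V (dist (y (cellPoint c)) (y k')) := by
      rw [tsum_congr_set_coe (fun k' => V (dist (y (cellPoint c)) (y k'))) e1]
      exact Summable.tsum_union_disjoint hdisj ((hsumm _).subtype _) ((hsumm _).subtype _)
    exact step
  -- the symmetry of the mixed term
  have hsym : ∑ c ∈ sX', Q P (cellPoint c) = ∑ c ∈ sP, Q X' (cellPoint c) :=
    hy.sum_tsum_comm hL hX'per hPper sX' sP hmsX' hmsP (W := V) hsumm
  -- the energy difference
  have hdiff : relaxedPeriodicEnergy V L X y - relaxedPeriodicEnergy V L X' y =
      ∑ c ∈ sP, (2 * Q X' (cellPoint c) + R P (cellPoint c)) := by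
    rw [hEX, hEX', hsplit, Finset.sum_congr rfl h1, Finset.sum_congr rfl h2,
      Finset.sum_add_distrib, hsym, Finset.sum_add_distrib, Finset.sum_add_distrib,
      ← Finset.mul_sum]
    ring
  -- the cell weights and the uniform row bound `≥ -W M`
  set wt : ℤ → ℝ := fun n => ((((n.natAbs : ℕ) : ℝ) + 1) * (((n.natAbs : ℕ) : ℝ) + 2))⁻¹ with hwt
  have hrow : ∀ (x : ℤ × ℤ) (η : Plane), dist (y x) η ≤ ρ → ∀ T : Set (ℤ × ℤ), T ⊆ X →
      -(4 * 420224 * (M : ℝ)) ≤ ∑' k' : T, V (dist (y x) (y k')) := by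
    intro x η hxη T hTX
    have hs : Summable fun k' : T => V (dist (y x) (y k')) := (hsumm (y x)).subtype _
    have hneg : ∑' k' : T, -V (dist (y x) (y k')) ≤ 4 * 420224 * (M : ℝ) := by
      refine hs.neg.tsum_le_of_sum_le fun u => ?_
      have hterm : ∀ k' ∈ u, -V (dist (y x) (y (k' : ℤ × ℤ))) ≤
          420224 * (wt ⌊(y k' 0 - η 0) / ρ⌋ * wt ⌊(y k' 1 - η 1) / ρ⌋) := by
        intro k' _
        have := hV.neg_cellWeight_le hα hα5 hρ25 η (y x) (y k') hxη
        simp only [hwt]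
        linarith
      refine (Finset.sum_le_sum hterm).trans ?_
      rw [← Finset.mul_sum]
      have hMu : ∀ z : Plane, (u.filter fun k' : T => dist (y k') z ≤ ρ).card ≤ M := by
        intro z
        refine le_trans ?_ (hle z)
        refine Finset.card_le_card_of_injOn (fun k' : T => (k' : ℤ × ℤ)) ?_
          (Subtype.val_injective.injOn)
        intro k' hk'
        rw [Finset.mem_coe, Finset.mem_filter] at hk'
        rw [Finset.mem_coe, hmemD]
        exact ⟨hTX k'.2, hk'.2⟩
      have h := sum_cellWeight_le_finset u (fun k' : T => y k') η hρ0 (M := M) hMu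
        (f := fun c : ℤ × ℤ => wt c.1 * wt c.2) (fun c => by positivity) (F := 4)
        (fun t => by simpa [hwt] using sum_prod_inv_natAbs_le_four t)
      nlinarith
    rw [tsum_neg] at hneg
    linarith
  -- the two lower bounds on the rows of `P ∩ LU`
  have hQlb : ∀ c ∈ sP, -(4 * 420224 * (M : ℝ)) ≤ Q X' (cellPoint c) := by
    intro c hc
    obtain ⟨a, ha, g₀, hag⟩ := (hmsP c).1 hc
    have hya : y (cellPoint c) = y a + (L : ℝ) • triPoint g₀ := by rw [hag, hy.apply_add_zsmul]
    have hd : dist (y (cellPoint c)) (η₀ + (L : ℝ) • triPoint g₀) ≤ ρ := by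
      rw [hya, dist_add_right]
      exact ((hAmem a).1 ha).2
    exact hrow (cellPoint c) _ hd X' hX'X
  have hRlb : ∀ c ∈ sP, ((M : ℝ) - 1) * (1 / α) - 4 * 420224 * (M : ℝ) ≤ R P (cellPoint c) := by
    intro c hc
    obtain ⟨a, ha, g₀, hag⟩ := (hmsP c).1 hc
    set η : Plane := η₀ + (L : ℝ) • triPoint g₀ with hη
    -- the translated cluster `𝒜 + L g₀`
    set Ag : Finset (ℤ × ℤ) := A.image fun a' => a' + (L : ℤ) • g₀ with hAg
    have hAgcard : Ag.card = M := by
      rw [hAg, Finset.card_image_of_injective _ (add_left_injective _), hAcard]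
    have hAgP : ∀ k' ∈ Ag, k' ∈ P := by
      intro k' hk'
      obtain ⟨a', ha', rfl⟩ := Finset.mem_image.1 hk'
      exact ⟨a', ha', g₀, rfl⟩
    have hAgd : ∀ k' ∈ Ag, dist (y k') η ≤ ρ := by
      intro k' hk'
      obtain ⟨a', ha', rfl⟩ := Finset.mem_image.1 hk'
      rw [hy.apply_add_zsmul, hη, dist_add_right]
      exact ((hAmem a').1 ha').2
    have hcAg : cellPoint c ∈ Ag := Finset.mem_image.2 ⟨a, ha, hag.symm⟩
    have hcd : dist (y (cellPoint c)) η ≤ ρ := hAgd _ hcAg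
    -- split the row over `P ∖ {x}` into the companions and the rest
    have e1 : ({k' : ℤ × ℤ | k' ∈ P ∧ k' ≠ cellPoint c} : Set (ℤ × ℤ)) =
        ↑(Ag.erase (cellPoint c)) ∪ {k' | k' ∈ P ∧ k' ∉ Ag} := by
      ext k'
      simp only [Set.mem_setOf_eq, Set.mem_union, Finset.coe_erase, Set.mem_sdiff,
        Finset.mem_coe, Set.mem_singleton_iff]
      constructor
      · rintro ⟨hk'P, hk'ne⟩
        by_cases hk'A : k' ∈ Ag
        · exact Or.inl ⟨hk'A, hk'ne⟩
        · exact Or.inr ⟨hk'P, hk'A⟩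
      · rintro (⟨hk'A, hk'ne⟩ | ⟨hk'P, hk'A⟩)
        · exact ⟨hAgP k' hk'A, hk'ne⟩
        · exact ⟨hk'P, fun h => hk'A (h ▸ hcAg)⟩
    have hdisj : Disjoint (↑(Ag.erase (cellPoint c)) : Set (ℤ × ℤ)) {k' | k' ∈ P ∧ k' ∉ Ag} :=
      Set.disjoint_left.2 fun k' hk' hk'' =>
        hk''.2 (Finset.mem_erase.1 (Finset.mem_coe.1 hk')).2
    have hsplitR : R P (cellPoint c) =
        ∑ k' ∈ Ag.erase (cellPoint c), V (dist (y (cellPoint c)) (y k')) +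
          ∑' k' : ({k' : ℤ × ℤ | k' ∈ P ∧ k' ∉ Ag} : Set (ℤ × ℤ)),
            V (dist (y (cellPoint c)) (y k')) := by
      have step : (∑' k' : ({k' : ℤ × ℤ | k' ∈ P ∧ k' ≠ cellPoint c} : Set (ℤ × ℤ)),
          V (dist (y (cellPoint c)) (y k'))) =
          (∑' k' : (↑(Ag.erase (cellPoint c)) : Set (ℤ × ℤ)), V (dist (y (cellPoint c)) (y k'))) +
            ∑' k' : ({k' : ℤ × ℤ | k' ∈ P ∧ k' ∉ Ag} : Set (ℤ × ℤ)),
              V (dist (y (cellPoint c)) (y k')) := by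
        rw [tsum_congr_set_coe (fun k' => V (dist (y (cellPoint c)) (y k'))) e1]
        exact Summable.tsum_union_disjoint hdisj ((hsumm _).subtype _) ((hsumm _).subtype _)
      rw [Finset.tsum_subtype' (Ag.erase (cellPoint c))
        (fun k' => V (dist (y (cellPoint c)) (y k')))] at step
      exact step
    -- the companions: `M - 1` bonds of length `≤ 1 - α`, each `≥ 1/α` by (2)
    have hcomp : ((M : ℝ) - 1) * (1 / α) ≤
        ∑ k' ∈ Ag.erase (cellPoint c), V (dist (y (cellPoint c)) (y k')) := by
      have hcard : ((Ag.erase (cellPoint c)).card : ℝ) = M - 1 := by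
        rw [Finset.card_erase_of_mem hcAg, hAgcard, Nat.cast_sub (by omega), Nat.cast_one]
      have h := Finset.card_nsmul_le_sum (Ag.erase (cellPoint c))
        (fun k' => V (dist (y (cellPoint c)) (y k'))) (1 / α) fun k' hk' => by
          have hk'A := (Finset.mem_erase.1 hk').2
          exact hV.core _ ⟨dist_nonneg, hdisc η _ _ hcd (hAgd k' hk'A)⟩
      rw [nsmul_eq_mul, hcard] at h
      exact h
    have hrest := hrow (cellPoint c) η hcd {k' | k' ∈ P ∧ k' ∉ Ag} fun k' hk' => hPX hk'.1
    rw [hsplitR]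
    linarith
  -- the final count
  have hsum_lb : ∑ c ∈ sP, (2 * (-(4 * 420224 * (M : ℝ))) +
      (((M : ℝ) - 1) * (1 / α) - 4 * 420224 * (M : ℝ))) ≤
      ∑ c ∈ sP, (2 * Q X' (cellPoint c) + R P (cellPoint c)) :=
    Finset.sum_le_sum fun c hc => by linarith [hQlb c hc, hRlb c hc]
  rw [Finset.sum_const, hsPcard, nsmul_eq_mul] at hsum_lb
  have hM2r : (2 : ℝ) ≤ M := by exact_mod_cast hM2
  -- the released energy is positive: `M((M-1)/α - 3WM) > 0` for `M ≥ 2`, `α < 1/(8W)`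
  have hpos : 0 < ∑ c ∈ sP, (2 * Q X' (cellPoint c) + R P (cellPoint c)) := by
    refine lt_of_lt_of_le ?_ hsum_lb
    have hinv : (13447168 : ℝ) ≤ 1 / α := by
      rw [le_div_iff₀ hα]
      nlinarith
    have h1 : ((M : ℝ) - 1) * 13447168 ≤ ((M : ℝ) - 1) * (1 / α) :=
      mul_le_mul_of_nonneg_left hinv (by linarith)
    have h2 : 0 < ((M : ℝ) - 1) * (1 / α) - 3 * (4 * 420224 * (M : ℝ)) := by nlinarith
    have h3 : 0 < (M : ℝ) * (((M : ℝ) - 1) * (1 / α) - 3 * (4 * 420224 * (M : ℝ))) :=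
      mul_pos (by linarith) h2
    have e : (M : ℝ) * (2 * -(4 * 420224 * (M : ℝ)) +
        (((M : ℝ) - 1) * (1 / α) - 4 * 420224 * (M : ℝ))) =
        (M : ℝ) * (((M : ℝ) - 1) * (1 / α) - 3 * (4 * 420224 * (M : ℝ))) := by ring
    linarith
  refine ⟨X', hX'per, hX'X, ?_, ?_⟩
  · -- the classes of `P` are lost
    have hsub : cellClasses L X' ⊆ cellClasses L X := fun c hc =>
      mem_cellClasses.2 (hX'X (mem_cellClasses.1 hc))
    obtain ⟨c, hc⟩ : sP.Nonempty := by
      rw [← Finset.card_pos, hsPcard]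
      omega
    refine Finset.card_lt_card ((Finset.ssubset_iff_of_subset hsub).2 ⟨c, ?_, ?_⟩)
    · exact mem_cellClasses.2 (hPX ((hmsP c).1 hc))
    · intro hc'
      exact (mem_cellClasses.1 hc').2 ((hmsP c).1 hc)
  · linarith

end PeriodicRemoval

/-! ### The lattice is a relaxed periodic minimizer, by (44) -/

section PeriodicExistence

variable {α : ℝ} {V : ℝ → ℝ} {L : ℕ} {X : Set (ℤ × ℤ)} {y : ℤ × ℤ → Plane}

/-- **Every periodic competitor is no better than the lattice, by (44).** For
`0 < α < 1/13447168`, `V` satisfying (1)–(5), `L ≥ 1` and (44) (for this `L`, some `C > 0`, all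
`L`-periodic `(X, y)` with (13)): `E_L^per(X, {y}) ≥ −6L²` (`= E_L^per(A₂, {id})`, ordered
normalisation) for EVERY `L`-periodic `(X, y)`. By strong induction on `#X̃`: under (13), (44)
gives `E/2 ≥ (1/C)·(≥ 0) + ¼ #∂X̃ − 3#X̃ ≥ −3L²` ("Since `#X̃ ≤ L²`", p. 14); otherwise
`exists_relaxedPeriodicEnergy_lt` passes to fewer classes and smaller energy.
[cite: Theil2006, §3 Proof of Theorem 1.2 ((44) and «Since #X̃ ≤ L²», preprint p. 14), with Lemma 3.1 (p. 13)] -/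
theorem le_relaxedPeriodicEnergy_of_mainEstimate (hα : 0 < α) (hαlt : α < 1 / 13447168)
    (hV : IsAdmissible α V) (hL : 0 < L) {C : ℝ} (hC : 0 < C)
    (h44 : ∀ (X : Set (ℤ × ℤ)) (y : ℤ × ℤ → Plane), IsPeriodicSet L X → IsPeriodic L y →
      (∀ x ∈ X, ∀ x' ∈ X, x ≠ x' → 1 - α < dist (y x) (y x')) →
        mainEstimateRHS C α V L X y ≤ relaxedPeriodicEnergy V L X y / 2)
    (hX : IsPeriodicSet L X) (hy : IsPeriodic L y) :
    -6 * (L : ℝ) ^ 2 ≤ relaxedPeriodicEnergy V L X y := by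
  have hα1 : α < 1 := by linarith
  -- one step: (13) ⇒ (44) ⇒ the bound; ¬(13) ⇒ remove a crowded periodic set
  have key : ∀ X : Set (ℤ × ℤ), IsPeriodicSet L X →
      (∀ X' : Set (ℤ × ℤ), IsPeriodicSet L X' →
        (cellClasses L X').card < (cellClasses L X).card →
          -6 * (L : ℝ) ^ 2 ≤ relaxedPeriodicEnergy V L X' y) →
      -6 * (L : ℝ) ^ 2 ≤ relaxedPeriodicEnergy V L X y := by
    intro X hX ih
    by_cases h13 : ∀ x ∈ X, ∀ x' ∈ X, x ≠ x' → 1 - α < dist (y x) (y x')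
    · have h := h44 X y hX hy h13
      have hS := hV.toIsNormalized.shortBondSum_nonneg (L := L) (X := X) (y := y) hα1
      have hD : (0 : ℝ) ≤ (defectClasses α L X y).card := Nat.cast_nonneg _
      have hN := card_cellClasses_le (L := L) (X := X)
      unfold mainEstimateRHS at h
      have hCS : 0 ≤ 1 / C * (shortBondSum α L X y (fun r => renormalizedPotential V r + 1) / 2) := by
        positivity
      linarith
    · push Not at h13
      obtain ⟨x₁, hx₁, x₂, hx₂, hne, hle⟩ := h13
      obtain ⟨X', hX', -, hcard, hlt⟩ :=
        exists_relaxedPeriodicEnergy_lt hα hαlt hV hL hX hy hx₁ hx₂ hne hle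
      linarith [ih X' hX' hcard]
  -- strong induction on the number of classes `#X̃`
  suffices H : ∀ n : ℕ, ∀ X : Set (ℤ × ℤ), IsPeriodicSet L X → (cellClasses L X).card = n →
      -6 * (L : ℝ) ^ 2 ≤ relaxedPeriodicEnergy V L X y from H _ X hX rfl
  intro n
  induction n using Nat.strong_induction_on with
  | _ n ih =>
    intro X hX hn
    exact key X hX fun X' hX' hlt => ih _ (hn ▸ hlt) X' hX' rfl

/-- **The undeformed lattice `(A₂, x ↦ x)` is a minimizer of the relaxed periodic problem**, for
every admissible `V` (continuous or not), given (44) for this `L`: its energy is `−6L²`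
(`IsNormalized.relaxedPeriodicEnergy_univ_triPoint`) and no competitor does better
(`le_relaxedPeriodicEnergy_of_mainEstimate`).
[cite: Theil2006, §3 («a minimizer (X_min, y_min) of E_L^per exists», preprint p. 13; proof of Theorem 1.2, p. 14)] -/
theorem isRelaxedMinimizer_univ_triPoint_of_mainEstimate (hα : 0 < α) (hαlt : α < 1 / 13447168)
    (hV : IsAdmissible α V) (hL : 0 < L) {C : ℝ} (hC : 0 < C)
    (h44 : ∀ (X : Set (ℤ × ℤ)) (y : ℤ × ℤ → Plane), IsPeriodicSet L X → IsPeriodic L y →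
      (∀ x ∈ X, ∀ x' ∈ X, x ≠ x' → 1 - α < dist (y x) (y x')) →
        mainEstimateRHS C α V L X y ≤ relaxedPeriodicEnergy V L X y / 2) :
    IsRelaxedMinimizer V L univ triPoint := by
  refine ⟨isPeriodicSet_univ L, isPeriodic_triPoint L, fun X' y' hX' hy' => ?_⟩
  rw [hV.toIsNormalized.relaxedPeriodicEnergy_univ_triPoint]
  exact le_relaxedPeriodicEnergy_of_mainEstimate hα hαlt hV hL hC h44 hX' hy'

/-- **Existence of a minimizer of the relaxed periodic problem for EVERY admissible `V`, from
(44)** — the hypothesis `hexPer` of `Theil2006_periodicGroundStates_upToRotation_of_mainEstimate`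
and `Theil2006_periodic_and_dirichletGroundStates_of_mainEstimate`, in exactly their shape,
DISCHARGED modulo (44) (per-`L` form): "since there are only `2^{L²}` possible `L`-periodic sets
`X`, a minimizer `(X_min, y_min)` of `E_L^per` exists" (p. 13) — here the lattice itself.
[cite: Theil2006, §3 (preprint p. 13)] -/
theorem exists_isRelaxedMinimizer_of_mainEstimate
    (h44 : ∃ α₁ : ℝ, 0 < α₁ ∧ ∀ α : ℝ, 0 < α → α < α₁ → ∀ L : ℕ, 0 < L → ∀ V : ℝ → ℝ,
      IsAdmissible α V → ∃ C : ℝ, 0 < C ∧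
        ∀ (X : Set (ℤ × ℤ)) (y : ℤ × ℤ → Plane), IsPeriodicSet L X → IsPeriodic L y →
          (∀ x ∈ X, ∀ x' ∈ X, x ≠ x' → 1 - α < dist (y x) (y x')) →
            mainEstimateRHS C α V L X y ≤ relaxedPeriodicEnergy V L X y / 2) :
    ∃ α₂ : ℝ, 0 < α₂ ∧ ∀ α : ℝ, 0 < α → α < α₂ → ∀ L : ℕ, 0 < L → ∀ V : ℝ → ℝ,
      IsAdmissible α V →
        ∃ (X₀ : Set (ℤ × ℤ)) (y₀ : ℤ × ℤ → Plane), IsRelaxedMinimizer V L X₀ y₀ := by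
  obtain ⟨α₁, hα₁, h44⟩ := h44
  refine ⟨min α₁ (1 / 13447168), lt_min hα₁ (by norm_num), fun α hα hαlt L hL V hV => ?_⟩
  obtain ⟨C, hC, h⟩ := h44 α hα (hαlt.trans_le (min_le_left _ _)) L hL V hV
  exact ⟨univ, triPoint, isRelaxedMinimizer_univ_triPoint_of_mainEstimate hα
    (hαlt.trans_le (min_le_right _ _)) hV hL hC h⟩

end PeriodicExistence

/-! ### The clamped lattice is a relaxed Dirichlet minimizer, by (44) and periodization -/

section DirichletExistence

variable {α : ℝ} {V : ℝ → ℝ} {A A' : Finset (ℤ × ℤ)} {y : ℤ × ℤ → Plane}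

/-- Every point of the plane is within `9/10` of a point of `A₂` (round the `b₂`-coordinate, then
the `b₁`-coordinate; a private copy of the helper of `Theil2006DirichletMinimumDistance.lean`).
[folklore] -/
private theorem exists_dist_triPoint_le_nine_tenths (p : Plane) :
    ∃ a : ℤ × ℤ, dist p (triPoint a) ≤ 9 / 10 := by
  have h3 : (0 : ℝ) < √3 := Real.sqrt_pos.2 (by norm_num)
  have hs3 : (√3 : ℝ) ^ 2 = 3 := Real.sq_sqrt (by norm_num)
  set t : ℝ := 2 * p 1 / √3 with ht
  set n : ℤ := round t with hn
  set m : ℤ := round (p 0 - (n : ℝ) / 2) with hm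
  refine ⟨(m, n), ?_⟩
  have hδ₂ := abs_le.1 (abs_sub_round t)
  have hδ₁ := abs_le.1 (abs_sub_round (p 0 - (n : ℝ) / 2))
  rw [← hn] at hδ₂
  rw [← hm] at hδ₁
  have e1 : p 1 = √3 / 2 * t := by
    rw [ht]; field_simp
  have hsq : dist p (triPoint (m, n)) ^ 2 =
      (p 0 - (n : ℝ) / 2 - m) ^ 2 + 3 / 4 * (t - n) ^ 2 := by
    rw [EuclideanSpace.dist_eq, Real.sq_sqrt (Finset.sum_nonneg fun i _ => sq_nonneg _),
      Fin.sum_univ_two, Real.dist_eq, Real.dist_eq, sq_abs, sq_abs, triPoint_apply_zero,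
      triPoint_apply_one, e1]
    dsimp only
    linear_combination ((t - (n : ℝ)) ^ 2 / 4) * hs3
  have hsq' : dist p (triPoint (m, n)) ^ 2 ≤ 7 / 16 := by
    rw [hsq]
    nlinarith [hδ₁.1, hδ₁.2, hδ₂.1, hδ₂.2]
  nlinarith [dist_nonneg (x := p) (y := triPoint (m, n)), hsq']

/-- **Confinement from (13) alone**: if the particles of `X = (A₂ ∖ 𝒜) ∪ 𝒜'` of a clamped
`y ∈ Y_𝒜^Dir` satisfy (13) (`α ≤ 1/10`), every free particle is within distance `1` of a label of
`𝒜` — otherwise it would be within `9/10 ≤ 1 − α` of a clamped lattice site ("Due to the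
compactness of `𝒜` we can assume that `A ⊂ B(0, C)`", p. 14; cf.
`IsRelaxedDirichletMinimizer.exists_dist_triPoint_le_one`, the same for minimizers).
[cite: Theil2006, §3 Proof of Corollary 1.3 (preprint p. 14); our lemma] -/
theorem exists_dist_triPoint_le_one_of_lt_dist (hα10 : α ≤ 1 / 10)
    (hy : IsClampedOutside A y) (hA' : A' ⊆ A)
    (h13 : ∀ x, (x ∉ A ∨ x ∈ A') → ∀ x', (x' ∉ A ∨ x' ∈ A') → x ≠ x' →
      1 - α < dist (y x) (y x'))
    {x : ℤ × ℤ} (hx : x ∈ A') : ∃ a ∈ A, dist (y x) (triPoint a) ≤ 1 := by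
  by_contra hfar
  push Not at hfar
  obtain ⟨a₀, ha₀⟩ := exists_dist_triPoint_le_nine_tenths (y x)
  have ha₀A : a₀ ∉ A := fun h => by linarith [hfar a₀ h]
  have hne : x ≠ a₀ := fun h => ha₀A (h ▸ hA' hx)
  have h := h13 x (Or.inr hx) a₀ (Or.inl ha₀A) hne
  rw [hy a₀ ha₀A] at h
  linarith

/-- **Every competitor of the relaxed Dirichlet problem is no better than the clamped lattice,
by (44).** For `0 < α < 1/13447168`, `V` satisfying (1)–(5) and (44) with a constant `C`
independent of `L`: `E(𝒜', {y}) ≥ E_𝒜(A₂)` for every `𝒜' ⊆ 𝒜` and `y ∈ Y_𝒜^Dir`. By strong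
induction on `#𝒜'`: if (13) fails, `exists_relaxedDirichletEnergy_lt` removes free particles with
profit; if (13) holds, the free particles are confined (`exists_dist_triPoint_le_one_of_lt_dist`),
the periodized pair `(X_per, y_per)` satisfies (13) (`lt_dist_periodize`) and hence (44), whose
right-hand side is `≥ −3(L² − #(𝒜 ∖ 𝒜'))` (`card_cellClasses_periodizeSet_dirichletSupport`),
while `E_L^per(X_per,{y_per}) + 6L² ≤ 2(E(𝒜',{y}) − E_𝒜(A₂)) + O(L⁻⁵)`
(`relaxedPeriodicEnergy_periodize_le`, (45)/(46)); `L → ∞` gives `E(𝒜',{y}) ≥ E_𝒜(A₂)`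
(indeed `+ 3#(𝒜 ∖ 𝒜')`). [cite: Theil2006, §3 Proof of Corollary 1.3 (the chain of displays and «3(L² − #Y)», preprint pp. 14–15)] -/
theorem dirichletEnergy_triPoint_le_of_mainEstimate (hα : 0 < α) (hαlt : α < 1 / 13447168)
    (hV : IsAdmissible α V) {C : ℝ} (hC : 0 < C)
    (h44 : ∀ L : ℕ, 0 < L → ∀ (X : Set (ℤ × ℤ)) (y : ℤ × ℤ → Plane), IsPeriodicSet L X →
      IsPeriodic L y → (∀ x ∈ X, ∀ x' ∈ X, x ≠ x' → 1 - α < dist (y x) (y x')) →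
        mainEstimateRHS C α V L X y ≤ relaxedPeriodicEnergy V L X y / 2)
    (hA' : A' ⊆ A) (hy : IsClampedOutside A y) :
    dirichletEnergy V A triPoint ≤ relaxedDirichletEnergy V A A' y := by
  classical
  have hα1 : α < 1 := by linarith
  have hα10 : α ≤ 1 / 10 := by linarith
  -- the lattice constant `S = ∑ |ξ|⁻⁵` of the tails
  set S : ℝ := ∑' g : ℤ × ℤ, ‖triPoint g‖⁻¹ ^ 5 with hSdef
  have hS0 : 0 ≤ S := tsum_nonneg fun g => by positivity
  -- a label bound for `𝒜`: `𝒜 ⊆ Y_L` for `L ≥ 2N + 2`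
  set N : ℕ := A.sup fun a => max a.1.natAbs a.2.natAbs with hNdef
  have hlab : ∀ a ∈ A, |a.1| ≤ (N : ℤ) ∧ |a.2| ≤ (N : ℤ) := by
    intro a ha
    have h := Finset.le_sup (f := fun a : ℤ × ℤ => max a.1.natAbs a.2.natAbs) ha
    rw [← hNdef] at h
    have h1 : a.1.natAbs ≤ N := (le_max_left _ _).trans h
    have h2 : a.2.natAbs ≤ N := (le_max_right _ _).trans h
    rw [Int.abs_eq_natAbs, Int.abs_eq_natAbs]
    exact ⟨by exact_mod_cast h1, by exact_mod_cast h2⟩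
  have hcellA : ∀ L : ℕ, 2 * N + 2 ≤ L → A ⊆ centredCell L := fun L hL a ha =>
    mem_centredCell_of_abs_le (hlab a ha).1 (hlab a ha).2 hL
  -- one step of the induction on `#𝒜'`
  have key : ∀ A' : Finset (ℤ × ℤ), A' ⊆ A →
      (∀ A'' : Finset (ℤ × ℤ), A'' ⊆ A → A''.card < A'.card →
        dirichletEnergy V A triPoint ≤ relaxedDirichletEnergy V A A'' y) →
      dirichletEnergy V A triPoint ≤ relaxedDirichletEnergy V A A' y := by
    intro A' hA' ih
    by_cases h13 : ∀ x, (x ∉ A ∨ x ∈ A') → ∀ x', (x' ∉ A ∨ x' ∈ A') → x ≠ x' →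
        1 - α < dist (y x) (y x')
    · -- (13): periodize and apply (44) for every large `L`
      -- a radius containing the hole and the free particles
      set R : ℝ := ∑ a ∈ A, ‖triPoint a‖ + 1 with hRdef
      have hsum0 : 0 ≤ ∑ a ∈ A, ‖triPoint a‖ := Finset.sum_nonneg fun a _ => norm_nonneg _
      have hR0 : 0 ≤ R := by rw [hRdef]; linarith
      have hAR : ∀ a ∈ A, ‖triPoint a‖ ≤ R := fun a ha => by
        rw [hRdef]
        linarith [Finset.single_le_sum (fun a _ => norm_nonneg (triPoint a)) ha]
      have hyR : ∀ x ∈ A', ‖y x‖ ≤ R := fun x hx => by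
        obtain ⟨a, ha, hd⟩ := exists_dist_triPoint_le_one_of_lt_dist hα10 hy hA' h13 hx
        have h4 := norm_sub_norm_le (y x) (triPoint a)
        rw [← dist_eq_norm] at h4
        rw [hRdef]
        linarith [Finset.single_le_sum (fun a _ => norm_nonneg (triPoint a)) ha]
      -- the error constant
      set K : ℝ := ((A'.card : ℝ) + A.card) ^ 2 * (2 * α * S) with hKdef
      have hK0 : 0 ≤ K := by positivity
      -- for every admissible `L`: `E_𝒜(A₂) − E(𝒜',{y}) ≤ K/L⁵`
      have hL_est : ∀ L : ℕ, 2 * N + 2 ≤ L → 4 * R + 3 ≤ (L : ℝ) →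
          dirichletEnergy V A triPoint - relaxedDirichletEnergy V A A' y ≤ K / (L : ℝ) ^ 5 := by
        intro L hLN hLR
        have hL : 0 < L := by omega
        have hAY : A ⊆ centredCell L := hcellA L hLN
        -- (13) for the periodized pair
        have hXA : ∀ k, k ∉ dirichletSupport A A' → k ∈ A := fun k hk => by
          by_contra h
          exact hk (Or.inl h)
        have h13per := lt_dist_periodize hL hα hXA hy
          (fun k hk k' hk' hne => h13 k hk k' hk' hne)
          (fun k hk hkA => hyR k ((mem_dirichletSupport.1 hk).resolve_left fun h => h hkA)) hAY
          (by linarith : 2 * R + 2 ≤ (L : ℝ))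
        have h44L := h44 L hL _ _ (isPeriodicSet_periodizeSet hL _) (isPeriodic_periodize hL y)
          h13per
        rw [mainEstimateRHS, card_cellClasses_periodizeSet_dirichletSupport hL hAY] at h44L
        have hcmp := relaxedPeriodicEnergy_periodize_le hV hL hy hA' hAY hR0 hyR hAR hLR
        have hSnn : 0 ≤ 1 / C * (shortBondSum α L (periodizeSet hL (dirichletSupport A A'))
            (periodize hL y) (fun r => renormalizedPotential V r + 1) / 2) := by
          have := hV.toIsNormalized.shortBondSum_nonneg (L := L)
            (X := periodizeSet hL (dirichletSupport A A')) (y := periodize hL y) hα1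
          positivity
        have hDnn : (0 : ℝ) ≤ (defectClasses α L (periodizeSet hL (dirichletSupport A A'))
            (periodize hL y)).card := Nat.cast_nonneg _
        have hdiff0 : (0 : ℝ) ≤ (A \ A').card := Nat.cast_nonneg _
        have e : ((A'.card : ℝ) + A.card) ^ 2 * (2 * α / (L : ℝ) ^ 5 * S) = K / (L : ℝ) ^ 5 := by
          rw [hKdef]
          ring
        linarith [e.le, e.ge]
      -- `K / L⁵ → 0`: the difference is `≤ 0`
      by_contra hgt
      rw [not_le] at hgt
      set δ : ℝ := dirichletEnergy V A triPoint - relaxedDirichletEnergy V A A' y with hδ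
      have hδ0 : 0 < δ := by rw [hδ]; linarith
      -- choose `L` past all thresholds and with `K / L < δ`
      set L : ℕ := max (max (2 * N + 2) ⌈4 * R + 3⌉₊) (⌈K / δ⌉₊ + 1) with hLdef
      have hLN : 2 * N + 2 ≤ L := (le_max_left _ _).trans (le_max_left _ _)
      have hLR : 4 * R + 3 ≤ (L : ℝ) :=
        (Nat.le_ceil _).trans (by exact_mod_cast (le_max_right _ _).trans (le_max_left _ _))
      have hL1 : (1 : ℝ) ≤ L := by
        have : 1 ≤ L := le_trans (by omega : 1 ≤ 2 * N + 2) hLN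
        exact_mod_cast this
      have hLK : K / δ < (L : ℝ) := by
        have h1 : K / δ ≤ (⌈K / δ⌉₊ : ℝ) := Nat.le_ceil _
        have h2 : ((⌈K / δ⌉₊ + 1 : ℕ) : ℝ) ≤ L := by exact_mod_cast le_max_right _ _
        push_cast at h2
        linarith
      have hL5 : (L : ℝ) ≤ (L : ℝ) ^ 5 := by
        calc (L : ℝ) = (L : ℝ) ^ 1 := (pow_one _).symm
          _ ≤ (L : ℝ) ^ 5 := pow_le_pow_right₀ hL1 (by norm_num)
      have hL0 : (0 : ℝ) < L := by linarith
      have hsmall : K / (L : ℝ) ^ 5 < δ :=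
        calc K / (L : ℝ) ^ 5 ≤ K / L := div_le_div_of_nonneg_left hK0 hL0 hL5
          _ < δ := by rw [div_lt_iff₀ hL0]; rw [div_lt_iff₀ hδ0] at hLK; linarith
      have h := hL_est L hLN hLR
      linarith
    · -- ¬(13): remove the free particles of a crowded disc
      push Not at h13
      obtain ⟨x₁, hx₁, x₂, hx₂, hne, hle⟩ := h13
      obtain ⟨A'', hA''sub, hA''ne, hlt⟩ :=
        exists_relaxedDirichletEnergy_lt hα hαlt hV hy hx₁ hx₂ hne hle
      have hcard : (A' \ A'').card < A'.card := by
        rw [Finset.card_sdiff_of_subset hA''sub]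
        have h1 := Finset.card_pos.2 hA''ne
        have h2 := Finset.card_le_card hA''sub
        omega
      linarith [ih (A' \ A'') (Finset.sdiff_subset.trans hA') hcard]
  -- strong induction on `#𝒜'`
  suffices H : ∀ n : ℕ, ∀ A' : Finset (ℤ × ℤ), A' ⊆ A → A'.card = n →
      dirichletEnergy V A triPoint ≤ relaxedDirichletEnergy V A A' y from H _ A' hA' rfl
  intro n
  induction n using Nat.strong_induction_on with
  | _ n ih =>
    intro A' hA' hn
    exact key A' hA' fun A'' hA'' hlt => ih _ (hn ▸ hlt) A'' hA'' rfl

/-- **The clamped lattice `(𝒜, x ↦ x)` is a minimizer of the relaxed Dirichlet problem**, for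
every admissible `V` (continuous or not), given (44) with a uniform constant
(`dirichletEnergy_triPoint_le_of_mainEstimate`; `E(𝒜, {id}) = E_𝒜(A₂)` definitionally).
[cite: Theil2006, §3 Proof of Corollary 1.3 («Let 𝒜_min, y_min be the minimizer of E(·,·)», preprint p. 14)] -/
theorem isRelaxedDirichletMinimizer_self_triPoint_of_mainEstimate (hα : 0 < α)
    (hαlt : α < 1 / 13447168) (hV : IsAdmissible α V) {C : ℝ} (hC : 0 < C)
    (h44 : ∀ L : ℕ, 0 < L → ∀ (X : Set (ℤ × ℤ)) (y : ℤ × ℤ → Plane), IsPeriodicSet L X →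
      IsPeriodic L y → (∀ x ∈ X, ∀ x' ∈ X, x ≠ x' → 1 - α < dist (y x) (y x')) →
        mainEstimateRHS C α V L X y ≤ relaxedPeriodicEnergy V L X y / 2)
    (A : Finset (ℤ × ℤ)) : IsRelaxedDirichletMinimizer V A A triPoint :=
  ⟨Finset.Subset.refl A, isClampedOutside_triPoint A, fun _A'' _y' hA'' hy' =>
    (relaxedDirichletEnergy_self V A triPoint).trans_le
      (dirichletEnergy_triPoint_le_of_mainEstimate hα hαlt hV hC h44 hA'' hy')⟩

/-- **Existence of a minimizer of the relaxed Dirichlet problem for EVERY admissible `V`, from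
(44) (uniform `C`)** — the hypothesis `hexDir` of `Theil2006_dirichletGroundStates_of_mainEstimate`
and `Theil2006_periodic_and_dirichletGroundStates_of_mainEstimate`, in exactly their shape,
DISCHARGED modulo (44): "Let `𝒜_min, y_min` be the minimizer of `E(·, ·)`" (p. 14) — here the
clamped lattice itself. [cite: Theil2006, §3 Proof of Corollary 1.3 (preprint p. 14)] -/
theorem exists_isRelaxedDirichletMinimizer_of_mainEstimate
    (h44 : ∃ α₁ : ℝ, 0 < α₁ ∧ ∀ α : ℝ, 0 < α → α < α₁ → ∀ V : ℝ → ℝ, IsAdmissible α V →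
      ∃ C : ℝ, 0 < C ∧ ∀ L : ℕ, 0 < L → ∀ (X : Set (ℤ × ℤ)) (y : ℤ × ℤ → Plane),
        IsPeriodicSet L X → IsPeriodic L y →
          (∀ x ∈ X, ∀ x' ∈ X, x ≠ x' → 1 - α < dist (y x) (y x')) →
            mainEstimateRHS C α V L X y ≤ relaxedPeriodicEnergy V L X y / 2) :
    ∃ α₃ : ℝ, 0 < α₃ ∧ ∀ α : ℝ, 0 < α → α < α₃ → ∀ V : ℝ → ℝ, IsAdmissible α V →
      ∀ A : Finset (ℤ × ℤ), ∃ (A' : Finset (ℤ × ℤ)) (y : ℤ × ℤ → Plane),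
        IsRelaxedDirichletMinimizer V A A' y := by
  obtain ⟨α₁, hα₁, h44⟩ := h44
  refine ⟨min α₁ (1 / 13447168), lt_min hα₁ (by norm_num), fun α hα hαlt V hV A => ?_⟩
  obtain ⟨C, hC, h⟩ := h44 α hα (hαlt.trans_le (min_le_left _ _)) V hV
  exact ⟨A, triPoint, isRelaxedDirichletMinimizer_self_triPoint_of_mainEstimate hα
    (hαlt.trans_le (min_le_right _ _)) hV hC h A⟩

end DirichletExistence

end Theil2006

/-! ### Theorem 1.2 (corrected) and Corollary 1.3 from (44) alone -/

open Theil2006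

/-- **Theil 2006, Theorem 1.2 (corrected: up to a rigid motion) and Corollary 1.3 from ONE proof
of (44), for EVERY admissible `V`** — `Theil2006_periodic_and_dirichletGroundStates_of_mainEstimate`
with its two existence hypotheses discharged by `exists_isRelaxedMinimizer_of_mainEstimate` and
`exists_isRelaxedDirichletMinimizer_of_mainEstimate`: given the main estimate (44) for the
relaxed periodic problem with a constant `C` independent of `L` (the paper's `C` is universal),
both named facts `Theil2006_periodicGroundStates_upToRotation` and
`Theil2006_dirichletGroundStates` follow, with no continuity assumption on `V` beyond (1)–(5).
[cite: Theil2006, §1 Theorem 1.2, Corollary 1.3; §3 (44) and the proofs of Theorem 1.2 and Corollary 1.3 (preprint pp. 13–15)] -/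
theorem Theil2006_periodic_and_dirichletGroundStates_of_mainEstimate'
    (h44 : ∃ α₁ : ℝ, 0 < α₁ ∧ ∀ α : ℝ, 0 < α → α < α₁ → ∀ V : ℝ → ℝ, IsAdmissible α V →
      ∃ C : ℝ, 0 < C ∧ ∀ L : ℕ, 0 < L → ∀ (X : Set (ℤ × ℤ)) (y : ℤ × ℤ → Plane),
        IsPeriodicSet L X → IsPeriodic L y →
          (∀ x ∈ X, ∀ x' ∈ X, x ≠ x' → 1 - α < dist (y x) (y x')) →
            mainEstimateRHS C α V L X y ≤ relaxedPeriodicEnergy V L X y / 2) :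
    Theil2006_periodicGroundStates_upToRotation ∧ Theil2006_dirichletGroundStates :=
  Theil2006_periodic_and_dirichletGroundStates_of_mainEstimate h44
    (exists_isRelaxedMinimizer_of_mainEstimate (Theil2006.mainEstimate_perL_of_uniform h44))
    (exists_isRelaxedDirichletMinimizer_of_mainEstimate h44)

end Literature.MathematicalPhysics.StatisticalMechanics

end
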